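/-
# SplitsliceFam — door 5♮ over a general coefficient ring: the abstract-family doors (+ SLACK doors) + BASE CHANGE to the crux's conclusion

Crux workfile for `TwoVariableEulerSystemDivisibility` (stmt-BirchSwinnertonDyer-20728), line `ratlift` (skeleton of record
`Lines/ratlift.lean`, untouched), explicit-unit bsd-idea-14 (lens=complete). Companion of `SplitsliceExt.lean` (v1.16, at the
200 000 B workfile cap, FROZEN): this file is the LIVE home of the (T6)(β) chain. NO `sorry`, NO new `def … : Prop`, hypotheses
passed explicitly. Nothing here proves the crux, the route or BSD.

## Contents
* §F1 GENERIC COMMUTATIVE ALGEBRA — verbatim copies (same names, this file's namespace) of `SplitsliceExt.lean` v1.16 §10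
  `height_le_two_of_mem_minimalPrimes_span_pair`, §11 `section ModuleDoorGeneric` (coinvariant fibres, descent of semilinear maps,
  pseudo-null images, `char` of products of cyclic modules, the prime-element structure theorem `exists_isPseudoIsomorphism_pi_prime`,
  the junk convention `charIdeal_eq_top_of_not_isTorsion`) and `section AbstractDoor` (`finite_setOf_isPrime_annihilator_le` =
  [OcSh15] Lemma 8.5 at `dim 3`; the one-map door `charIdeal_fibre_le_map`). Crux workfiles cannot import one another on the farm,
  hence the copy (≈ 470 lines); `SplitsliceExt.lean` keeps its copy for its `ℤ_p`-doors §10–§11♯.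
* §F2 THE DOORS FOR AN ABSTRACT OCHIAI–SHIMOMOTO FAMILY — verbatim copy of `SplitsliceExt.lean` v1.16 §12 (`fam_*`, Theorems A/B for
  any Noetherian local factorial domain `A` with `ht 𝔪_A = 3`, quotients `Λ` with `ht 𝔪_Λ > 1`, family `θ_n : A ↠ Λ`, `ker θ_n = (x_n)`
  prime ((T1)), avoidance (B) of [OcSh15] Def. 8.1 ((T2))) and the DVR ring inputs for `W⟦T₁,T₂⟧`, `W⟦T⟧` — minus the `ℤ_p`
  instance `…_via_fam` (which needs `SplitsliceExt` §9).
* §F3 BASE CHANGE ((β) steps (iii)+(v), NEW): `isTorsion_baseChange_of_injective`; the PUSH LEMMA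
  `span_singleton_map_le_of_le_charIdeal_baseChange` — for a Noetherian UFD `R`, a Noetherian UFD `R`-algebra `S` with injective
  structure map, a finite `R`-module `M` and ANY ring map `κ : S → T`: `(g) ≤ char_S(S ⊗_R M)` ⇒ `(κ g) ≤ (char_R M)·T` along
  `κ ∘ algebraMap` (torsion case: `char_R M` is principal (`SkinnerUrban2014.exists_charIdeal_eq_span_prod`) and
  `char_S(S ⊗ M) ≤ char_R(M)·S` is the TREE theorem `SkinnerUrban2014.charIdeal_baseChange_le_span_singleton` = [SkinnerUrban2014]
  Cor. 3.2.9 (ii) (Fitting ideals commute with base change); non-torsion case: junk `char_R M = ⊤`).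
* §F4 THE CRUX'S CONCLUSION SHAPE FROM A DIVISIBILITY OVER `S ⊇ Λ₂` (NEW): at `X_Gr,2 = WeierstrassCurve.XGr₂ …` (finite over `Λ₂`:
  instance binder, the landed `xGr₂_module_finite`), for any such `S` and `κ : S → 𝒪_{ℂ_p}⟦T₁,T₂⟧` with `κ ∘ algebraMap = toUnr₂ p J`:
  `(g) ≤ char_S(S ⊗_{Λ₂} X_Gr,2)`, `u` a unit ⇒ `(u·κ g) ≤ (XGr₂.charIdeal …).map (toUnr₂ p J)` — LITERALLY the conclusion of
  `TwoVariableEulerSystemDivisibility` for `G = u·κ g` (`xGr₂_span_singleton_le_map_toUnr₂_of_baseChange`); the instance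
  `S = W⟦T₁,T₂⟧`, `W` any DVR with an injective `ℤ_p → W`, `κ = map (map ι)` (`…_powerSeries`); and THE (β) DOOR ASSEMBLED
  (`xGr₂_span_singleton_le_map_toUnr₂_of_frequently_fam`): an abstract family `θ_n : W⟦T₁,T₂⟧ ↠ Λ'` with (T1)+(B), `θ_n`-fibres of
  `W⟦T₁,T₂⟧ ⊗_{Λ₂} X_Gr,2` pseudo-isomorphic to `Λ'`-modules `X_n`, and `θ_n g ∈ char_{Λ'}(X_n)` for infinitely many `n`
  ⇒ the crux's conclusion for `G = u · map (map ι) g`; and its instance AT `W = unrIntegers p ⊂ ℂ_p` (the ring of the crux's Katz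
  period `Ωp`) with the crux's own `J`-binder and print's `J₀ : unrIntegers p → 𝒪_{ℂ_p}` (`…_fam_unr`; injectivity of
  `ℤ_p → unrIntegers p` and `J₀ ∘ algebraMap = J` PROVED; the ONE remaining ring input is the instance binder
  `[IsDiscreteValuationRing (unrIntegers p)]` — a TREE THEOREM (critic V#26dj P1, corrected at v1.5):
  `Summit.BirchSwinnertonDyer.Rank1Residual.X2.HidaLimitAlgebra.isDiscreteValuationRing_unrIntegers`
  (`Summits/BirchSwinnertonDyer/Rank1Residual/X2/HidaLimitCongruenceAlgebra.lean` :134; the consumer's one line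
  `haveI := HidaLimitAlgebra.isDiscreteValuationRing_unrIntegers (p := p)`; kept as a binder here so that this workfile
  imports Literature only); likewise `¬ IsUnit (p : unrIntegers p)` = `HidaLimitAlgebra.irreducible_natCast_p.not_isUnit` (:87)).
  What it leaves: the CONSTRUCTION of such a family over `W⟦T₁,T₂⟧` ((β)(ii): `SplitsliceExt` §5/§7/§9 read in `W`), the ARITHMETIC
  control + one-variable divisibilities ((β)(iv)), the `W`-rationality of the crux's `G` up to a unit ((β)(vi)), and — at
  `W = unrIntegers p` — its DVR property ((β)(vii)).
* §F5 TRANSPORT OF (B) (v1.2, NEW; (β)(ii)'s (T2) half made FORMAL): for a family PUSHED from `Λ₂` (`x_n^W = algebraMap x_n`),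
  avoidance (B) over `W⟦T₁⟧⟦T₂⟧` FOLLOWS from (B) over `Λ₂` whenever `W` is a DVR with `p ≠ 0` — non-maximal primes of `W⟦T₁⟧⟦T₂⟧`
  contract to non-maximal primes of `Λ₂` (`fam_avoid_map_of_comap`, `eq_maximalIdeal_of_C_C_mem`, `maximalIdeal_le_of_natCast_mem`,
  `comap_ne_maximalIdeal_powerSeries`, `fam_avoid_powerSeries_of_avoid`).
* §F6 THE (β) DOOR AT `unrIntegers p` FOR A PUSHED FAMILY (v1.2, NEW): `…_of_frequently_pushedFam_unr` = `…_fam_unr` with (B) taken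
  OVER `Λ₂` (`hB₀`; for `SplitsliceExt` §9's explicit sequence = its theorem `setOf_curveElt_mem_finite`) and discharged over
  `(unrIntegers p)⟦T₁⟧⟦T₂⟧` by §F5 (`p ≠ 0` by characteristic zero of `ℂ_p`). FAMILY INPUT LEFT = (T1) only: the surjections
  `θ_n^W` with `ker θ_n^W = (algebraMap x_n)`, `algebraMap x_n` prime, onto one factorial `Λ'` with `1 < ht 𝔪` (`SplitsliceExt`
  §3/§7 read in `W`: `p`-adic evaluation `ev` and `deepChar` with `W`-coefficients).

* §F7 THE OUTER-VARIABLE SPECIALISATION BY WEIERSTRASS DIVISION (v1.3, NEW; (β)(ii)'s (T1) half, ring-general): for a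
  complete local ring `A` (`[IsAdicComplete 𝔪_A A]`) and `s ∈ 𝔪_A`, `outerChar s : A⟦X⟧ ↠ A` (`C a ↦ a`, `X ↦ s`) via Mathlib's
  `Polynomial.IsDistinguishedAt.algEquivQuotient` ([Washington1997] Prop. 7.2) for the distinguished polynomial `X − s`, with
  `ker = (X − C s)` and `X − C s` PRIME when `A` is a domain (`isDistinguishedAt_X_sub_C`, `outerChar_C`, `outerChar_X`,
  `ker_outerChar`, `outerChar_surjective`, `prime_X_sub_C`). No `p`-adic analysis: the OUTER-SOLVED form `X − C s` of a deep
  graph member (the swap-frame image of `SplitsliceExt`'s `λ_{a,d}`; `s = d(1+T)^a − 1`) is handled by Weierstrass division.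
* §F8 THE (β) DOOR AT `unrIntegers p`, FAMILY BUILT (v1.3, NEW): `…_of_frequently_outerFam_unr` — for `s₀ : ℕ → ℤ_p⟦T⟧` with
  `s₀ n (0) ∈ pℤ_p` and (B) over `Λ₂` for `X − C(s₀ n)`, the family `θ_n = outerFam … n` has (T1) (§F7) and (T2) (§F5), so
  ONLY the arithmetic (`φ_n`, `hX`, `h`), the `W`-rationality of `G` and (B) over `Λ₂` for the chosen `s₀` remain as inputs;
  the three ring binders about `unrIntegers p` (DVR, `𝔪`-adic completeness of `(unrIntegers p)⟦T⟧`, `p` a non-unit) are ALL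
  TREE THEOREMS (V#26dj P1 / V#26dm P2; names in §F8's docblock), kept as binders only because this workfile imports no
  `Summits` module.

* §F9 (B) FOR THE OUTER-SOLVED FAMILY FROM `SplitsliceExt` §9's (B) (v1.4, NEW): (B) is invariant under ring automorphisms
  of a local ring (`fam_avoid_ringEquiv`); the tree's swap frame `frameSubst ℤ_p swapFrame` carries the inner-solved member
  `λ_{a,c} = (1+T₂) − c(1+T₁)^a` to `X − C (c(1+T)^a − 1)` (`frameSubst_swapFrame_lineExpr`, `swapSeries`,
  `swap_avoid_of_avoid`); the door `…_of_frequently_curveFam_unr` takes (B) over `Λ₂` for `λ_{a_n,c_n}` in EXACTLY the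
  shape `SplitsliceExt.setOf_curveElt_mem_finite` proves it for `a_n = n`, `c_n = curveTwist n` (the identification
  `curveElt n = (1 + C X) − C (C c_n) · map C (binomialSeries ↑n)` is `rfl`, checked in scratch against verbatim copies of
  `bpow`/`lineElt`/`curveElt`; the two workfiles cannot import each other on the farm, so the one-line junction is left to
  the merging Theorems file). After v1.4 the (β) chain's inputs are: ARITHMETIC (control `φ_n`/`hφk`/`hX` + one-variable
  divisibilities `h` along `θ_n = curveFam … n`) and the `W`-rationality of `G` (the three ring binders about
  `unrIntegers p` being tree theorems, discharged by the consumer's three `haveI`).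

* §F10 THE SLACK (RATIONAL) DOORS FOR AN ABSTRACT FAMILY (v1.6, NEW): a fixed slack element `d ∈ A` and PER-LINE exponents
  `t_n`: `fam_mem_minimalPrimes_span_pair_of_mem` (the key step of the ring doors, isolated), the prime form
  `fam_dvd_of_prime_of_frequently_dvd_pow_mul` (`π ∤ d`, `θ_n π ∣ θ_n(d^{t_n} F)` i.o. ⇒ `π ∣ F`; minimal primes of `(π,F)`
  AND `(π,d)` avoided at once), the general form `fam_exists_dvd_pow_mul_of_frequently` (`f ≠ 0`, `θ_n f ∣ θ_n(d^{t_n} F)` i.o.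
  ⇒ `∃ a, f ∣ d^a F`; induction on the factorisation of `f`), Theorem B slack
  `fam_exists_span_singleton_le_charIdeal_of_frequently` (+ `'` no-torsion, + `_of_arePseudoIsomorphic` control form:
  `θ_n(d^{t_n} G) ∈ char_Λ(F_n)` i.o. ⇒ `∃ a, (d^a G) ⊆ char_A N`).
* §F11 THE SLACK DOOR AT `X_Gr,2` (v1.6, NEW): `algebraMap_unrIntegers_injective`; `…_of_frequently_fam_slack` (abstract
  `W`-family, any DVR `W`); `…_of_frequently_curveFam_unr_slack` (at `unrIntegers p` along `curveFam`, any slack `d`); and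
  `…_of_frequently_curveFam_unr_pSlack` (`d = p`, per-line input `∃ t, p^t · θ_n g ∈ char(X_n)` i.o.) concluding
  `∃ e, Ideal.span {(p : 𝒪_{ℂ_p}⟦T₁⟧⟦T₂⟧)^e * (u · map (map J₀) g)} ≤ (XGr₂.charIdeal …).map (toUnr₂ p J)` — the conclusion SHAPE of
  the skeleton's research stub `stub_ratEulerSystemSS` (`W := W.baseChange K`, `G = u · map (map J₀) g`). The per-line
  `p`-power (tempered one-variable classes, lattice indices) no longer needs to be uniform in the line.
* §F12 THE FRAME PIN AND THE DOOR ON THE STUB'S OWN `G` (v1.7, NEW; (β)(vi) SPLIT): `isGreenbergLFunctionAnyRoot₂_eq_of_rich` —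
  two series in the SAME Greenberg value frame over the same Katz series `LK` AGREE at every admissible interpolation point
  (`IsGreenbergLFunctionAnyRoot₂.hasValueAt₂`), so by the tree's identity principle for `𝒪_{ℂ_p}⟦T₁⟧⟦T₂⟧`
  (`IntSeries.eq_of_infinite_hasValueAt₂_eq_fibred`: agreement on a fibred-infinite set inside closed polydiscs of radius `< 1`)
  they are EQUAL as soon as the admissible points are RICH (hypothesis `hrich`, spelled out: a fibred-infinite set of points
  `(r(g₁) − 1, r(g₂) − 1)` carried by everywhere-unramified Hecke characters of type `(−(m+1), n+1)` with avatar through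
  `(κ₁, κ₂)`, each with its CM newform, entire continuation and `LK`-value); and `…_curveFam_unr_pSlack_of_frame` — the `p`-slack
  door stated for the crux's OWN `G` (any `G` in the frame), the `W`-rationality input (vi) replaced by (vi-a) a PIN hypothesis
  (= `…_eq_of_rich`'s conclusion shape) and (vi-b) ONE `unrIntegers p`-rational-up-to-unit series `u · map (map J₀) g` in the
  same frame. Conclusion VERBATIM `stub_ratEulerSystemSS`'s `∃ e, Ideal.span {(p)^e * G} ≤ (XGr₂.charIdeal …).map (toUnr₂ p J)`.
  (v1.8:) `rich_of_supply` / `isGreenbergLFunctionAnyRoot₂_eq_of_supply` — the richness hypothesis in the SHAPE print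
  produces it: a GRID `(ξ i j, r i j)` of everywhere-unramified characters with avatars through `(κ₁, κ₂)` ((S1)), per-point
  auxiliary data ((S2)) and spread points ((S4): first coordinate a function of `i`, injective; second injective in `j`;
  all of norm `≤ ‖ϖ‖ < 1`) ⇒ `hrich`; the frame's `LK`-value demand ((S3)) is discharged in-kernel
  (`IntSeries.hasValueAt₂_tsum` + `‖r(g₂)² − 1‖ < 1`); the rest is bookkeeping (`Set.infinite_range_of_injective`).
* §F13 THE TWO-CHARACTER SUPPLY (v1.9, NEW): `rich_of_two_characters` — the grid (S1)+(S4) of §F12 from TWO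
  everywhere-unramified Hecke characters `A` (type `(−a₁, a₂)`), `B` (type `(−b₁, b₂)`, `b₁, b₂ ≥ 1`) with avatars `rA`, `rB`
  through `(κ₁, κ₂)` and THREE value conditions (`rB(g₁) = 1`; the powers of `rA(g₁)` and of `rB(g₂)` injective): grid
  `ξ_{ij} = B^{j+1} A^{i+1}`, avatar the twist power `rA^{⊗(i+1)} ⊗ det rB^{⊗(j+1)}` (`twistPow`; Serre's dictionary iterated:
  tree `IsPAdicAvatarOf.mul_twist`, `factorsThroughPair_twist_detChar`, `avatarValueAt_twist_detChar`), points
  `(rA(g₁)^{i+1} − 1, rB(g₂)^{j+1} rA(g₂)^{i+1} − 1)` in the disc of radius `max ‖· − 1‖ < 1` (tree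
  `norm_avatarValueAt_sub_one_lt_of_factorsThroughPair` + ultrametric bookkeeping); (S2) stays per grid point.

Versions: v1.0 bbfd4e11081b (§F1–§F4 minus `_fam_unr`), v1.1 5011b806b5c9 (+ `_fam_unr`), v1.2 a3efd4ed40dd (+ §F5, §F6),
v1.3 58d31f6fed16 (+ §F7, §F8), v1.4 57e72488978e (+ §F9), v1.5 ec12e6d83fee (docstrings only — critic V#26dj price P1: the DVR
property of `unrIntegers p` and `¬ IsUnit p` are tree theorems of `HidaLimitCongruenceAlgebra.lean`; no Lean change), v1.6 (this:
+ §F10, §F11 — the slack doors; docstrings — critic V#26dm price P2: `𝔪`-adic completeness of `W⟦T⟧` for a complete local `W` IS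
the tree theorem `Literature.NumberTheory.GaloisRepresentations.powerSeries_isAdicComplete_maximalIdeal` over
`Theorems.CongruentShaFreeCutUnrSeriesWeierstrass.isAdicComplete_maximalIdeal`), v1.7 c114615d3d64 (+ §F12 — frame PIN by the
tree's identity principle `IntSeriesIdentityPrinciple.lean` and the `p`-slack door on the frame's own `G`; imports
`BurungaleSkinnerTianWan2024.GreenbergMainStatementOPEN`, `IntSeriesIdentityPrinciple` added), v1.8 24ce95e7c94b (+ `rich_of_supply`,
`isGreenbergLFunctionAnyRoot₂_eq_of_supply` in §F12 — richness from a grid supply; no import change), v1.9 (this: + §F13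
`rich_of_two_characters` with `twistPow` and its bookkeeping; import `DeShalit1987.KatzMeasurePointTransport` added; the unused
`[IsDiscreteValuationRing (unrIntegers p)]` binder of `algebraMap_unrIntegers_injective` dropped — critic V#26dn t1).

References: [OchiaiShimomoto2015] = arXiv:1108.4708 Def. 8.1, Lemma 8.2, 8.5, 8.6, Thm. 8.8; [SkinnerUrban2014] Cor. 3.2.9 (ii);
[BourbakiAC5to7] Ch. VII §4.4 Thm. 5, §4.5; [Matsumura1987] Thm. 15.4, 20.3; [Washington1997] §7.1 Prop. 7.2, §13.2; [YanZhu2024MainConjNonCM]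
statement 4.1 (2) (arXiv:2412.20078v4) — via `Literature/NumberTheory/EllipticCurves/SkinnerUrban2014/CharacteristicIdealBaseChangeProofs.lean`,
`Literature/NumberTheory/IwasawaTheory/IwasawaAlgebraTwoVarRegularProofs.lean`, `Literature/NumberTheory/EllipticCurves/IwasawaAlgebra{Structure,
CharIdeal,SemilinearCharIdeal,PseudoNull}Proofs.lean`, `YanZhu2026/GreenbergMainTheorems.lean`.
-/

import Mathlib.RingTheory.PowerSeries.Trunc
import Mathlib.RingTheory.Filtration
import Mathlib.RingTheory.Ideal.KrullsHeightTheorem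
import Mathlib.RingTheory.Ideal.MinimalPrime.Noetherian
import Mathlib.RingTheory.PowerSeries.NoZeroDivisors
import Literature.NumberTheory.EllipticCurves.IwasawaAlgebraTwoVarGeneratorChange
import Literature.NumberTheory.EllipticCurves.IwasawaAlgebraUnitTwistPair
import Literature.NumberTheory.EllipticCurves.DeShalit1987.KatzMeasureMonomialLinesPAdic
import Literature.NumberTheory.IwasawaTheory.IwasawaAlgebraTwoVarRegularProofs
import Literature.NumberTheory.EllipticCurves.IwasawaAlgebraStructureProofs
import Literature.NumberTheory.EllipticCurves.IwasawaAlgebraRankOneIdealProofs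
import Literature.NumberTheory.EllipticCurves.IwasawaAlgebraCharIdealProofs
import Literature.NumberTheory.EllipticCurves.IwasawaAlgebraSemilinearCharIdealProofs
import Literature.NumberTheory.EllipticCurves.IwasawaAlgebraProofs
import Literature.NumberTheory.EllipticCurves.IwasawaAlgebraPseudoNullProofs
import Mathlib.RingTheory.Support
import Mathlib.RingTheory.UniqueFactorizationDomain.Ideal
import Mathlib.RingTheory.Artinian.Module
import Mathlib.RingTheory.FiniteLength
import Mathlib.RingTheory.KrullDimension.Field
import Literature.NumberTheory.EllipticCurves.YanZhu2026.GreenbergMainTheorems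
import HarnessLib
import Literature.NumberTheory.EllipticCurves.SkinnerUrban2014.CharacteristicIdealBaseChangeProofs
import Mathlib.RingTheory.PowerSeries.WeierstrassPreparation
import Mathlib.RingTheory.Polynomial.Quotient
import Literature.NumberTheory.EllipticCurves.BurungaleSkinnerTianWan2024.GreenbergMainStatementOPEN
import Literature.NumberTheory.EllipticCurves.IntSeriesIdentityPrinciple
import Literature.NumberTheory.EllipticCurves.DeShalit1987.KatzMeasurePointTransport

set_option linter.dupNamespace false

namespace Summit.BirchSwinnertonDyer.BirchSwinnertonDyer.Cruxes.TwoVariableEulerSystemDivisibility.SplitsliceFam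

open Literature.NumberTheory.EllipticCurves

open scoped TensorProduct

/-! ## §F1 Generic commutative algebra (verbatim from `SplitsliceExt.lean` v1.16 §10–§11) -/


/-- Krull's height theorem for two generators: a prime minimal over `(a, b)` has height `≤ 2`.
[cite: arXiv:1108.4708, Lemma 8.6] -/
theorem height_le_two_of_mem_minimalPrimes_span_pair {R : Type*} [CommRing R] [IsNoetherianRing R] (a b : R)
    {P : Ideal R} (hP : P ∈ (Ideal.span {a, b}).minimalPrimes) : P.height ≤ 2 := by
  classical
  refine (Ideal.height_le_spanRank_toENat_of_mem_minimalPrimes _ _ hP).trans ?_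
  rw [Submodule.spanRank_toENat_eq_iInf_finset_card]
  have hs : Submodule.span R (({a, b} : Finset R) : Set R) = Ideal.span {a, b} := by
    rw [Finset.coe_insert, Finset.coe_singleton]
  refine (iInf_le _ ⟨{a, b}, hs⟩).trans ?_
  exact_mod_cast Finset.card_le_two

/-! ### Coinvariant fibres, descent, pseudo-null images, structure theorem (verbatim `SplitsliceExt` §11 `ModuleDoorGeneric`) -/

section ModuleDoorGeneric

variable {R S : Type*} [CommRing R] [CommRing S] (θ : R →+* S)

variable {N : Type*} [AddCommGroup N] [Module R N] {F : Type*} [AddCommGroup F] [Module S F]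
  {P : Type*} [AddCommGroup P] [Module S P]

/-- **Descent along a surjective semilinear map.** For `θ : R → S` surjective, a surjective `θ`-semilinear
`φ : N → F` and a `θ`-semilinear `χ : N → P` vanishing on `ker φ`, the induced `S`-linear map `F → P`
(`χ = ψ̄ ∘ φ`; Bourbaki A II §1.8). [folklore] -/
noncomputable def descend (hθ : Function.Surjective θ) (φ : N →ₛₗ[θ] F) (hφ : Function.Surjective φ)
    (χ : N →ₛₗ[θ] P) (hker : ∀ y, φ y = 0 → χ y = 0) : F →ₗ[S] P where
  toFun v := χ (Function.surjInv hφ v)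
  map_add' v w := by
    have h : φ (Function.surjInv hφ (v + w) - (Function.surjInv hφ v + Function.surjInv hφ w)) = 0 := by
      rw [map_sub, map_add, Function.surjInv_eq hφ, Function.surjInv_eq hφ, Function.surjInv_eq hφ, sub_self]
    have := hker _ h
    rwa [map_sub, map_add, sub_eq_zero] at this
  map_smul' c v := by
    obtain ⟨a, rfl⟩ := hθ c
    have h : φ (Function.surjInv hφ (θ a • v) - a • Function.surjInv hφ v) = 0 := by
      rw [map_sub, LinearMap.map_smulₛₗ, Function.surjInv_eq hφ, Function.surjInv_eq hφ, sub_self]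
    have := hker _ h
    rw [map_sub, LinearMap.map_smulₛₗ, sub_eq_zero] at this
    rw [RingHom.id_apply]
    exact this

theorem descend_apply (hθ : Function.Surjective θ) (φ : N →ₛₗ[θ] F) (hφ : Function.Surjective φ)
    (χ : N →ₛₗ[θ] P) (hker : ∀ y, φ y = 0 → χ y = 0) (y : N) :
    descend θ hθ φ hφ χ hker (φ y) = χ y := by
  show χ (Function.surjInv hφ (φ y)) = χ y
  have h : φ (Function.surjInv hφ (φ y) - y) = 0 := by rw [map_sub, Function.surjInv_eq hφ, sub_self]
  have := hker _ h
  rwa [map_sub, sub_eq_zero] at this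

theorem range_descend (hθ : Function.Surjective θ) (φ : N →ₛₗ[θ] F) (hφ : Function.Surjective φ)
    (χ : N →ₛₗ[θ] P) (hker : ∀ y, φ y = 0 → χ y = 0) :
    (LinearMap.range (descend θ hθ φ hφ χ hker) : Set P) = Set.range χ := by
  ext z
  simp only [SetLike.mem_coe, LinearMap.mem_range, Set.mem_range]
  constructor
  · rintro ⟨v, rfl⟩
    obtain ⟨y, rfl⟩ := hφ v
    exact ⟨y, (descend_apply θ hθ φ hφ χ hker y).symm⟩
  · rintro ⟨y, rfl⟩
    exact ⟨φ y, descend_apply θ hθ φ hφ χ hker y⟩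

/-- A semilinear image (over a surjective `θ`) of a finitely generated module is finitely generated. [folklore] -/
theorem moduleFinite_of_surjective_semilinear (hθ : Function.Surjective θ) [Module.Finite R N]
    (φ : N →ₛₗ[θ] F) (hφ : Function.Surjective φ) : Module.Finite S F := by
  haveI : RingHomSurjective θ := ⟨hθ⟩
  exact Module.Finite.of_surjective φ hφ

/-- A semilinear image of a module killed by `a` is torsion as soon as `θ a` is a non-zero-divisor. [folklore] -/
theorem isTorsion_of_surjective_semilinear (φ : N →ₛₗ[θ] F) (hφ : Function.Surjective φ) {a : R}
    (haN : ∀ y : N, a • y = 0) (ha : θ a ∈ nonZeroDivisors S) : Module.IsTorsion S F := by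
  intro v
  obtain ⟨y, rfl⟩ := hφ v
  exact ⟨⟨θ a, ha⟩, by rw [Submonoid.mk_smul, ← LinearMap.map_smulₛₗ, haN, map_zero]⟩

/-- The local ring `R_𝔭` at a height-one prime of a domain has infinite length over itself (it is not Artinian: an
Artinian domain is a field, of Krull dimension `0 ≠ 1 = ht 𝔭 = dim R_𝔭`). [folklore] -/
theorem length_localization_atPrime_eq_top [IsDomain R] (𝔭 : PrimeSpectrum R) (h𝔭 : 𝔭.asIdeal.height = 1) :
    Module.length (Localization.AtPrime 𝔭.asIdeal) (Localization.AtPrime 𝔭.asIdeal) = ⊤ := by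
  by_contra hne
  have hfl := Module.length_ne_top_iff.mp hne
  rw [isFiniteLength_iff_isNoetherian_isArtinian] at hfl
  haveI : IsArtinianRing (Localization.AtPrime 𝔭.asIdeal) := hfl.2
  have hF : IsField (Localization.AtPrime 𝔭.asIdeal) := IsArtinianRing.isField_of_isDomain _
  have h0 : ringKrullDim (Localization.AtPrime 𝔭.asIdeal) = 0 := ringKrullDim_eq_zero_of_isField hF
  have h1 := IsLocalization.AtPrime.ringKrullDim_eq_height 𝔭.asIdeal (Localization.AtPrime 𝔭.asIdeal)
  rw [h0, h𝔭] at h1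
  exact absurd h1 (by simp)

/-- If some `y : N` has trivial annihilator (a copy `R ↪ N`), every height-one local length of `N` is infinite
(`R_𝔭 ↪ N_𝔭`). [folklore] -/
theorem lengthAt_eq_top_of_forall_smul_eq_zero [IsDomain R] {y : N} (hy : ∀ a : R, a • y = 0 → a = 0)
    (𝔭 : PrimeSpectrum R) (h𝔭 : 𝔭.asIdeal.height = 1) : Module.lengthAt R N 𝔭 = ⊤ := by
  classical
  let g : Localization.AtPrime 𝔭.asIdeal →ₗ[Localization.AtPrime 𝔭.asIdeal]
      LocalizedModule 𝔭.asIdeal.primeCompl N :=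
    LinearMap.toSpanSingleton _ _ (LocalizedModule.mk y 1)
  have hg : Function.Injective g := by
    rw [← LinearMap.ker_eq_bot, eq_bot_iff]
    intro r hr
    rw [LinearMap.mem_ker] at hr
    induction r using Localization.induction_on with
    | H as =>
      obtain ⟨a, s⟩ := as
      have h : LocalizedModule.mk (a • y) (s * 1) = (0 : LocalizedModule 𝔭.asIdeal.primeCompl N) := by
        simpa [g, LinearMap.toSpanSingleton_apply, LocalizedModule.mk_smul_mk] using hr
      rw [← LocalizedModule.zero_mk (s * 1), LocalizedModule.mk_eq] at h
      obtain ⟨u, hu⟩ := h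
      simp only [smul_zero, Submonoid.smul_def, smul_smul] at hu
      have hua : ((u : R) * ((s : R) * 1) * a) = 0 := hy _ (by simpa [mul_assoc, smul_smul] using hu)
      have hu0 : (u : R) ≠ 0 := fun h => by
        have := u.2; rw [h] at this; exact this (Ideal.zero_mem _)
      have hs0 : (s : R) ≠ 0 := fun h => by
        have := s.2; rw [h] at this; exact this (Ideal.zero_mem _)
      have ha : a = 0 := by
        rcases mul_eq_zero.mp hua with h | h
        · rcases mul_eq_zero.mp h with h | h
          · exact absurd h hu0
          · exact absurd (by simpa using h) hs0
        · exact h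
      subst ha
      simp [Localization.mk_zero]
  have hle := Module.length_le_of_injective g hg
  rw [length_localization_atPrime_eq_top 𝔭 h𝔭, top_le_iff] at hle
  exact hle

/-- **JUNK CONVENTION of `Module.charIdeal`: a module over a domain that is NOT torsion has `char = ⊤`** — every
height-one local length is infinite, so every exponent `(lengthAt).toNat` is `0` and the `finprod` is `1`. Consequently
every divisibility statement `G ∈ char N` / `(G) ≤ char N` (this file's doors, and the crux's conclusion
`(G) ≤ (XGr₂.charIdeal …).map toUnr₂`) holds TRIVIALLY for non-torsion `N`: such statements are silent about
torsion-ness, which must be carried separately where it is wanted. [folklore] -/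
theorem charIdeal_eq_top_of_not_isTorsion [IsDomain R] (hN : ¬ Module.IsTorsion R N) :
    Module.charIdeal R N = ⊤ := by
  classical
  obtain ⟨y, hy⟩ : ∃ y : N, ∀ a : R, a • y = 0 → a = 0 := by
    by_contra h
    simp only [not_exists, not_forall] at h
    refine hN fun y => ?_
    obtain ⟨a, hay, ha⟩ := h y
    exact ⟨⟨a, mem_nonZeroDivisors_of_ne_zero ha⟩, hay⟩
  unfold Module.charIdeal
  rw [← Ideal.one_eq_top]
  refine finprod_mem_of_eqOn_one (s := {𝔭 : PrimeSpectrum R | 𝔭.asIdeal.height = 1}) ?_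
  intro 𝔭 h𝔭
  show 𝔭.asIdeal ^ (Module.lengthAt R N 𝔭).toNat = 1
  rw [lengthAt_eq_top_of_forall_smul_eq_zero hy 𝔭 h𝔭, ENat.toNat_top, pow_zero]

/-- **Pseudo-nullity along a semilinear surjection.** If `π : C → Q` is `θ`-semilinear and surjective and NO prime
`𝔮` of `S` of height `≤ 1` has `ann_R C ⊆ θ⁻¹ 𝔮`, then `Q` is pseudo-null over `S`: an element of `ann C`
outside `θ⁻¹ 𝔮` maps to an element outside `𝔮` killing `Q`. [cite: BourbakiAC5to7, Ch. VII §4 no. 4 Def. 2] -/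
theorem isPseudoNull_of_surjective_semilinear {C : Type*} [AddCommGroup C] [Module R C]
    {Q : Type*} [AddCommGroup Q] [Module S Q] (π : C →ₛₗ[θ] Q) (hπ : Function.Surjective π)
    (h : ∀ 𝔮 : PrimeSpectrum S, 𝔮.asIdeal.height ≤ 1 → ¬ Module.annihilator R C ≤ 𝔮.asIdeal.comap θ) :
    Module.IsPseudoNull S Q := by
  rw [Module.isPseudoNull_iff]
  intro 𝔮 h𝔮 q
  obtain ⟨c, rfl⟩ := hπ q
  obtain ⟨t, htJ, ht𝔮⟩ := Set.not_subset.mp (h 𝔮 h𝔮)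
  refine ⟨θ t, ht𝔮, ?_⟩
  rw [← LinearMap.map_smulₛₗ, Module.mem_annihilator.mp htJ, map_zero]

/-- `char(F) ⊆ char(E')` for an `S`-linear `g : F → E'` between finitely generated torsion modules over a Noetherian
domain whose cokernel is pseudo-null (`char F = char(ker)·char(range) ⊆ char(range) = char(range)·char(coker) =
char E'`). [cite: BourbakiAC5to7, Ch. VII §4.5 Prop. 10] -/
theorem charIdeal_le_of_isPseudoNull_coker [IsDomain S] [IsNoetherianRing S]
    {E' : Type*} [AddCommGroup E'] [Module S E'] [Module.Finite S F] [Module.Finite S E']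
    (hF : Module.IsTorsion S F) (hE : Module.IsTorsion S E') (g : F →ₗ[S] E')
    (hQ : Module.IsPseudoNull S (E' ⧸ LinearMap.range g)) :
    Module.charIdeal S F ≤ Module.charIdeal S E' := by
  have h1 := Module.charIdeal_eq_mul_of_surjective hF g.rangeRestrict g.surjective_rangeRestrict
  have h2 := Module.charIdeal_eq_mul_of_exact hE (LinearMap.range g).subtype (LinearMap.range g).mkQ
    (Submodule.subtype_injective _) (Submodule.mkQ_surjective _) (LinearMap.exact_subtype_mkQ _)
  rw [Module.charIdeal_eq_top_of_isPseudoNull hQ, Ideal.mul_top] at h2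
  rw [h1, h2]
  exact Ideal.mul_le_left

/-! ### Characteristic ideals of products of cyclic modules -/

/-- `ℓ_𝔭(R/(∏_{i∈s} bᵢ)) = ∑_{i∈s} ℓ_𝔭(R/(bᵢ))` for nonzero `bᵢ` in a domain. [folklore] -/
theorem lengthAt_quotient_span_finsetProd [IsDomain R] {ι : Type*} (s : Finset ι) (b : ι → R)
    (hb : ∀ i ∈ s, b i ≠ 0) (𝔭 : PrimeSpectrum R) :
    Module.lengthAt R (R ⧸ Ideal.span {∏ i ∈ s, b i}) 𝔭 =
      ∑ i ∈ s, Module.lengthAt R (R ⧸ Ideal.span {b i}) 𝔭 := by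
  classical
  induction s using Finset.induction_on with
  | empty =>
    rw [Finset.prod_empty, Finset.sum_empty]
    exact Module.lengthAt_quotient_eq_zero_of_not_le (by
      rw [Ideal.span_singleton_one]; exact fun h => 𝔭.isPrime.ne_top (top_le_iff.mp h))
  | insert j s hj IH =>
    rw [Finset.prod_insert hj, Finset.sum_insert hj,
      Module.lengthAt_quotient_span_singleton_mul _ (hb j (Finset.mem_insert_self j s)) 𝔭,
      IH fun i hi => hb i (Finset.mem_insert_of_mem hi)]

/-- **`char(Πᵢ Πₖ R/(aᵢₖ)) = (∏ᵢ ∏ₖ aᵢₖ)`** for nonzero `aᵢₖ` in a Noetherian factorial domain (local lengths add up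
over the product and over the factorisation; `char(R/(x)) = (x)`). [cite: Washington1997, §13.2] -/
theorem charIdeal_pi_pi_quotient [IsDomain R] [IsNoetherianRing R] [UniqueFactorizationMonoid R]
    {n : ℕ} {r : Fin n → ℕ} (a : ∀ i, Fin (r i) → R) (ha : ∀ i k, a i k ≠ 0) :
    Module.charIdeal R (Π i, Π k : Fin (r i), R ⧸ Ideal.span {a i k}) = Ideal.span {∏ i, ∏ k, a i k} := by
  have hne : (∏ i, ∏ k, a i k) ≠ 0 :=
    Finset.prod_ne_zero_iff.mpr fun i _ => Finset.prod_ne_zero_iff.mpr fun k _ => ha i k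
  rw [← Module.charIdeal_quotient_span_singleton hne]
  unfold Module.charIdeal
  refine finprod_mem_congr rfl fun 𝔭 _ => ?_
  congr 2
  rw [Module.lengthAt_pi, lengthAt_quotient_span_finsetProd _ _ (fun i _ =>
    Finset.prod_ne_zero_iff.mpr fun k _ => ha i k)]
  refine Finset.sum_congr rfl fun i _ => ?_
  rw [Module.lengthAt_pi, lengthAt_quotient_span_finsetProd _ _ (fun k _ => ha i k)]

/-- The product `Πᵢ Πₖ R/(aᵢₖ)` is killed by `∏ᵢ ∏ₖ aᵢₖ`. [folklore] -/
theorem prod_smul_pi_pi_quotient_eq_zero {n : ℕ} {r : Fin n → ℕ} (a : ∀ i, Fin (r i) → R)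
    (m : Π i, Π k : Fin (r i), R ⧸ Ideal.span {a i k}) : (∏ i, ∏ k, a i k) • m = 0 := by
  funext i k
  rw [Pi.smul_apply, Pi.smul_apply, Pi.zero_apply, Pi.zero_apply]
  obtain ⟨b, hb⟩ := Ideal.Quotient.mk_surjective (m i k)
  rw [← hb, Algebra.smul_def, Ideal.Quotient.algebraMap_eq, ← map_mul, Ideal.Quotient.eq_zero_iff_mem]
  refine Ideal.mul_mem_right _ _ (Ideal.mem_span_singleton.mpr ?_)
  exact (Finset.dvd_prod_of_mem _ (Finset.mem_univ k)).trans (Finset.dvd_prod_of_mem _ (Finset.mem_univ i))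

/-- **Structure theorem over a Noetherian factorial domain, prime-element form**: a finitely generated torsion
module is pseudo-isomorphic to `Πᵢ Πₖ R/(gᵢ^{eᵢₖ})` with PRIME ELEMENTS `gᵢ` (every height-one prime of a UFD
is principal, generated by a prime element). [cite: BourbakiAC5to7, Ch. VII §4.4 Thm. 5; Washington1997, §13.2] -/
theorem exists_isPseudoIsomorphism_pi_prime [IsDomain R] [IsNoetherianRing R] [UniqueFactorizationMonoid R]
    (N : Type*) [AddCommGroup N] [Module R N] [Module.Finite R N] (hN : Module.IsTorsion R N) :
    ∃ (n : ℕ) (r : Fin n → ℕ) (e : ∀ i, Fin (r i) → ℕ) (g : Fin n → R), (∀ i, Prime (g i)) ∧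
      ∃ ψ : N →ₗ[R] (Π i, Π k : Fin (r i), R ⧸ Ideal.span {g i ^ e i k}),
        LinearMap.IsPseudoIsomorphism ψ := by
  classical
  -- a prime generator for every nonzero prime
  let gen : PrimeSpectrum R → R := fun 𝔮 =>
    if h : 𝔮.asIdeal ≠ ⊥ then Classical.choose (𝔮.isPrime.exists_mem_prime_of_ne_bot h) else 0
  have hgen_spec : ∀ 𝔮 : PrimeSpectrum R, 𝔮.asIdeal ≠ ⊥ → gen 𝔮 ∈ 𝔮.asIdeal ∧ Prime (gen 𝔮) := by
    intro 𝔮 h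
    simp only [gen, dif_pos h]
    exact Classical.choose_spec (𝔮.isPrime.exists_mem_prime_of_ne_bot h)
  have hne : ∀ 𝔮 : PrimeSpectrum R, 𝔮.asIdeal.height = 1 → 𝔮.asIdeal ≠ ⊥ := by
    intro 𝔮 h1 h0
    have : 𝔮.asIdeal.height = 0 := Ideal.height_eq_zero_iff_eq_bot.mpr h0  -- may need adjusting
    rw [this] at h1
    exact zero_ne_one h1
  have hgen : ∀ 𝔮 : PrimeSpectrum R, 𝔮.asIdeal.height = 1 → Module.annihilator R N ≤ 𝔮.asIdeal →
      𝔮.asIdeal = Ideal.span {gen 𝔮} := fun 𝔮 h1 _ =>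
    Ideal.eq_span_singleton_of_height_eq_one h1 (hgen_spec 𝔮 (hne 𝔮 h1)).1 (hgen_spec 𝔮 (hne 𝔮 h1)).2
  obtain ⟨n, q, -, hq, r, e, -, ψ, hψ⟩ := Module.exists_isPseudoIsomorphism_pi N hN gen hgen
  exact ⟨n, r, e, fun i => gen (q i), fun i => (hgen_spec (q i) (hne (q i) (hq i).1)).2, ψ, hψ⟩

/-! ### The fibre of a product of cyclic modules along `θ` -/

/-- The `θ`-semilinear reduction `R/I → S/J` for `I ≤ θ⁻¹ J` (Mathlib's `Ideal.quotientMap` as a semilinear map).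
[folklore] -/
def quotientMapₛₗ (I : Ideal R) (J : Ideal S) (h : I ≤ J.comap θ) : (R ⧸ I) →ₛₗ[θ] (S ⧸ J) where
  toFun := Ideal.quotientMap J θ h
  map_add' := map_add _
  map_smul' r m := by
    obtain ⟨b, rfl⟩ := Ideal.Quotient.mk_surjective m
    show Ideal.quotientMap J θ h (r • Ideal.Quotient.mk I b) = θ r • Ideal.quotientMap J θ h (Ideal.Quotient.mk I b)
    rw [Algebra.smul_def, Algebra.smul_def, Ideal.Quotient.algebraMap_eq, Ideal.Quotient.algebraMap_eq, ← map_mul,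
      Ideal.quotientMap_mk, Ideal.quotientMap_mk, map_mul, map_mul]

@[simp] theorem quotientMapₛₗ_mk (I : Ideal R) (J : Ideal S) (h : I ≤ J.comap θ) (b : R) :
    quotientMapₛₗ θ I J h (Ideal.Quotient.mk I b) = Ideal.Quotient.mk J (θ b) :=
  Ideal.quotientMap_mk (f := θ) (H := h)

theorem quotientMapₛₗ_surjective (hθ : Function.Surjective θ) (I : Ideal R) (J : Ideal S) (h : I ≤ J.comap θ) :
    Function.Surjective (quotientMapₛₗ θ I J h) := by
  intro w
  obtain ⟨s, rfl⟩ := Ideal.Quotient.mk_surjective w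
  obtain ⟨c, rfl⟩ := hθ s
  exact ⟨Ideal.Quotient.mk I c, quotientMapₛₗ_mk θ I J h c⟩

theorem span_singleton_le_comap_span_singleton_map (a : R) :
    Ideal.span {a} ≤ (Ideal.span {θ a}).comap θ := by
  rw [Ideal.span_singleton_le_iff_mem, Ideal.mem_comap]
  exact Ideal.mem_span_singleton_self _

/-- The componentwise reduction `Πᵢ Πₖ R/(aᵢₖ) → Πᵢ Πₖ S/(θ aᵢₖ)`, `θ`-semilinear. [folklore] -/
def piReduce {n : ℕ} {r : Fin n → ℕ} (a : ∀ i, Fin (r i) → R) :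
    (Π i, Π k : Fin (r i), R ⧸ Ideal.span {a i k}) →ₛₗ[θ] (Π i, Π k : Fin (r i), S ⧸ Ideal.span {θ (a i k)}) where
  toFun m i k := quotientMapₛₗ θ _ _ (span_singleton_le_comap_span_singleton_map θ (a i k)) (m i k)
  map_add' m m' := by funext i k; exact map_add _ _ _
  map_smul' c m := by funext i k; exact LinearMap.map_smulₛₗ _ _ _

theorem piReduce_apply {n : ℕ} {r : Fin n → ℕ} (a : ∀ i, Fin (r i) → R)
    (m : Π i, Π k : Fin (r i), R ⧸ Ideal.span {a i k}) (i : Fin n) (k : Fin (r i)) :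
    piReduce θ a m i k = quotientMapₛₗ θ _ _ (span_singleton_le_comap_span_singleton_map θ (a i k)) (m i k) :=
  rfl

theorem piReduce_surjective (hθ : Function.Surjective θ) {n : ℕ} {r : Fin n → ℕ} (a : ∀ i, Fin (r i) → R) :
    Function.Surjective (piReduce θ a) := by
  intro w
  have hc : ∀ i k, ∃ m : R ⧸ Ideal.span {a i k},
      quotientMapₛₗ θ _ _ (span_singleton_le_comap_span_singleton_map θ (a i k)) m = w i k := fun i k =>
    quotientMapₛₗ_surjective θ hθ _ _ _ (w i k)
  choose m hm using hc
  exact ⟨fun i k => m i k, funext fun i => funext fun k => hm i k⟩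

/-- Kernel condition of the cyclic reduction `R/(g) → S/(θ g)` along a surjective `θ`: if `θ b ∈ (θ g)` then
`b̄ ∈ (ker θ)·(R/(g))`. [folklore] -/
theorem mk_mem_ker_smul_top_of_quotientMapₛₗ_eq_zero (hθ : Function.Surjective θ) (g b : R)
    (hb : quotientMapₛₗ θ (Ideal.span {g}) (Ideal.span {θ g}) (span_singleton_le_comap_span_singleton_map θ g)
      (Ideal.Quotient.mk (Ideal.span {g}) b) = 0) :
    Ideal.Quotient.mk (Ideal.span {g}) b ∈ RingHom.ker θ • (⊤ : Submodule R (R ⧸ Ideal.span {g})) := by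
  rw [quotientMapₛₗ_mk, Ideal.Quotient.eq_zero_iff_mem, Ideal.mem_span_singleton'] at hb
  obtain ⟨c, hc⟩ := hb
  obtain ⟨c', rfl⟩ := hθ c
  have hk : b - c' * g ∈ RingHom.ker θ := by
    rw [RingHom.mem_ker, map_sub, map_mul, hc, sub_self]
  have h1 : Ideal.Quotient.mk (Ideal.span {g}) b = (b - c' * g) • Ideal.Quotient.mk (Ideal.span {g}) 1 := by
    rw [Algebra.smul_def, Ideal.Quotient.algebraMap_eq, map_one, mul_one, map_sub, map_mul,
      Ideal.Quotient.eq_zero_iff_mem.mpr (Ideal.mem_span_singleton_self g), mul_zero, sub_zero]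
  rw [h1]
  exact Submodule.smul_mem_smul hk Submodule.mem_top

/-- **The `S`-module structure on the coinvariants `N ⧸ (ker θ)N`** along a surjective `θ : R ↠ S`: transport of Mathlib's
`R ⧸ ker θ`-module structure on `N ⧸ (ker θ) • ⊤` along `R ⧸ ker θ ≃+* S`. A `def` (used with `letI`, never an instance):
the CANONICAL `θ`-fibre. [folklore] -/
@[reducible] noncomputable def coinvModule (hθ : Function.Surjective θ) :
    Module S (N ⧸ (RingHom.ker θ • ⊤ : Submodule R N)) :=
  Module.compHom _ (RingHom.quotientKerEquivOfSurjective hθ).symm.toRingHom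

/-- The quotient map `N → N ⧸ (ker θ)N` as a `θ`-SEMILINEAR map for the transported structure `coinvModule`. [folklore] -/
noncomputable def coinvMkₛₗ (hθ : Function.Surjective θ) :
    letI := coinvModule θ (N := N) hθ
    N →ₛₗ[θ] (N ⧸ (RingHom.ker θ • ⊤ : Submodule R N)) :=
  letI := coinvModule θ (N := N) hθ
  { toFun := Submodule.Quotient.mk
    map_add' := fun _ _ => rfl
    map_smul' := fun a y => by
      show Submodule.Quotient.mk (a • y) =
        ((RingHom.quotientKerEquivOfSurjective hθ).symm.toRingHom (θ a)) •
          (Submodule.Quotient.mk y : N ⧸ (RingHom.ker θ • ⊤ : Submodule R N))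
      rw [RingEquiv.toRingHom_eq_coe, RingHom.coe_coe, RingHom.quotientKerEquivOfSurjective_symm_apply]
      rfl }

theorem coinvMkₛₗ_apply (hθ : Function.Surjective θ) (y : N) :
    coinvMkₛₗ θ (N := N) hθ y = Submodule.Quotient.mk y := rfl

theorem coinvMkₛₗ_surjective (hθ : Function.Surjective θ) :
    Function.Surjective (coinvMkₛₗ θ (N := N) hθ) :=
  Submodule.Quotient.mk_surjective _

theorem coinvMkₛₗ_eq_zero_iff (hθ : Function.Surjective θ) (y : N) :
    coinvMkₛₗ θ (N := N) hθ y = 0 ↔ y ∈ (RingHom.ker θ • ⊤ : Submodule R N) :=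
  Submodule.Quotient.mk_eq_zero _

end ModuleDoorGeneric

/-! ### The abstract door: one good reduction map -/

section AbstractDoor

variable {A Λ : Type*} [CommRing A] [CommRing Λ]

/-- A `θ`-semilinear map kills `(ker θ)•N`. [folklore] -/
theorem semilinear_apply_eq_zero_of_mem_ker_smul_top (θ : A →+* Λ) {N : Type*} [AddCommGroup N] [Module A N]
    {P : Type*} [AddCommGroup P] [Module Λ P] (χ : N →ₛₗ[θ] P) {y : N}
    (hy : y ∈ RingHom.ker θ • (⊤ : Submodule A N)) : χ y = 0 := by
  refine Submodule.smul_induction_on hy (fun r hr n _ => ?_) (fun x y hx hy => ?_)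
  · rw [LinearMap.map_smulₛₗ, RingHom.mem_ker.mp hr, zero_smul]
  · rw [map_add, hx, hy, add_zero]

/-- **Finiteness of the bad primes.** Over a Noetherian local ring whose maximal ideal has height `≤ 3`, a finitely
generated PSEUDO-NULL module `C` has only finitely many primes `P ⊇ ann C` other than the maximal ideal (they are
the minimal primes of `ann C`, all of height `≥ 2`). [cite: arXiv:1108.4708, Lemma 8.5] -/
theorem finite_setOf_isPrime_annihilator_le [IsNoetherianRing A] [IsLocalRing A]
    (hA : (IsLocalRing.maximalIdeal A).height ≤ 3) (C : Type*) [AddCommGroup C] [Module A C]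
    [Module.Finite A C] (hC : Module.IsPseudoNull A C) :
    {P : Ideal A | P.IsPrime ∧ Module.annihilator A C ≤ P ∧ P ≠ IsLocalRing.maximalIdeal A}.Finite := by
  refine ((Module.annihilator A C).finite_minimalPrimes_of_isNoetherianRing).subset ?_
  rintro P ⟨hP, hJP, hPm⟩
  obtain ⟨P₀, hP₀min, hP₀P⟩ := Ideal.exists_minimalPrimes_le hJP
  haveI hP₀prime : P₀.IsPrime := hP₀min.1.1
  have hJP₀ : Module.annihilator A C ≤ P₀ := hP₀min.1.2
  have h2 : ¬ P₀.height ≤ 1 := by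
    intro h1
    have hmem : (⟨P₀, hP₀prime⟩ : PrimeSpectrum A) ∈ Module.support A C :=
      Module.mem_support_iff_of_finite.mpr hJP₀
    rw [Module.mem_support_iff] at hmem
    haveI := hC ⟨P₀, hP₀prime⟩ h1
    exact false_of_nontrivial_of_subsingleton (LocalizedModule P₀.primeCompl C)
  have hlt : P < IsLocalRing.maximalIdeal A := lt_of_le_of_ne (IsLocalRing.le_maximalIdeal hP.ne_top) hPm
  have hPlt : P.height < 3 := (Ideal.height_strict_mono_of_isPrime hlt).trans_le hA
  have hP2 : P.height ≤ 2 := Order.le_of_lt_add_one (by simpa [show (2 : ℕ∞) + 1 = 3 by norm_num] using hPlt)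
  have hP₀2 : 2 ≤ P₀.height := by
    have := Order.add_one_le_of_lt (not_le.mp h2)
    simpa [one_add_one_eq_two] using this
  have hEq : P₀ = P := Ideal.eq_of_le_of_height_le (I := P₀) (J := P) hP₀P (hP2.trans hP₀2)
  rw [← hEq]
  exact hP₀min

variable [IsDomain A] [IsNoetherianRing A] [IsLocalRing A] [UniqueFactorizationMonoid A]
  [IsDomain Λ] [IsNoetherianRing Λ] [IsLocalRing Λ] [UniqueFactorizationMonoid Λ]

/-- **The abstract door (one good reduction).** `θ : A ↠ Λ` a surjection of Noetherian local factorial domains with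
`ht 𝔪_Λ > 1`; `N` a finitely generated `A`-module pseudo-isomorphic (via `ψ`) to `E = Πᵢ Πₖ A/(gᵢ^{eᵢₖ})` with prime
`gᵢ`; `θ` GOOD: `θ gᵢ ≠ 0`, `θ a ≠ 0` for some `a` killing `N`, and the only prime `P ⊇ ann(E/ψN) + ker θ` is `𝔪_A`.
Then every `θ`-FIBRE `F` of `N` (a surjective `θ`-semilinear `φ : N → F` with `ker φ ⊆ (ker θ)N`) satisfies
`char_Λ(F) ⊆ θ(char_A N)·Λ`.  Proof: descend `ε∘ψ` (`ε : E → E_θ = Πᵢ Πₖ Λ/(θ gᵢ^{eᵢₖ})` the reduction) to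
`ψ̄ : F → E_θ`; its cokernel is a `θ`-semilinear image of `E/ψN`, pseudo-null by goodness; so `char F ⊆ char E_θ =
(θ ∏∏ gᵢ^{eᵢₖ}) = θ(char N)`. [cite: arXiv:1108.4708, Lemma 8.2 + Thm. 8.8 (3)⇒(1)] -/
theorem charIdeal_fibre_le_map (hΛ : 1 < (IsLocalRing.maximalIdeal Λ).height)
    (θ : A →+* Λ) (hθ : Function.Surjective θ)
    {N : Type*} [AddCommGroup N] [Module A N] [Module.Finite A N]
    {n : ℕ} {r : Fin n → ℕ} {e : ∀ i, Fin (r i) → ℕ} {g : Fin n → A} (hg : ∀ i, Prime (g i))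
    (ψ : N →ₗ[A] (Π i, Π k : Fin (r i), A ⧸ Ideal.span {g i ^ e i k}))
    (hψ : LinearMap.IsPseudoIsomorphism ψ)
    (hgθ : ∀ i, θ (g i) ≠ 0) {a : A} (haN : ∀ y : N, a • y = 0) (ha : θ a ≠ 0)
    (hgood : ∀ P : Ideal A, P.IsPrime →
      Module.annihilator A ((Π i, Π k : Fin (r i), A ⧸ Ideal.span {g i ^ e i k}) ⧸ LinearMap.range ψ) ≤ P →
      RingHom.ker θ ≤ P → P = IsLocalRing.maximalIdeal A)
    {F : Type*} [AddCommGroup F] [Module Λ F] (φ : N →ₛₗ[θ] F) (hφ : Function.Surjective φ)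
    (hφk : ∀ y, φ y = 0 → y ∈ RingHom.ker θ • (⊤ : Submodule A N)) :
    Module.charIdeal Λ F ≤ (Module.charIdeal A N).map θ := by
  classical
  let a' : ∀ i, Fin (r i) → A := fun i k => g i ^ e i k
  have ha' : ∀ i k, a' i k ≠ 0 := fun i k => pow_ne_zero _ (hg i).ne_zero
  have ha'θ : ∀ i k, θ (a' i k) ≠ 0 := fun i k => by
    simp only [a', map_pow]; exact pow_ne_zero _ (hgθ i)
  let ε := piReduce θ a'
  have hεs : Function.Surjective ε := piReduce_surjective θ hθ a'
  let χ : N →ₛₗ[θ] (Π i, Π k : Fin (r i), Λ ⧸ Ideal.span {θ (a' i k)}) := ε.comp ψ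
  have hker : ∀ y, φ y = 0 → χ y = 0 := fun y hy =>
    semilinear_apply_eq_zero_of_mem_ker_smul_top θ χ (hφk y hy)
  let ψbar := descend θ hθ φ hφ χ hker
  -- finiteness / torsion
  haveI : Module.Finite Λ F := moduleFinite_of_surjective_semilinear θ hθ φ hφ
  have hF : Module.IsTorsion Λ F :=
    isTorsion_of_surjective_semilinear θ φ hφ haN (mem_nonZeroDivisors_of_ne_zero ha)
  have hE' : Module.IsTorsion Λ (Π i, Π k : Fin (r i), Λ ⧸ Ideal.span {θ (a' i k)}) := fun m =>
    ⟨⟨∏ i, ∏ k, θ (a' i k), mem_nonZeroDivisors_of_ne_zero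
      (Finset.prod_ne_zero_iff.mpr fun i _ => Finset.prod_ne_zero_iff.mpr fun k _ => ha'θ i k)⟩,
      prod_smul_pi_pi_quotient_eq_zero _ m⟩
  -- the cokernel of ψbar is pseudo-null
  have hle : LinearMap.range ψ ≤ LinearMap.ker ((LinearMap.range ψbar).mkQ.comp ε) := by
    rintro _ ⟨y, rfl⟩
    rw [LinearMap.mem_ker, LinearMap.comp_apply, Submodule.mkQ_apply, Submodule.Quotient.mk_eq_zero]
    exact ⟨φ y, descend_apply θ hθ φ hφ χ hker y⟩
  let π := (LinearMap.range ψ).liftQ ((LinearMap.range ψbar).mkQ.comp ε) hle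
  have hπ : Function.Surjective π := by
    intro q
    obtain ⟨w, rfl⟩ := Submodule.mkQ_surjective _ q
    obtain ⟨z, rfl⟩ := hεs w
    exact ⟨Submodule.Quotient.mk z, rfl⟩
  have hcoker : Module.IsPseudoNull Λ (_ ⧸ LinearMap.range ψbar) := by
    refine isPseudoNull_of_surjective_semilinear θ π hπ fun 𝔮 h𝔮 hJ => ?_
    haveI : (𝔮.asIdeal.comap θ).IsPrime := Ideal.comap_isPrime θ 𝔮.asIdeal
    have hP : 𝔮.asIdeal.comap θ = IsLocalRing.maximalIdeal A :=
      hgood _ inferInstance hJ (by rw [RingHom.ker_eq_comap_bot]; exact Ideal.comap_mono bot_le)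
    have h1 : 𝔮.asIdeal = (IsLocalRing.maximalIdeal A).map θ := by
      rw [← hP, Ideal.map_comap_of_surjective θ hθ]
    have h𝔮m : 𝔮.asIdeal = IsLocalRing.maximalIdeal Λ := by
      rcases Ideal.map_eq_top_or_isMaximal_of_surjective θ hθ (IsLocalRing.maximalIdeal.isMaximal A) with
        htop | hmax
      · exact absurd (h1.trans htop) 𝔮.isPrime.ne_top
      · exact IsLocalRing.eq_maximalIdeal (h1 ▸ hmax)
    rw [h𝔮m] at h𝔮
    exact not_lt.mpr h𝔮 hΛ
  -- assemble
  have hFle := charIdeal_le_of_isPseudoNull_coker hF hE' ψbar hcoker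
  have hE'char := charIdeal_pi_pi_quotient (R := Λ) (fun i k => θ (a' i k)) ha'θ
  have hEtors : Module.IsTorsion A (Π i, Π k : Fin (r i), A ⧸ Ideal.span {a' i k}) := fun m =>
    ⟨⟨∏ i, ∏ k, a' i k, mem_nonZeroDivisors_of_ne_zero
      (Finset.prod_ne_zero_iff.mpr fun i _ => Finset.prod_ne_zero_iff.mpr fun k _ => ha' i k)⟩,
      prod_smul_pi_pi_quotient_eq_zero _ m⟩
  have hNchar : Module.charIdeal A N = Ideal.span {∏ i, ∏ k, a' i k} := by
    rw [← charIdeal_pi_pi_quotient a' ha']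
    exact Module.charIdeal_eq_of_arePseudoIsomorphic ⟨ψ, hψ⟩
  rw [hNchar, Ideal.map_span, Set.image_singleton, map_prod]
  simp_rw [map_prod]
  exact hFle.trans hE'char.le

end AbstractDoor

/-! ## §F2 THE DOORS FOR AN ABSTRACT OCHIAI–SHIMOMOTO FAMILY (verbatim `SplitsliceExt` v1.16 §12, minus `…_via_fam`)

`A` any Noetherian local factorial domain with `ht 𝔪_A = 3`, `Λ` any Noetherian local factorial domain with `ht 𝔪_Λ > 1`,
surjections `θ_n : A ↠ Λ` with `ker θ_n = (x_n)`, `x_n` prime ((T1)), and the AVOIDANCE PROPERTY (B) of [OcSh15, Def. 8.1] ((T2)):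
every non-maximal prime of `A` contains `x_n` for only finitely many `n` (hypotheses `hθ`, `hker`, `hx`, `hB`, `hA`, `hΛ`). -/
section FamilyDoor

universe uF₃ uX₃

variable {A Λ : Type*} [CommRing A] [CommRing Λ] {θ : ℕ → (A →+* Λ)} {x : ℕ → A}

/-- `θ_n(π) ∣ θ_n(F)` ⇒ `F ∈ (π, x_n)` ((T1): `θ_n` surjective with kernel `(x_n)`). [cite: arXiv:1108.4708, Def. 8.1] -/
theorem fam_mem_span_pair_of_dvd {n : ℕ} (hθ : Function.Surjective (θ n))
    (hker : RingHom.ker (θ n) = Ideal.span {x n}) {π F : A} (h : θ n π ∣ θ n F) :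
    F ∈ Ideal.span {π, x n} := by
  obtain ⟨c, hc⟩ := h
  obtain ⟨q, hq⟩ := hθ c
  have hk : F - q * π ∈ RingHom.ker (θ n) := by
    rw [RingHom.mem_ker, map_sub, map_mul, hq, hc]; ring
  rw [hker, Ideal.mem_span_singleton] at hk
  obtain ⟨r, hr⟩ := hk
  exact Ideal.mem_span_pair.mpr ⟨q, r, by linear_combination (-1 : A) * hr⟩

variable [IsLocalRing A]

/-- (B) for a finite set of non-maximal primes at once. [cite: arXiv:1108.4708, Def. 8.1 (B)] -/
theorem fam_eventually_forall_not_mem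
    (hB : ∀ 𝔮 : Ideal A, 𝔮.IsPrime → 𝔮 ≠ IsLocalRing.maximalIdeal A → ∀ᶠ n in Filter.cofinite, x n ∉ 𝔮)
    (s : Finset (Ideal A)) (hs : ∀ 𝔮 ∈ s, 𝔮.IsPrime ∧ 𝔮 ≠ IsLocalRing.maximalIdeal A) :
    ∀ᶠ n in Filter.cofinite, ∀ 𝔮 ∈ s, x n ∉ 𝔮 :=
  (Filter.eventually_all_finset s).mpr fun 𝔮 h𝔮 => hB 𝔮 (hs 𝔮 h𝔮).1 (hs 𝔮 h𝔮).2

variable [IsNoetherianRing A]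

/-- Minimal primes of two-generated ideals are non-maximal when `ht 𝔪_A = 3`. [cite: arXiv:1108.4708, Lemma 8.6] -/
theorem fam_ne_maximalIdeal_of_mem_minimalPrimes_span_pair (hA : (IsLocalRing.maximalIdeal A).height = 3) (a b : A)
    {P : Ideal A} (hP : P ∈ (Ideal.span {a, b}).minimalPrimes) : P ≠ IsLocalRing.maximalIdeal A := by
  intro heq
  have h2 := height_le_two_of_mem_minimalPrimes_span_pair a b hP
  rw [heq, hA] at h2
  norm_num at h2

/-- A prime element generates a non-maximal ideal when `ht 𝔪_A = 3`. [cite: arXiv:1108.4708, Lemma 8.6] -/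
theorem fam_span_singleton_ne_maximalIdeal_of_prime (hA : (IsLocalRing.maximalIdeal A).height = 3) {π : A}
    (hπ : Prime π) : Ideal.span {π} ≠ IsLocalRing.maximalIdeal A := by
  intro heq
  haveI hπI : (Ideal.span {π}).IsPrime := (Ideal.span_singleton_prime hπ.ne_zero).mpr hπ
  have h1 : (Ideal.span {π}).height ≤ 1 :=
    Ideal.height_le_one_of_isPrincipal_of_mem_minimalPrimes (Ideal.span {π}) _
      (by rw [Ideal.minimalPrimes_eq_subsingleton_self]; rfl)
  rw [heq, hA] at h1
  norm_num at h1

variable [IsDomain A]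

/-- `θ_n(π) ≠ 0` cofinitely, for a prime `π` ((B) applied to the non-maximal prime `(π)`). [cite: arXiv:1108.4708, Def. 8.1] -/
theorem fam_eventually_map_ne_zero_of_prime (hker : ∀ n, RingHom.ker (θ n) = Ideal.span {x n})
    (hx : ∀ n, Prime (x n))
    (hB : ∀ 𝔮 : Ideal A, 𝔮.IsPrime → 𝔮 ≠ IsLocalRing.maximalIdeal A → ∀ᶠ n in Filter.cofinite, x n ∉ 𝔮)
    (hA : (IsLocalRing.maximalIdeal A).height = 3) {π : A} (hπ : Prime π) :
    ∀ᶠ n in Filter.cofinite, θ n π ≠ 0 := by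
  haveI hπI : (Ideal.span {π}).IsPrime := (Ideal.span_singleton_prime hπ.ne_zero).mpr hπ
  refine (hB _ hπI (fam_span_singleton_ne_maximalIdeal_of_prime hA hπ)).mono fun n hn h0 => hn ?_
  have hk : π ∈ RingHom.ker (θ n) := h0
  rw [hker, Ideal.mem_span_singleton] at hk
  obtain ⟨w, hw⟩ := hk
  have hwu : IsUnit w := (hπ.irreducible.isUnit_or_isUnit hw).resolve_left (hx n).not_unit
  rw [Ideal.mem_span_singleton]
  exact ⟨↑hwu.unit⁻¹, by rw [hw, mul_assoc, IsUnit.mul_val_inv, mul_one]⟩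

/-- **Ring-element door, prime form, for an abstract family**: `π` prime, `θ_n(π) ∣ θ_n(F)` for infinitely many `n`
⇒ `π ∣ F`. [cite: arXiv:1108.4708, Thm. 8.8] -/
theorem fam_dvd_of_prime_of_frequently_dvd (hθ : ∀ n, Function.Surjective (θ n))
    (hker : ∀ n, RingHom.ker (θ n) = Ideal.span {x n}) (hx : ∀ n, Prime (x n))
    (hB : ∀ 𝔮 : Ideal A, 𝔮.IsPrime → 𝔮 ≠ IsLocalRing.maximalIdeal A → ∀ᶠ n in Filter.cofinite, x n ∉ 𝔮)
    (hA : (IsLocalRing.maximalIdeal A).height = 3) {π F : A} (hπ : Prime π)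
    (h : ∃ᶠ n in Filter.cofinite, θ n π ∣ θ n F) : π ∣ F := by
  by_contra hnd
  set I : Ideal A := Ideal.span {π, F} with hI
  have hfin := Ideal.finite_minimalPrimes_of_isNoetherianRing A I
  have hS : ∀ 𝔮 ∈ hfin.toFinset, 𝔮.IsPrime ∧ 𝔮 ≠ IsLocalRing.maximalIdeal A := by
    intro 𝔮 h𝔮
    rw [Set.Finite.mem_toFinset] at h𝔮
    exact ⟨h𝔮.1.1, fam_ne_maximalIdeal_of_mem_minimalPrimes_span_pair hA π F h𝔮⟩
  obtain ⟨n, hdiv, hn⟩ := (h.and_eventually (fam_eventually_forall_not_mem hB _ hS)).exists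
  have hF : F ∈ Ideal.span {π, x n} := fam_mem_span_pair_of_dvd (hθ n) (hker n) hdiv
  have hJ : Ideal.span {π, x n} ≤ IsLocalRing.maximalIdeal A := by
    rw [Ideal.span_le, Set.insert_subset_iff, Set.singleton_subset_iff]
    exact ⟨(IsLocalRing.mem_maximalIdeal _).mpr (mem_nonunits_iff.mpr hπ.not_unit),
      (IsLocalRing.mem_maximalIdeal _).mpr (mem_nonunits_iff.mpr (hx n).not_unit)⟩
  obtain ⟨P, hP, -⟩ := Ideal.exists_minimalPrimes_le hJ
  haveI hPp : P.IsPrime := hP.1.1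
  have hπP : π ∈ P := hP.1.2 (Ideal.subset_span (by simp))
  have hxP : x n ∈ P := hP.1.2 (Ideal.subset_span (by simp))
  have hFP : F ∈ P := hP.1.2 hF
  have hIP : I ≤ P := by
    rw [hI, Ideal.span_le, Set.insert_subset_iff, Set.singleton_subset_iff]; exact ⟨hπP, hFP⟩
  obtain ⟨P₀, hP₀, hP₀P⟩ := Ideal.exists_minimalPrimes_le hIP
  haveI hP₀p : P₀.IsPrime := hP₀.1.1
  have hP2 : P.height ≤ 2 := height_le_two_of_mem_minimalPrimes_span_pair _ _ hP
  haveI hπI : (Ideal.span {π}).IsPrime := (Ideal.span_singleton_prime hπ.ne_zero).mpr hπ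
  haveI : (⊥ : Ideal A).IsPrime := Ideal.isPrime_bot
  have hlt1 : (⊥ : Ideal A) < Ideal.span {π} := by
    refine bot_lt_iff_ne_bot.mpr ?_
    rw [Ne, Ideal.span_singleton_eq_bot]
    exact hπ.ne_zero
  have hlt2 : Ideal.span {π} < P₀ := by
    refine lt_of_le_of_ne ((Ideal.span_singleton_le_iff_mem _).mpr (hP₀.1.2 (Ideal.subset_span (by simp)))) ?_
    intro heq
    have hFπ : F ∈ Ideal.span {π} := by rw [heq]; exact hP₀.1.2 (Ideal.subset_span (by simp))
    exact hnd (Ideal.mem_span_singleton.mp hFπ)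
  have e1 := Ideal.height_add_one_le_of_lt_of_isPrime hlt1
  have e2 := Ideal.height_add_one_le_of_lt_of_isPrime hlt2
  rw [Ideal.height_bot, zero_add] at e1
  have hP₀2 : (2 : ℕ∞) ≤ P₀.height :=
    calc (2 : ℕ∞) = 1 + 1 := by norm_num
      _ ≤ (Ideal.span {π}).height + 1 := by gcongr
      _ ≤ P₀.height := e2
  have hPP₀ : P₀ = P := Ideal.eq_of_le_of_height_le (I := P₀) hP₀P (hP2.trans hP₀2)
  have hmem : P₀ ∈ hfin.toFinset := by rw [Set.Finite.mem_toFinset]; exact hP₀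
  exact hn P₀ hmem (hPP₀ ▸ hxP)

variable [UniqueFactorizationMonoid A] [IsDomain Λ]

/-- `θ_n(a) ≠ 0` cofinitely, for every `a ≠ 0` (prime factorisation). [cite: arXiv:1108.4708, Lemma 8.6] -/
theorem fam_eventually_map_ne_zero (hker : ∀ n, RingHom.ker (θ n) = Ideal.span {x n})
    (hx : ∀ n, Prime (x n))
    (hB : ∀ 𝔮 : Ideal A, 𝔮.IsPrime → 𝔮 ≠ IsLocalRing.maximalIdeal A → ∀ᶠ n in Filter.cofinite, x n ∉ 𝔮)
    (hA : (IsLocalRing.maximalIdeal A).height = 3) {a : A} (ha : a ≠ 0) :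
    ∀ᶠ n in Filter.cofinite, θ n a ≠ 0 := by
  have key : ∀ a : A, a ≠ 0 → ∀ᶠ n in Filter.cofinite, θ n a ≠ 0 := by
    intro a
    refine UniqueFactorizationMonoid.induction_on_prime a ?_ ?_ ?_
    · intro h0; exact absurd rfl h0
    · intro y hy _
      exact Filter.Eventually.of_forall fun n ↦ (hy.map (θ n)).ne_zero
    · intro b π hb hπ IH _
      refine ((fam_eventually_map_ne_zero_of_prime hker hx hB hA hπ).and (IH hb)).mono fun n hn ↦ ?_
      rw [map_mul]
      exact mul_ne_zero hn.1 hn.2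
  exact key a ha

/-- **Ring-element door, general form, for an abstract family**: `G ≠ 0`, `θ_n(G) ∣ θ_n(F)` for infinitely many `n`
⇒ `G ∣ F`. [cite: arXiv:1108.4708, Thm. 8.8; Matsumura1987, Thm. 20.3] -/
theorem fam_dvd_of_frequently_dvd (hθ : ∀ n, Function.Surjective (θ n))
    (hker : ∀ n, RingHom.ker (θ n) = Ideal.span {x n}) (hx : ∀ n, Prime (x n))
    (hB : ∀ 𝔮 : Ideal A, 𝔮.IsPrime → 𝔮 ≠ IsLocalRing.maximalIdeal A → ∀ᶠ n in Filter.cofinite, x n ∉ 𝔮)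
    (hA : (IsLocalRing.maximalIdeal A).height = 3) {G F : A} (hG : G ≠ 0)
    (h : ∃ᶠ n in Filter.cofinite, θ n G ∣ θ n F) : G ∣ F := by
  have key : ∀ G : A, G ≠ 0 → ∀ F : A, (∃ᶠ n in Filter.cofinite, θ n G ∣ θ n F) → G ∣ F := by
    intro G
    refine UniqueFactorizationMonoid.induction_on_prime G ?_ ?_ ?_
    · intro h0; exact absurd rfl h0
    · intro y hy _ F _
      exact hy.dvd
    · intro a π ha hπ IH _ F h
      have hπF : π ∣ F :=
        fam_dvd_of_prime_of_frequently_dvd hθ hker hx hB hA hπ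
          (h.mono fun n hn ↦ dvd_trans ⟨θ n a, map_mul (θ n) π a⟩ hn)
      obtain ⟨F', rfl⟩ := hπF
      have h' : ∃ᶠ n in Filter.cofinite, θ n a ∣ θ n F' := by
        refine (h.and_eventually (fam_eventually_map_ne_zero_of_prime hker hx hB hA hπ)).mono fun n hn ↦ ?_
        obtain ⟨hn, hne⟩ := hn
        rw [map_mul, map_mul] at hn
        exact (mul_dvd_mul_iff_left hne).mp hn
      exact mul_dvd_mul_left π (IH ha F' h')
  exact key G hG F h

variable [IsNoetherianRing Λ] [IsLocalRing Λ] [UniqueFactorizationMonoid Λ]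

/-- **Theorem A for an abstract family** (Lemma 8.2 inclusion direction + Lemma 8.5): for a finitely generated torsion
`A`-module `N`, cofinitely in `n` every `θ_n`-fibre `F` of `N` has `char_Λ(F) ⊆ θ_n(char_A N)·Λ`.
[cite: arXiv:1108.4708, Lemma 8.2, Lemma 8.5, Thm. 8.8] -/
theorem fam_eventually_charIdeal_fibre_le (hθ : ∀ n, Function.Surjective (θ n))
    (hker : ∀ n, RingHom.ker (θ n) = Ideal.span {x n}) (hx : ∀ n, Prime (x n))
    (hB : ∀ 𝔮 : Ideal A, 𝔮.IsPrime → 𝔮 ≠ IsLocalRing.maximalIdeal A → ∀ᶠ n in Filter.cofinite, x n ∉ 𝔮)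
    (hA : (IsLocalRing.maximalIdeal A).height = 3) (hΛ : 1 < (IsLocalRing.maximalIdeal Λ).height)
    (N : Type*) [AddCommGroup N] [Module A N] [Module.Finite A N] (hN : Module.IsTorsion A N) :
    ∀ᶠ n in Filter.cofinite, ∀ (F : Type uF₃) [AddCommGroup F] [Module Λ F]
      (φ : N →ₛₗ[θ n] F), Function.Surjective φ →
      (∀ y, φ y = 0 → y ∈ RingHom.ker (θ n) • (⊤ : Submodule A N)) →
      Module.charIdeal Λ F ≤ (Module.charIdeal A N).map (θ n) := by
  classical
  obtain ⟨m, r, e, g, hg, ψ, hψ⟩ := exists_isPseudoIsomorphism_pi_prime N hN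
  obtain ⟨a, haann, ha0⟩ := Submodule.annihilator_top_inter_nonZeroDivisors hN
  rw [SetLike.mem_coe, Submodule.annihilator_top] at haann
  have haN : ∀ y : N, a • y = 0 := fun y => Module.mem_annihilator.mp haann y
  have ha : a ≠ 0 := nonZeroDivisors.ne_zero ha0
  have hfin := finite_setOf_isPrime_annihilator_le hA.le
    ((Π i, Π k : Fin (r i), A ⧸ Ideal.span {g i ^ e i k}) ⧸ LinearMap.range ψ) hψ.2
  have h1 := fam_eventually_forall_not_mem hB hfin.toFinset (fun 𝔮 h𝔮 => by
    rw [Set.Finite.mem_toFinset] at h𝔮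
    exact ⟨h𝔮.1, h𝔮.2.2⟩)
  have h2 : ∀ᶠ n in Filter.cofinite, ∀ i, θ n (g i) ≠ 0 :=
    Filter.eventually_all.mpr fun i => fam_eventually_map_ne_zero_of_prime hker hx hB hA (hg i)
  have h3 := fam_eventually_map_ne_zero hker hx hB hA ha
  filter_upwards [h1, h2, h3] with n hn1 hn2 hn3 F _ _ φ hφ hφk
  refine charIdeal_fibre_le_map hΛ (θ n) (hθ n) hg ψ hψ hn2 haN hn3 (fun P hP hJP hkerP => ?_) φ hφ hφk
  by_contra hPm
  refine hn1 P (hfin.mem_toFinset.mpr ⟨hP, hJP, hPm⟩) (hkerP ?_)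
  rw [hker]
  exact Ideal.mem_span_singleton_self _

/-- **Theorem B for an abstract family**: `N` f.g. torsion over `A`, `G ∈ A`, `F_n` any `θ_n`-fibres of `N`;
`θ_n(G) ∈ char_Λ(F_n)` for infinitely many `n` ⇒ `(G) ⊆ char_A(N)`. [cite: arXiv:1108.4708, Thm. 8.8] -/
theorem fam_span_singleton_le_charIdeal_of_frequently (hθ : ∀ n, Function.Surjective (θ n))
    (hker : ∀ n, RingHom.ker (θ n) = Ideal.span {x n}) (hx : ∀ n, Prime (x n))
    (hB : ∀ 𝔮 : Ideal A, 𝔮.IsPrime → 𝔮 ≠ IsLocalRing.maximalIdeal A → ∀ᶠ n in Filter.cofinite, x n ∉ 𝔮)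
    (hA : (IsLocalRing.maximalIdeal A).height = 3) (hΛ : 1 < (IsLocalRing.maximalIdeal Λ).height)
    (N : Type*) [AddCommGroup N] [Module A N] [Module.Finite A N] (hN : Module.IsTorsion A N) {G : A}
    (F : ℕ → Type uF₃) [∀ n, AddCommGroup (F n)] [∀ n, Module Λ (F n)]
    (φ : ∀ n, N →ₛₗ[θ n] F n) (hφ : ∀ n, Function.Surjective (φ n))
    (hφk : ∀ n y, φ n y = 0 → y ∈ RingHom.ker (θ n) • (⊤ : Submodule A N))
    (h : ∃ᶠ n in Filter.cofinite, θ n G ∈ Module.charIdeal Λ (F n)) :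
    Ideal.span {G} ≤ Module.charIdeal A N := by
  classical
  obtain ⟨m, r, e, g, hg, ψ, hψ⟩ := exists_isPseudoIsomorphism_pi_prime N hN
  have ha' : ∀ i (k : Fin (r i)), g i ^ e i k ≠ 0 := fun i k => pow_ne_zero _ (hg i).ne_zero
  have hNchar : Module.charIdeal A N = Ideal.span {∏ i, ∏ k, g i ^ e i k} := by
    rw [← charIdeal_pi_pi_quotient (fun i k => g i ^ e i k) ha']
    exact Module.charIdeal_eq_of_arePseudoIsomorphic ⟨ψ, hψ⟩
  have hf0 : (∏ i, ∏ k, g i ^ e i k) ≠ 0 :=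
    Finset.prod_ne_zero_iff.mpr fun i _ => Finset.prod_ne_zero_iff.mpr fun k _ => ha' i k
  rw [hNchar, Ideal.span_singleton_le_span_singleton]
  refine fam_dvd_of_frequently_dvd hθ hker hx hB hA hf0 ?_
  refine (h.and_eventually (fam_eventually_charIdeal_fibre_le hθ hker hx hB hA hΛ N hN)).mono fun n hn => ?_
  obtain ⟨hn, hle⟩ := hn
  have := hle (F n) (φ n) (hφ n) (hφk n) hn
  rwa [hNchar, Ideal.map_span, Set.image_singleton, Ideal.mem_span_singleton] at this

/-- **Theorem B for an abstract family, no torsion hypothesis** (junk convention for non-torsion `N`).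
[cite: arXiv:1108.4708, Thm. 8.8] -/
theorem fam_span_singleton_le_charIdeal_of_frequently' (hθ : ∀ n, Function.Surjective (θ n))
    (hker : ∀ n, RingHom.ker (θ n) = Ideal.span {x n}) (hx : ∀ n, Prime (x n))
    (hB : ∀ 𝔮 : Ideal A, 𝔮.IsPrime → 𝔮 ≠ IsLocalRing.maximalIdeal A → ∀ᶠ n in Filter.cofinite, x n ∉ 𝔮)
    (hA : (IsLocalRing.maximalIdeal A).height = 3) (hΛ : 1 < (IsLocalRing.maximalIdeal Λ).height)
    (N : Type*) [AddCommGroup N] [Module A N] [Module.Finite A N] {G : A}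
    (F : ℕ → Type uF₃) [∀ n, AddCommGroup (F n)] [∀ n, Module Λ (F n)]
    (φ : ∀ n, N →ₛₗ[θ n] F n) (hφ : ∀ n, Function.Surjective (φ n))
    (hφk : ∀ n y, φ n y = 0 → y ∈ RingHom.ker (θ n) • (⊤ : Submodule A N))
    (h : ∃ᶠ n in Filter.cofinite, θ n G ∈ Module.charIdeal Λ (F n)) :
    Ideal.span {G} ≤ Module.charIdeal A N := by
  by_cases hN : Module.IsTorsion A N
  · exact fam_span_singleton_le_charIdeal_of_frequently hθ hker hx hB hA hΛ N hN F φ hφ hφk h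
  · rw [charIdeal_eq_top_of_not_isTorsion hN]
    exact le_top

/-- **Control form for an abstract family** (fibres replaced by pseudo-isomorphic `Λ`-modules `X_n`).
[cite: arXiv:1108.4708, Thm. 8.8] -/
theorem fam_span_singleton_le_charIdeal_of_frequently_of_arePseudoIsomorphic (hθ : ∀ n, Function.Surjective (θ n))
    (hker : ∀ n, RingHom.ker (θ n) = Ideal.span {x n}) (hx : ∀ n, Prime (x n))
    (hB : ∀ 𝔮 : Ideal A, 𝔮.IsPrime → 𝔮 ≠ IsLocalRing.maximalIdeal A → ∀ᶠ n in Filter.cofinite, x n ∉ 𝔮)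
    (hA : (IsLocalRing.maximalIdeal A).height = 3) (hΛ : 1 < (IsLocalRing.maximalIdeal Λ).height)
    (N : Type*) [AddCommGroup N] [Module A N] [Module.Finite A N] {G : A}
    (F : ℕ → Type uF₃) [∀ n, AddCommGroup (F n)] [∀ n, Module Λ (F n)]
    (φ : ∀ n, N →ₛₗ[θ n] F n) (hφ : ∀ n, Function.Surjective (φ n))
    (hφk : ∀ n y, φ n y = 0 → y ∈ RingHom.ker (θ n) • (⊤ : Submodule A N))
    (X : ℕ → Type uX₃) [∀ n, AddCommGroup (X n)] [∀ n, Module Λ (X n)]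
    (hX : ∀ n, Module.ArePseudoIsomorphic Λ (F n) (X n))
    (h : ∃ᶠ n in Filter.cofinite, θ n G ∈ Module.charIdeal Λ (X n)) :
    Ideal.span {G} ≤ Module.charIdeal A N :=
  fam_span_singleton_le_charIdeal_of_frequently' hθ hker hx hB hA hΛ N F φ hφ hφk
    (h.mono fun n hn => by rwa [← Module.charIdeal_eq_of_arePseudoIsomorphic (hX n)] at hn)


/-- **`ht 𝔪 = 3` for `W⟦T₁,T₂⟧`, `W` ANY discrete valuation ring** — the `hA` input of the family doors in the
(T6)(β) setting (the tree's `ringKrullDim_powerSeries_powerSeries` for a DVR). [cite: Matsumura1987, Thm. 15.4] -/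
theorem height_maximalIdeal_powerSeries_powerSeries (𝒪 : Type*) [CommRing 𝒪] [IsDomain 𝒪]
    [IsDiscreteValuationRing 𝒪] : (IsLocalRing.maximalIdeal (PowerSeries (PowerSeries 𝒪))).height = 3 := by
  have h := IsLocalRing.maximalIdeal_height_eq_ringKrullDim (R := PowerSeries (PowerSeries 𝒪))
  rw [Literature.NumberTheory.IwasawaTheory.ringKrullDim_powerSeries_powerSeries 𝒪,
    show (3 : WithBot ℕ∞) = ((3 : ℕ∞) : WithBot ℕ∞) from rfl, WithBot.coe_inj] at h
  exact h

/-- **`1 < ht 𝔪` for `W⟦T⟧`, `W` ANY discrete valuation ring** — the `hΛ` input of the family doors (chain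
`⊥ < (T) < 𝔪`, `(T) ≠ 𝔪` witnessed by a uniformiser). [cite: Washington1997, §13.2] -/
theorem one_lt_height_maximalIdeal_powerSeries (𝒪 : Type*) [CommRing 𝒪] [IsDomain 𝒪]
    [IsDiscreteValuationRing 𝒪] : 1 < (IsLocalRing.maximalIdeal (PowerSeries 𝒪)).height := by
  obtain ⟨ϖ, hϖ⟩ := IsDiscreteValuationRing.exists_irreducible 𝒪
  haveI hXp : (Ideal.span {(PowerSeries.X : PowerSeries 𝒪)}).IsPrime := PowerSeries.span_X_isPrime
  have h1 : (⊥ : Ideal (PowerSeries 𝒪)) < Ideal.span {PowerSeries.X} := by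
    refine bot_lt_iff_ne_bot.mpr ?_
    rw [Ne, Ideal.span_singleton_eq_bot]
    exact PowerSeries.X_ne_zero
  have h2 : Ideal.span {(PowerSeries.X : PowerSeries 𝒪)} < IsLocalRing.maximalIdeal (PowerSeries 𝒪) := by
    refine lt_of_le_of_ne (IsLocalRing.le_maximalIdeal hXp.ne_top) ?_
    intro h
    have hCm : PowerSeries.C ϖ ∈ IsLocalRing.maximalIdeal (PowerSeries 𝒪) := by
      refine (IsLocalRing.mem_maximalIdeal _).mpr (mem_nonunits_iff.mpr fun hu => hϖ.not_isUnit ?_)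
      simpa only [PowerSeries.constantCoeff_C] using PowerSeries.isUnit_iff_constantCoeff.mp hu
    rw [← h, Ideal.mem_span_singleton, PowerSeries.X_dvd_iff, PowerSeries.constantCoeff_C] at hCm
    exact hϖ.ne_zero hCm
  haveI : (⊥ : Ideal (PowerSeries 𝒪)).IsPrime := Ideal.isPrime_bot
  have e1 := Ideal.height_add_one_le_of_lt_of_isPrime h1
  have e2 := Ideal.height_add_one_le_of_lt_of_isPrime h2
  rw [Ideal.height_bot, zero_add] at e1
  have h2le : (2 : ℕ∞) ≤ (IsLocalRing.maximalIdeal (PowerSeries 𝒪)).height :=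
    calc (2 : ℕ∞) = 1 + 1 := by norm_num
      _ ≤ (Ideal.span {(PowerSeries.X : PowerSeries 𝒪)}).height + 1 := by gcongr
      _ ≤ _ := e2
  exact lt_of_lt_of_le (by norm_num) h2le

/-- **`W⟦T₁,T₂⟧` and `W⟦T⟧` are Noetherian local factorial domains** for ANY DVR `W` — the instance inputs of the family
doors in the (T6)(β) setting, collected from Mathlib and the tree (`uniqueFactorizationMonoid_powerSeries_powerSeries`).
[cite: Matsumura1987, Thm. 20.3] -/
theorem familyDoor_instances_powerSeries (𝒪 : Type*) [CommRing 𝒪] [IsDomain 𝒪] [IsDiscreteValuationRing 𝒪] :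
    (IsDomain (PowerSeries (PowerSeries 𝒪)) ∧ IsNoetherianRing (PowerSeries (PowerSeries 𝒪)) ∧
      IsLocalRing (PowerSeries (PowerSeries 𝒪)) ∧ UniqueFactorizationMonoid (PowerSeries (PowerSeries 𝒪))) ∧
    (IsDomain (PowerSeries 𝒪) ∧ IsNoetherianRing (PowerSeries 𝒪) ∧ IsLocalRing (PowerSeries 𝒪) ∧
      UniqueFactorizationMonoid (PowerSeries 𝒪)) :=
  ⟨⟨inferInstance, inferInstance, inferInstance,
      Literature.NumberTheory.IwasawaTheory.uniqueFactorizationMonoid_powerSeries_powerSeries 𝒪⟩,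
    ⟨inferInstance, inferInstance, inferInstance, inferInstance⟩⟩

end FamilyDoor

/-! ## §F10 THE SLACK (RATIONAL) DOORS FOR AN ABSTRACT FAMILY (v1.6, NEW) — per-line `d`-power slack absorbed

Same abstract Ochiai–Shimomoto family as §F2 (`A` Noetherian local factorial domain with `ht 𝔪_A = 3`, quotients `Λ` with
`ht 𝔪_Λ > 1`, `θ_n : A ↠ Λ`, `ker θ_n = (x_n)` prime ((T1)), avoidance (B) ((T2))), and a FIXED slack element `d ∈ A`
(at the crux: `d = p`, or `p` times a parasite). The per-line inputs are allowed a `d`-power denominator whose exponent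
`t_n` DEPENDS ON THE LINE: `θ_n(f) ∣ θ_n(d^{t_n} F)` resp. `θ_n(d^{t_n} G) ∈ char_Λ(F_n)` for infinitely many `n`. Output:
ONE exponent `a` with `f ∣ d^a F` resp. `(d^a G) ⊆ char_A(N)` — at `X_Gr,2` and `d = p` LITERALLY the conclusion shape
`∃ a, (p^a · G) ≤ char(X_Gr,2)·𝒪_{ℂ_p}⟦T₁,T₂⟧` of the skeleton's research stub `stub_ratEulerSystemSS` (§F11). The proof is the
§F2 minimal-primes argument run against the FINITE set `MinPrimes(π,F) ∪ MinPrimes(π,d)` (prime form, `π ∤ d`), then induction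
on the prime factorisation of `f` (factors dividing `d` are absorbed into `d^a`, the others divide `F`), then [OcSh15] Lemma
8.2/8.5 (`fam_eventually_charIdeal_fibre_le`) exactly as in Theorem B. WHY: on the lines of a (B)-family through the
supersingular two-variable module the one-variable classes (Beilinson–Flach / tempered distributions, lattice comparisons)
come with `p`-power denominators that are bounded on each line but NOT uniformly in the line; the slack door makes the
uniformity unnecessary. [cite: arXiv:1108.4708, Def. 8.1, Lemma 8.2, 8.5, 8.6, Thm. 8.8; Matsumura1987, Thm. 20.3] -/
section SlackDoor

universe uF₄ uX₄

variable {A Λ : Type*} [CommRing A] [CommRing Λ] {θ : ℕ → (A →+* Λ)} {x : ℕ → A}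
variable [IsLocalRing A] [IsNoetherianRing A] [IsDomain A]

omit [IsLocalRing A] in
/-- **Key step of the ring doors, isolated**: for `π` prime with `π ∤ H`, a prime `P` minimal over `(π, y)` that contains
`H` is minimal over `(π, H)` (chain `⊥ < (π) < P₀ ≤ P` with `P₀` minimal over `(π, H)`, and `ht P ≤ 2` by Krull's height
theorem, force `P₀ = P`). [cite: arXiv:1108.4708, Lemma 8.6, Thm. 8.8; Matsumura1987, Thm. 20.3] -/
theorem fam_mem_minimalPrimes_span_pair_of_mem {π H y : A} (hπ : Prime π) (hnd : ¬ π ∣ H) {P : Ideal A}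
    (hP : P ∈ (Ideal.span {π, y}).minimalPrimes) (hHP : H ∈ P) : P ∈ (Ideal.span {π, H}).minimalPrimes := by
  haveI hPp : P.IsPrime := hP.1.1
  have hπP : π ∈ P := hP.1.2 (Ideal.subset_span (by simp))
  have hIP : Ideal.span {π, H} ≤ P := by
    rw [Ideal.span_le, Set.insert_subset_iff, Set.singleton_subset_iff]; exact ⟨hπP, hHP⟩
  obtain ⟨P₀, hP₀, hP₀P⟩ := Ideal.exists_minimalPrimes_le hIP
  haveI hP₀p : P₀.IsPrime := hP₀.1.1
  have hP2 : P.height ≤ 2 := height_le_two_of_mem_minimalPrimes_span_pair _ _ hP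
  haveI hπI : (Ideal.span {π}).IsPrime := (Ideal.span_singleton_prime hπ.ne_zero).mpr hπ
  haveI : (⊥ : Ideal A).IsPrime := Ideal.isPrime_bot
  have hlt1 : (⊥ : Ideal A) < Ideal.span {π} := by
    refine bot_lt_iff_ne_bot.mpr ?_
    rw [Ne, Ideal.span_singleton_eq_bot]
    exact hπ.ne_zero
  have hlt2 : Ideal.span {π} < P₀ := by
    refine lt_of_le_of_ne ((Ideal.span_singleton_le_iff_mem _).mpr (hP₀.1.2 (Ideal.subset_span (by simp)))) ?_
    intro heq
    have hHπ : H ∈ Ideal.span {π} := by rw [heq]; exact hP₀.1.2 (Ideal.subset_span (by simp))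
    exact hnd (Ideal.mem_span_singleton.mp hHπ)
  have e1 := Ideal.height_add_one_le_of_lt_of_isPrime hlt1
  have e2 := Ideal.height_add_one_le_of_lt_of_isPrime hlt2
  rw [Ideal.height_bot, zero_add] at e1
  have hP₀2 : (2 : ℕ∞) ≤ P₀.height :=
    calc (2 : ℕ∞) = 1 + 1 := by norm_num
      _ ≤ (Ideal.span {π}).height + 1 := by gcongr
      _ ≤ P₀.height := e2
  have hPP₀ : P₀ = P := Ideal.eq_of_le_of_height_le (I := P₀) hP₀P (hP2.trans hP₀2)
  exact hPP₀ ▸ hP₀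

/-- **Ring-element SLACK door, prime form, for an abstract family**: `π` prime, `π ∤ d`, and `θ_n(π) ∣ θ_n(d^{t_n} F)` for
infinitely many `n` (slack exponents `t_n` depending on `n`) ⇒ `π ∣ F`. Choose `n` with `x_n` outside the minimal primes
of `(π,F)` AND of `(π,d)` ((B); all non-maximal at `ht 𝔪 = 3`); a minimal prime `P ∋ π, x_n, d^t F` of `(π, x_n)` contains
`d` or `F`, hence is minimal over `(π,d)` or over `(π,F)` (`fam_mem_minimalPrimes_span_pair_of_mem`) — contradiction.
[cite: arXiv:1108.4708, Thm. 8.8; Matsumura1987, Thm. 20.3] -/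
theorem fam_dvd_of_prime_of_frequently_dvd_pow_mul (hθ : ∀ n, Function.Surjective (θ n))
    (hker : ∀ n, RingHom.ker (θ n) = Ideal.span {x n}) (hx : ∀ n, Prime (x n))
    (hB : ∀ 𝔮 : Ideal A, 𝔮.IsPrime → 𝔮 ≠ IsLocalRing.maximalIdeal A → ∀ᶠ n in Filter.cofinite, x n ∉ 𝔮)
    (hA : (IsLocalRing.maximalIdeal A).height = 3) {π d F : A} (hπ : Prime π) (hd : ¬ π ∣ d)
    (h : ∃ᶠ n in Filter.cofinite, ∃ t : ℕ, θ n π ∣ θ n (d ^ t * F)) : π ∣ F := by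
  classical
  by_contra hnd
  have hfinF := Ideal.finite_minimalPrimes_of_isNoetherianRing A (Ideal.span {π, F})
  have hfind := Ideal.finite_minimalPrimes_of_isNoetherianRing A (Ideal.span {π, d})
  have hS : ∀ 𝔮 ∈ hfinF.toFinset ∪ hfind.toFinset, 𝔮.IsPrime ∧ 𝔮 ≠ IsLocalRing.maximalIdeal A := by
    intro 𝔮 h𝔮
    rcases Finset.mem_union.mp h𝔮 with h𝔮 | h𝔮
    · rw [Set.Finite.mem_toFinset] at h𝔮
      exact ⟨h𝔮.1.1, fam_ne_maximalIdeal_of_mem_minimalPrimes_span_pair hA π F h𝔮⟩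
    · rw [Set.Finite.mem_toFinset] at h𝔮
      exact ⟨h𝔮.1.1, fam_ne_maximalIdeal_of_mem_minimalPrimes_span_pair hA π d h𝔮⟩
  obtain ⟨n, ⟨t, hdiv⟩, hn⟩ := (h.and_eventually (fam_eventually_forall_not_mem hB _ hS)).exists
  have hF : d ^ t * F ∈ Ideal.span {π, x n} := fam_mem_span_pair_of_dvd (hθ n) (hker n) hdiv
  have hJ : Ideal.span {π, x n} ≤ IsLocalRing.maximalIdeal A := by
    rw [Ideal.span_le, Set.insert_subset_iff, Set.singleton_subset_iff]
    exact ⟨(IsLocalRing.mem_maximalIdeal _).mpr (mem_nonunits_iff.mpr hπ.not_unit),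
      (IsLocalRing.mem_maximalIdeal _).mpr (mem_nonunits_iff.mpr (hx n).not_unit)⟩
  obtain ⟨P, hP, -⟩ := Ideal.exists_minimalPrimes_le hJ
  haveI hPp : P.IsPrime := hP.1.1
  have hxP : x n ∈ P := hP.1.2 (Ideal.subset_span (by simp))
  rcases hPp.mem_or_mem (hP.1.2 hF) with hdP | hFP
  · have hmem : P ∈ hfinF.toFinset ∪ hfind.toFinset := Finset.mem_union_right _ (by
      rw [Set.Finite.mem_toFinset]
      exact fam_mem_minimalPrimes_span_pair_of_mem hπ hd hP (hPp.mem_of_pow_mem t hdP))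
    exact hn P hmem hxP
  · have hmem : P ∈ hfinF.toFinset ∪ hfind.toFinset := Finset.mem_union_left _ (by
      rw [Set.Finite.mem_toFinset]
      exact fam_mem_minimalPrimes_span_pair_of_mem hπ hnd hP hFP)
    exact hn P hmem hxP

variable [UniqueFactorizationMonoid A] [IsDomain Λ]

/-- **Ring-element SLACK door, general form, for an abstract family**: `f ≠ 0` and `θ_n(f) ∣ θ_n(d^{t_n} F)` for
infinitely many `n` ⇒ `f ∣ d^a F` for SOME `a` (induction on the prime factorisation of `f`: a prime factor dividing `d`
is absorbed into one more power of `d`; a prime factor not dividing `d` divides `F` by the prime form and is cancelled,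
`θ_n` of it being nonzero cofinitely). [cite: arXiv:1108.4708, Thm. 8.8; Matsumura1987, Thm. 20.3] -/
theorem fam_exists_dvd_pow_mul_of_frequently (hθ : ∀ n, Function.Surjective (θ n))
    (hker : ∀ n, RingHom.ker (θ n) = Ideal.span {x n}) (hx : ∀ n, Prime (x n))
    (hB : ∀ 𝔮 : Ideal A, 𝔮.IsPrime → 𝔮 ≠ IsLocalRing.maximalIdeal A → ∀ᶠ n in Filter.cofinite, x n ∉ 𝔮)
    (hA : (IsLocalRing.maximalIdeal A).height = 3) {d f F : A} (hf : f ≠ 0)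
    (h : ∃ᶠ n in Filter.cofinite, ∃ t : ℕ, θ n f ∣ θ n (d ^ t * F)) : ∃ a : ℕ, f ∣ d ^ a * F := by
  have key : ∀ f : A, f ≠ 0 → ∀ F : A, (∃ᶠ n in Filter.cofinite, ∃ t : ℕ, θ n f ∣ θ n (d ^ t * F)) →
      ∃ a : ℕ, f ∣ d ^ a * F := by
    intro f
    refine UniqueFactorizationMonoid.induction_on_prime f ?_ ?_ ?_
    · intro h0; exact absurd rfl h0
    · intro y hy _ F _
      exact ⟨0, (hy.dvd : y ∣ d ^ 0 * F)⟩
    · intro b π hb hπ IH _ F h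
      have hbF : ∀ F' : A, (∃ᶠ n in Filter.cofinite, ∃ t : ℕ, θ n (π * b) ∣ θ n (d ^ t * (π * F'))) →
          ∃ a : ℕ, b ∣ d ^ a * F' := fun F' h' =>
        IH hb F' ((h'.and_eventually (fam_eventually_map_ne_zero_of_prime hker hx hB hA hπ)).mono fun n hn => by
          obtain ⟨⟨t, hn⟩, hne⟩ := hn
          refine ⟨t, ?_⟩
          rw [mul_left_comm (d ^ t) π F', map_mul, map_mul] at hn
          exact (mul_dvd_mul_iff_left hne).mp hn)
      by_cases hπd : π ∣ d
      · obtain ⟨a, ha⟩ := IH hb F (h.mono fun n hn => by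
          obtain ⟨t, hn⟩ := hn
          refine ⟨t, dvd_trans ?_ hn⟩
          rw [map_mul]
          exact dvd_mul_left _ _)
        obtain ⟨e, rfl⟩ := hπd
        refine ⟨a + 1, ?_⟩
        have hre : (π * e) ^ (a + 1) * F = π * (e * ((π * e) ^ a * F)) := by ring
        rw [hre]
        exact mul_dvd_mul_left π (dvd_mul_of_dvd_right ha e)
      · have hπF : π ∣ F :=
          fam_dvd_of_prime_of_frequently_dvd_pow_mul hθ hker hx hB hA hπ hπd (h.mono fun n hn => by
            obtain ⟨t, hn⟩ := hn
            refine ⟨t, dvd_trans ?_ hn⟩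
            rw [map_mul]
            exact dvd_mul_right _ _)
        obtain ⟨F', rfl⟩ := hπF
        obtain ⟨a, ha⟩ := hbF F' h
        refine ⟨a, ?_⟩
        rw [mul_left_comm]
        exact mul_dvd_mul_left π ha
  exact key f hf F h

variable [IsNoetherianRing Λ] [IsLocalRing Λ] [UniqueFactorizationMonoid Λ]

/-- **Theorem B, SLACK form, for an abstract family**: `N` f.g. torsion over `A`, `d, G ∈ A`, `F_n` any `θ_n`-fibres of
`N`; `θ_n(d^{t_n} G) ∈ char_Λ(F_n)` for infinitely many `n` ⇒ `(d^a G) ⊆ char_A(N)` for some `a` (§F2 Theorem A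
`fam_eventually_charIdeal_fibre_le` + `fam_exists_dvd_pow_mul_of_frequently`). [cite: arXiv:1108.4708, Lemma 8.2, 8.5, Thm. 8.8] -/
theorem fam_exists_span_singleton_le_charIdeal_of_frequently (hθ : ∀ n, Function.Surjective (θ n))
    (hker : ∀ n, RingHom.ker (θ n) = Ideal.span {x n}) (hx : ∀ n, Prime (x n))
    (hB : ∀ 𝔮 : Ideal A, 𝔮.IsPrime → 𝔮 ≠ IsLocalRing.maximalIdeal A → ∀ᶠ n in Filter.cofinite, x n ∉ 𝔮)
    (hA : (IsLocalRing.maximalIdeal A).height = 3) (hΛ : 1 < (IsLocalRing.maximalIdeal Λ).height)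
    (N : Type*) [AddCommGroup N] [Module A N] [Module.Finite A N] (hN : Module.IsTorsion A N) {d G : A}
    (F : ℕ → Type uF₄) [∀ n, AddCommGroup (F n)] [∀ n, Module Λ (F n)]
    (φ : ∀ n, N →ₛₗ[θ n] F n) (hφ : ∀ n, Function.Surjective (φ n))
    (hφk : ∀ n y, φ n y = 0 → y ∈ RingHom.ker (θ n) • (⊤ : Submodule A N))
    (h : ∃ᶠ n in Filter.cofinite, ∃ t : ℕ, θ n (d ^ t * G) ∈ Module.charIdeal Λ (F n)) :
    ∃ a : ℕ, Ideal.span {d ^ a * G} ≤ Module.charIdeal A N := by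
  classical
  obtain ⟨m, r, e, g, hg, ψ, hψ⟩ := exists_isPseudoIsomorphism_pi_prime N hN
  have ha' : ∀ i (k : Fin (r i)), g i ^ e i k ≠ 0 := fun i k => pow_ne_zero _ (hg i).ne_zero
  have hNchar : Module.charIdeal A N = Ideal.span {∏ i, ∏ k, g i ^ e i k} := by
    rw [← charIdeal_pi_pi_quotient (fun i k => g i ^ e i k) ha']
    exact Module.charIdeal_eq_of_arePseudoIsomorphic ⟨ψ, hψ⟩
  have hf0 : (∏ i, ∏ k, g i ^ e i k) ≠ 0 :=
    Finset.prod_ne_zero_iff.mpr fun i _ => Finset.prod_ne_zero_iff.mpr fun k _ => ha' i k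
  simp_rw [hNchar, Ideal.span_singleton_le_span_singleton]
  refine fam_exists_dvd_pow_mul_of_frequently hθ hker hx hB hA hf0 ?_
  refine (h.and_eventually (fam_eventually_charIdeal_fibre_le hθ hker hx hB hA hΛ N hN)).mono fun n hn => ?_
  obtain ⟨⟨t, hn⟩, hle⟩ := hn
  have h1 := hle (F n) (φ n) (hφ n) (hφk n) hn
  rw [hNchar, Ideal.map_span, Set.image_singleton, Ideal.mem_span_singleton] at h1
  exact ⟨t, h1⟩

/-- **Theorem B, SLACK form, no torsion hypothesis** (junk convention `char = ⊤` for non-torsion `N`: `a = 0`).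
[cite: arXiv:1108.4708, Thm. 8.8] -/
theorem fam_exists_span_singleton_le_charIdeal_of_frequently' (hθ : ∀ n, Function.Surjective (θ n))
    (hker : ∀ n, RingHom.ker (θ n) = Ideal.span {x n}) (hx : ∀ n, Prime (x n))
    (hB : ∀ 𝔮 : Ideal A, 𝔮.IsPrime → 𝔮 ≠ IsLocalRing.maximalIdeal A → ∀ᶠ n in Filter.cofinite, x n ∉ 𝔮)
    (hA : (IsLocalRing.maximalIdeal A).height = 3) (hΛ : 1 < (IsLocalRing.maximalIdeal Λ).height)
    (N : Type*) [AddCommGroup N] [Module A N] [Module.Finite A N] {d G : A}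
    (F : ℕ → Type uF₄) [∀ n, AddCommGroup (F n)] [∀ n, Module Λ (F n)]
    (φ : ∀ n, N →ₛₗ[θ n] F n) (hφ : ∀ n, Function.Surjective (φ n))
    (hφk : ∀ n y, φ n y = 0 → y ∈ RingHom.ker (θ n) • (⊤ : Submodule A N))
    (h : ∃ᶠ n in Filter.cofinite, ∃ t : ℕ, θ n (d ^ t * G) ∈ Module.charIdeal Λ (F n)) :
    ∃ a : ℕ, Ideal.span {d ^ a * G} ≤ Module.charIdeal A N := by
  by_cases hN : Module.IsTorsion A N
  · exact fam_exists_span_singleton_le_charIdeal_of_frequently hθ hker hx hB hA hΛ N hN F φ hφ hφk h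
  · refine ⟨0, ?_⟩
    rw [charIdeal_eq_top_of_not_isTorsion hN]
    exact le_top

/-- **Control form of the SLACK door** (fibres replaced by pseudo-isomorphic `Λ`-modules `X_n`).
[cite: arXiv:1108.4708, Thm. 8.8] -/
theorem fam_exists_span_singleton_le_charIdeal_of_frequently_of_arePseudoIsomorphic
    (hθ : ∀ n, Function.Surjective (θ n))
    (hker : ∀ n, RingHom.ker (θ n) = Ideal.span {x n}) (hx : ∀ n, Prime (x n))
    (hB : ∀ 𝔮 : Ideal A, 𝔮.IsPrime → 𝔮 ≠ IsLocalRing.maximalIdeal A → ∀ᶠ n in Filter.cofinite, x n ∉ 𝔮)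
    (hA : (IsLocalRing.maximalIdeal A).height = 3) (hΛ : 1 < (IsLocalRing.maximalIdeal Λ).height)
    (N : Type*) [AddCommGroup N] [Module A N] [Module.Finite A N] {d G : A}
    (F : ℕ → Type uF₄) [∀ n, AddCommGroup (F n)] [∀ n, Module Λ (F n)]
    (φ : ∀ n, N →ₛₗ[θ n] F n) (hφ : ∀ n, Function.Surjective (φ n))
    (hφk : ∀ n y, φ n y = 0 → y ∈ RingHom.ker (θ n) • (⊤ : Submodule A N))
    (X : ℕ → Type uX₄) [∀ n, AddCommGroup (X n)] [∀ n, Module Λ (X n)]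
    (hX : ∀ n, Module.ArePseudoIsomorphic Λ (F n) (X n))
    (h : ∃ᶠ n in Filter.cofinite, ∃ t : ℕ, θ n (d ^ t * G) ∈ Module.charIdeal Λ (X n)) :
    ∃ a : ℕ, Ideal.span {d ^ a * G} ≤ Module.charIdeal A N :=
  fam_exists_span_singleton_le_charIdeal_of_frequently' hθ hker hx hB hA hΛ N F φ hφ hφk
    (h.mono fun n hn => by
      obtain ⟨t, hn⟩ := hn
      exact ⟨t, by rwa [← Module.charIdeal_eq_of_arePseudoIsomorphic (hX n)] at hn⟩)

end SlackDoor

/-! ## §F3 BASE CHANGE OF THE CHARACTERISTIC IDEAL ((β) step (iii)) — torsion, and the push lemma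

For a Noetherian UFD `R`, a Noetherian UFD `R`-algebra `S` with INJECTIVE structure map and a finite `R`-module `M`:
`char_S(S ⊗_R M) ⊆ char_R(M)·S`. This is [SkinnerUrban2014] Cor. 3.2.9 (ii) in the tree's base-change form
`SkinnerUrban2014.charIdeal_baseChange_le_span_singleton` (`Fitt` commutes with base change, `Char` = least principal ideal
above `Fitt₀`), fed with a generator of the principal ideal `char_R(M)` (`SkinnerUrban2014.exists_charIdeal_eq_span_prod`) and
with torsion-ness of `S ⊗_R M` (`isTorsion_baseChange_of_injective`); the non-torsion case is the junk convention
`char_R(M) = ⊤`. Pushed along ANY ring map `κ : S → T` it is the shape the crux wants. -/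

section BaseChange

universe uR uS uT uM

variable {R : Type uR} [CommRing R]

/-- Base change of a finitely generated TORSION module along an injective structure map into a domain is torsion: a
nonzero `s ∈ Ann_R(M)` (`Submodule.annihilator_top_inter_nonZeroDivisors`) maps to a nonzero, hence regular, element of `S`
killing `S ⊗_R M`. [folklore] [cite: BourbakiAC5to7, Ch. VII §4.5] -/
theorem isTorsion_baseChange_of_injective [IsDomain R] (S : Type uS) [CommRing S] [IsDomain S] [Algebra R S]
    (hinj : Function.Injective (algebraMap R S)) {M : Type uM} [AddCommGroup M] [Module R M] [Module.Finite R M]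
    (hM : Module.IsTorsion R M) : Module.IsTorsion S (S ⊗[R] M) := by
  obtain ⟨s, hsann, hs0⟩ := Submodule.annihilator_top_inter_nonZeroDivisors hM
  have hs : s ≠ 0 := nonZeroDivisors.ne_zero hs0
  have hsM : ∀ m : M, s • m = 0 := fun m => Submodule.mem_annihilator.mp hsann m Submodule.mem_top
  have hs' : algebraMap R S s ≠ 0 := fun h => hs (hinj (by rw [h, map_zero]))
  intro z
  refine ⟨⟨algebraMap R S s, mem_nonZeroDivisors_of_ne_zero hs'⟩, ?_⟩
  show algebraMap R S s • z = 0
  rw [algebraMap_smul]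
  induction z using TensorProduct.induction_on with
  | zero => exact smul_zero _
  | tmul b m => rw [TensorProduct.smul_tmul', TensorProduct.smul_tmul, hsM, TensorProduct.tmul_zero]
  | add y z hy hz => rw [smul_add, hy, hz, add_zero]

variable [IsNoetherianRing R] [IsDomain R] [UniqueFactorizationMonoid R]

/-- **THE PUSH LEMMA ((β)(iii)+(v), ring-general).** `R` a Noetherian UFD, `S` a Noetherian UFD `R`-algebra with injective
structure map, `M` a finite `R`-module, `κ : S → T` any ring map: `(g) ≤ char_S(S ⊗_R M)` ⇒ `(κ g) ≤ (char_R M)·T` (extension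
along `κ ∘ algebraMap`). Torsion `M`: `char_R M = (f)` (`SkinnerUrban2014.exists_charIdeal_eq_span_prod`),
`char_S(S ⊗ M) ≤ (f)·S` = [SkinnerUrban2014] Cor. 3.2.9 (ii) (`SkinnerUrban2014.charIdeal_baseChange_le_span_singleton`),
then `Ideal.map_mono`; non-torsion `M`: `char_R M = ⊤`. [cite: SkinnerUrban2014, Cor. 3.2.9 (ii) (p. 24)] -/
theorem span_singleton_map_le_of_le_charIdeal_baseChange (S : Type uS) [CommRing S] [Algebra R S]
    [IsNoetherianRing S] [IsDomain S] [UniqueFactorizationMonoid S]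
    (hinj : Function.Injective (algebraMap R S)) {T : Type uT} [CommRing T] (κ : S →+* T)
    (M : Type uM) [AddCommGroup M] [Module R M] [Module.Finite R M]
    {g : S} (hg : Ideal.span {g} ≤ Module.charIdeal S (S ⊗[R] M)) :
    Ideal.span {κ g} ≤ (Module.charIdeal R M).map (κ.comp (algebraMap R S)) := by
  classical
  by_cases hM : Module.IsTorsion R M
  · obtain ⟨t, π, -, -, -, hf⟩ := SkinnerUrban2014.exists_charIdeal_eq_span_prod (M := M) hM
    have h1 := SkinnerUrban2014.charIdeal_baseChange_le_span_singleton (M := M) S hf.le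
      (isTorsion_baseChange_of_injective S hinj hM)
    have h2 : Ideal.span {κ g} ≤ Ideal.span {κ (algebraMap R S (∏ 𝔭 ∈ t, π 𝔭 ^ (Module.lengthAt R M 𝔭).toNat))} := by
      have h3 := Ideal.map_mono (f := κ) (hg.trans h1)
      simpa only [Ideal.map_span, Set.image_singleton] using h3
    refine h2.trans (le_of_eq ?_)
    rw [hf, Ideal.map_span, Set.image_singleton, RingHom.comp_apply]
  · rw [charIdeal_eq_top_of_not_isTorsion hM, Ideal.map_top]
    exact le_top

end BaseChange

/-! ## §F4 THE CRUX'S CONCLUSION SHAPE FROM A DIVISIBILITY OVER `S ⊇ Λ₂`, and THE (β) DOOR ASSEMBLED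

At the crux's own module `X_Gr,2 = WeierstrassCurve.XGr₂ W p κ₁ κ₂ v̄ γ₁ γ₂` (finite over `Λ₂`: the instance binder is the landed
`Theorems.SignedBaseChangeAcDivFinitePiece.xGr₂_module_finite`, one `haveI` at the consumer). NO torsion hypothesis anywhere
(junk convention on both sides). -/

section CruxAssembly

open NumberField IsDedekindDomain

variable {p : ℕ} [Fact p.Prime]

universe uK uS uΛ uF' uX'

variable {K : Type uK} [Field K] [NumberField K] (W : WeierstrassCurve K)
  (κ₁ κ₂ : ZpExtension K p) (vbar : IsDedekindDomain.HeightOneSpectrum (NumberField.RingOfIntegers K))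
  (γ₁ γ₂ : Field.absoluteGaloisGroup K) [Fact (ZpExtension.IsTopGeneratorPair κ₁ κ₂ γ₁ γ₂)]
  [Module.Finite (IwasawaAlgebra₂ p) (W.XGr₂ p κ₁ κ₂ vbar γ₁ γ₂)]

/-- **THE CRUX'S CONCLUSION FROM A DIVISIBILITY OVER ANY NOETHERIAN UFD `S ⊇ Λ₂`.** `S` a Noetherian UFD `Λ₂`-algebra with
injective structure map, `η : S → 𝒪_{ℂ_p}⟦T₁⟧⟦T₂⟧` a ring map with `η ∘ algebraMap = toUnr₂ p J`, `u` a unit: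
`(g) ≤ char_S(S ⊗_{Λ₂} X_Gr,2)` ⇒ `(u · η g) ≤ (XGr₂.charIdeal W p κ₁ κ₂ v̄ γ₁ γ₂).map (toUnr₂ p J)` — LITERALLY the conclusion of
`TwoVariableEulerSystemDivisibility` for `G = u · η g`. (The push lemma at `M = X_Gr,2`; `XGr₂.charIdeal = Module.charIdeal Λ₂ X_Gr,2`
by `rfl`.) [cite: SkinnerUrban2014, Cor. 3.2.9 (ii) (p. 24); YanZhu2024MainConjNonCM, statement 4.1 (2) (arXiv:2412.20078v4)] -/
theorem xGr₂_span_singleton_le_map_toUnr₂_of_baseChange (J : ℤ_[p] →+* PadicComplexInt p)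
    (S : Type uS) [CommRing S] [Algebra (IwasawaAlgebra₂ p) S] [IsNoetherianRing S] [IsDomain S]
    [UniqueFactorizationMonoid S] (hinj : Function.Injective (algebraMap (IwasawaAlgebra₂ p) S))
    (η : S →+* PowerSeries (PowerSeries (PadicComplexInt p)))
    (hη : η.comp (algebraMap (IwasawaAlgebra₂ p) S) = IwasawaAlgebra₂.toUnr₂ p J)
    {g : S} (hg : Ideal.span {g} ≤ Module.charIdeal S (S ⊗[IwasawaAlgebra₂ p] W.XGr₂ p κ₁ κ₂ vbar γ₁ γ₂))
    {u : PowerSeries (PowerSeries (PadicComplexInt p))} (hu : IsUnit u) :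
    Ideal.span {u * η g} ≤
      (WeierstrassCurve.XGr₂.charIdeal W p κ₁ κ₂ vbar γ₁ γ₂).map (IwasawaAlgebra₂.toUnr₂ p J) := by
  haveI : UniqueFactorizationMonoid (IwasawaAlgebra₂ p) :=
    Literature.NumberTheory.IwasawaTheory.uniqueFactorizationMonoid_iwasawaAlgebraTwoVar p
  rw [Ideal.span_singleton_mul_left_unit hu, ← hη]
  exact span_singleton_map_le_of_le_charIdeal_baseChange S hinj η (W.XGr₂ p κ₁ κ₂ vbar γ₁ γ₂) hg

/-- **… for `S = W⟦T₁⟧⟦T₂⟧`, `W` ANY DVR with an injective structure map `ℤ_p → W`** (e.g. `W = unrIntegers p`, the ring the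
crux's Katz period `Ωp` lives in), `η = map (map ι)` for `ι : W → 𝒪_{ℂ_p}` with `ι ∘ algebraMap = J`: the `Λ₂`-algebra structure is
Mathlib's coefficientwise one (`PowerSeries.algebraPowerSeries`, twice), the structure map `map (map algebraMap)` is injective
(`PowerSeries.map_injective`), `S` is a Noetherian UFD (tree `uniqueFactorizationMonoid_powerSeries_powerSeries`).
[cite: SkinnerUrban2014, Cor. 3.2.9 (ii) (p. 24); BourbakiAC5to7, Ch. VII §4.5] -/
theorem xGr₂_span_singleton_le_map_toUnr₂_of_baseChange_powerSeries (J : ℤ_[p] →+* PadicComplexInt p)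
    (𝒪 : Type uS) [CommRing 𝒪] [IsDomain 𝒪] [IsDiscreteValuationRing 𝒪] [Algebra ℤ_[p] 𝒪]
    (hinj : Function.Injective (algebraMap ℤ_[p] 𝒪)) (ι : 𝒪 →+* PadicComplexInt p)
    (hι : ι.comp (algebraMap ℤ_[p] 𝒪) = J) {g : PowerSeries (PowerSeries 𝒪)}
    (hg : Ideal.span {g} ≤ Module.charIdeal (PowerSeries (PowerSeries 𝒪))
      (PowerSeries (PowerSeries 𝒪) ⊗[IwasawaAlgebra₂ p] W.XGr₂ p κ₁ κ₂ vbar γ₁ γ₂))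
    {u : PowerSeries (PowerSeries (PadicComplexInt p))} (hu : IsUnit u) :
    Ideal.span {u * PowerSeries.map (PowerSeries.map ι) g} ≤
      (WeierstrassCurve.XGr₂.charIdeal W p κ₁ κ₂ vbar γ₁ γ₂).map (IwasawaAlgebra₂.toUnr₂ p J) := by
  haveI : UniqueFactorizationMonoid (PowerSeries (PowerSeries 𝒪)) :=
    Literature.NumberTheory.IwasawaTheory.uniqueFactorizationMonoid_powerSeries_powerSeries 𝒪
  refine xGr₂_span_singleton_le_map_toUnr₂_of_baseChange W κ₁ κ₂ vbar γ₁ γ₂ J (PowerSeries (PowerSeries 𝒪)) ?_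
    (PowerSeries.map (PowerSeries.map ι)) ?_ hg hu
  · show Function.Injective (PowerSeries.map (PowerSeries.map (algebraMap ℤ_[p] 𝒪)))
    exact PowerSeries.map_injective _ (PowerSeries.map_injective _ hinj)
  · show (PowerSeries.map (PowerSeries.map ι)).comp (PowerSeries.map (PowerSeries.map (algebraMap ℤ_[p] 𝒪))) =
      PowerSeries.map (PowerSeries.map J)
    rw [← PowerSeries.map_comp, ← PowerSeries.map_comp, hι]

/-- **THE (β) DOOR ASSEMBLED — door 5♮ over `W⟦T₁⟧⟦T₂⟧` to the crux's verbatim conclusion.** `W` any DVR with injective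
`ℤ_p → W`, `ι : W → 𝒪_{ℂ_p}` over `J`; an ABSTRACT family `θ_n : W⟦T₁⟧⟦T₂⟧ ↠ Λ'` (`Λ'` any Noetherian local factorial domain with
`ht 𝔪 > 1`, e.g. `W⟦T⟧` by `one_lt_height_maximalIdeal_powerSeries`) with `ker θ_n = (x_n)`, `x_n` prime ((T1)) and the avoidance
(B) ((T2)); `θ_n`-fibres `F_n` of `W⟦T₁⟧⟦T₂⟧ ⊗_{Λ₂} X_Gr,2` (surjective `θ_n`-semilinear `φ_n` with `ker φ_n ⊆ (x_n)·(…)`) pseudo-isomorphic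
to `Λ'`-modules `X_n`; and `θ_n g ∈ char_{Λ'}(X_n)` for INFINITELY MANY `n`. THEN `(u · map (map ι) g) ≤ (XGr₂.charIdeal …).map (toUnr₂ p J)`
for every unit `u`. Proof: §F2 Theorem B (`fam_span_singleton_le_charIdeal_of_frequently_of_arePseudoIsomorphic`, `hA` =
`height_maximalIdeal_powerSeries_powerSeries W`) + `…_of_baseChange_powerSeries`. LEFT TO BUILD/ARITHMETIC: such a family over
`W⟦T₁⟧⟦T₂⟧` ((β)(ii)), the control `φ_n`/`hX` and the divisibilities `h` ((β)(iv)), `G = u · map (map ι) g` ((β)(vi)).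
[cite: arXiv:1108.4708, Thm. 8.8; SkinnerUrban2014, Cor. 3.2.9 (ii) (p. 24); YanZhu2024MainConjNonCM, statement 4.1 (2) (arXiv:2412.20078v4)] -/
theorem xGr₂_span_singleton_le_map_toUnr₂_of_frequently_fam (J : ℤ_[p] →+* PadicComplexInt p)
    (𝒪 : Type uS) [CommRing 𝒪] [IsDomain 𝒪] [IsDiscreteValuationRing 𝒪] [Algebra ℤ_[p] 𝒪]
    (hinj : Function.Injective (algebraMap ℤ_[p] 𝒪)) (ι : 𝒪 →+* PadicComplexInt p)
    (hι : ι.comp (algebraMap ℤ_[p] 𝒪) = J)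
    {Λ' : Type uΛ} [CommRing Λ'] [IsDomain Λ'] [IsNoetherianRing Λ'] [IsLocalRing Λ'] [UniqueFactorizationMonoid Λ']
    (hΛ : 1 < (IsLocalRing.maximalIdeal Λ').height)
    {θ : ℕ → (PowerSeries (PowerSeries 𝒪) →+* Λ')} {x : ℕ → PowerSeries (PowerSeries 𝒪)}
    (hθ : ∀ n, Function.Surjective (θ n)) (hker : ∀ n, RingHom.ker (θ n) = Ideal.span {x n})
    (hx : ∀ n, Prime (x n))
    (hB : ∀ 𝔮 : Ideal (PowerSeries (PowerSeries 𝒪)), 𝔮.IsPrime →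
      𝔮 ≠ IsLocalRing.maximalIdeal (PowerSeries (PowerSeries 𝒪)) → ∀ᶠ n in Filter.cofinite, x n ∉ 𝔮)
    {g : PowerSeries (PowerSeries 𝒪)}
    (F : ℕ → Type uF') [∀ n, AddCommGroup (F n)] [∀ n, Module Λ' (F n)]
    (φ : ∀ n, PowerSeries (PowerSeries 𝒪) ⊗[IwasawaAlgebra₂ p] W.XGr₂ p κ₁ κ₂ vbar γ₁ γ₂ →ₛₗ[θ n] F n)
    (hφ : ∀ n, Function.Surjective (φ n))
    (hφk : ∀ n y, φ n y = 0 → y ∈ RingHom.ker (θ n) •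
      (⊤ : Submodule (PowerSeries (PowerSeries 𝒪)) (PowerSeries (PowerSeries 𝒪) ⊗[IwasawaAlgebra₂ p] W.XGr₂ p κ₁ κ₂ vbar γ₁ γ₂)))
    (X : ℕ → Type uX') [∀ n, AddCommGroup (X n)] [∀ n, Module Λ' (X n)]
    (hX : ∀ n, Module.ArePseudoIsomorphic Λ' (F n) (X n))
    (h : ∃ᶠ n in Filter.cofinite, θ n g ∈ Module.charIdeal Λ' (X n))
    {u : PowerSeries (PowerSeries (PadicComplexInt p))} (hu : IsUnit u) :
    Ideal.span {u * PowerSeries.map (PowerSeries.map ι) g} ≤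
      (WeierstrassCurve.XGr₂.charIdeal W p κ₁ κ₂ vbar γ₁ γ₂).map (IwasawaAlgebra₂.toUnr₂ p J) := by
  haveI : UniqueFactorizationMonoid (PowerSeries (PowerSeries 𝒪)) :=
    Literature.NumberTheory.IwasawaTheory.uniqueFactorizationMonoid_powerSeries_powerSeries 𝒪
  have hg : Ideal.span {g} ≤ Module.charIdeal (PowerSeries (PowerSeries 𝒪))
      (PowerSeries (PowerSeries 𝒪) ⊗[IwasawaAlgebra₂ p] W.XGr₂ p κ₁ κ₂ vbar γ₁ γ₂) :=
    fam_span_singleton_le_charIdeal_of_frequently_of_arePseudoIsomorphic hθ hker hx hB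
      (height_maximalIdeal_powerSeries_powerSeries 𝒪) hΛ _ F φ hφ hφk X hX h
  exact xGr₂_span_singleton_le_map_toUnr₂_of_baseChange_powerSeries W κ₁ κ₂ vbar γ₁ γ₂ J 𝒪 hinj ι hι hg hu

/-- **… AT `W = unrIntegers p ⊂ ℂ_p`** (the ring of the crux's Katz period `Ωp : (unrIntegers p)ˣ`; Castella's `R₀`,
`𝒲 = W(𝔽̄_p)`), with the crux's OWN coefficient binder `J : ℤ_p → 𝒪_{ℂ_p}`, `(J x : ℂ_p) = x`, and print's
`J₀ : unrIntegers p → 𝒪_{ℂ_p}`, `(J₀ y : ℂ_p) = y` (`BurungaleCastellaSkinner2025.exists_ringHom_unrIntegers_padicComplexInt`):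
the structure map `ℤ_p → unrIntegers p` is an `[Algebra ℤ_[p] (unrIntegers p)]` binder with `(algebraMap x : ℂ_p) = x` (a consumer
holding print's `j : ℤ_[p] →+* unrIntegers p` says `letI := j.toAlgebra`); its injectivity is PROVED here (a nonzero kernel would
be `(p^n)` — `IsDiscreteValuationRing.ideal_eq_span_pow_irreducible`, `PadicInt.irreducible_p` — and `p^n ≠ 0` in `ℂ_p`), and
`J₀ ∘ algebraMap = J` is PROVED (both are the identity on `ℂ_p`-values). REMAINING RING INPUT, carried as the instance binder
`[IsDiscreteValuationRing (unrIntegers p)]`: `unrIntegers p` (the closure in `ℂ_p` of `ℤ[ζ_m : p ∤ m]`) is a DVR — a TREE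
THEOREM (critic V#26dj P1; corrected at v1.5): `Summit.BirchSwinnertonDyer.Rank1Residual.X2.HidaLimitAlgebra.isDiscreteValuationRing_unrIntegers`
(`HidaLimitCongruenceAlgebra.lean` :134, uniformiser `p` via `irreducible_natCast_p` :87; no Witt-vector identification involved);
the binder is kept only because this workfile imports Literature modules only — the consumer discharges it by
`haveI := HidaLimitAlgebra.isDiscreteValuationRing_unrIntegers (p := p)`. [cite: Castella2018, §3 (arXiv:1704.06608 p. 9)]
[cite: Serre1979LocalFields, Ch. II §5] [cite: SkinnerUrban2014, Cor. 3.2.9 (ii) (p. 24); arXiv:1108.4708, Thm. 8.8] -/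
theorem xGr₂_span_singleton_le_map_toUnr₂_of_frequently_fam_unr
    [Algebra ℤ_[p] (unrIntegers p)] [IsDiscreteValuationRing (unrIntegers p)]
    (hj : ∀ x : ℤ_[p], ((algebraMap ℤ_[p] (unrIntegers p) x : unrIntegers p) : ℂ_[p]) = ((x : ℚ_[p]) : ℂ_[p]))
    (J : ℤ_[p] →+* PadicComplexInt p)
    (hJ : ∀ x : ℤ_[p], ((J x : PadicComplexInt p) : ℂ_[p]) = ((x : ℚ_[p]) : ℂ_[p]))
    (J₀ : unrIntegers p →+* PadicComplexInt p)
    (hJ₀ : ∀ y : unrIntegers p, ((J₀ y : PadicComplexInt p) : ℂ_[p]) = (y : ℂ_[p]))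
    {Λ' : Type uΛ} [CommRing Λ'] [IsDomain Λ'] [IsNoetherianRing Λ'] [IsLocalRing Λ'] [UniqueFactorizationMonoid Λ']
    (hΛ : 1 < (IsLocalRing.maximalIdeal Λ').height)
    {θ : ℕ → (PowerSeries (PowerSeries (unrIntegers p)) →+* Λ')} {x : ℕ → PowerSeries (PowerSeries (unrIntegers p))}
    (hθ : ∀ n, Function.Surjective (θ n)) (hker : ∀ n, RingHom.ker (θ n) = Ideal.span {x n})
    (hx : ∀ n, Prime (x n))
    (hB : ∀ 𝔮 : Ideal (PowerSeries (PowerSeries (unrIntegers p))), 𝔮.IsPrime →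
      𝔮 ≠ IsLocalRing.maximalIdeal (PowerSeries (PowerSeries (unrIntegers p))) → ∀ᶠ n in Filter.cofinite, x n ∉ 𝔮)
    {g : PowerSeries (PowerSeries (unrIntegers p))}
    (F : ℕ → Type uF') [∀ n, AddCommGroup (F n)] [∀ n, Module Λ' (F n)]
    (φ : ∀ n, PowerSeries (PowerSeries (unrIntegers p)) ⊗[IwasawaAlgebra₂ p] W.XGr₂ p κ₁ κ₂ vbar γ₁ γ₂ →ₛₗ[θ n] F n)
    (hφ : ∀ n, Function.Surjective (φ n))
    (hφk : ∀ n y, φ n y = 0 → y ∈ RingHom.ker (θ n) •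
      (⊤ : Submodule (PowerSeries (PowerSeries (unrIntegers p)))
        (PowerSeries (PowerSeries (unrIntegers p)) ⊗[IwasawaAlgebra₂ p] W.XGr₂ p κ₁ κ₂ vbar γ₁ γ₂)))
    (X : ℕ → Type uX') [∀ n, AddCommGroup (X n)] [∀ n, Module Λ' (X n)]
    (hX : ∀ n, Module.ArePseudoIsomorphic Λ' (F n) (X n))
    (h : ∃ᶠ n in Filter.cofinite, θ n g ∈ Module.charIdeal Λ' (X n))
    {u : PowerSeries (PowerSeries (PadicComplexInt p))} (hu : IsUnit u) :
    Ideal.span {u * PowerSeries.map (PowerSeries.map J₀) g} ≤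
      (WeierstrassCurve.XGr₂.charIdeal W p κ₁ κ₂ vbar γ₁ γ₂).map (IwasawaAlgebra₂.toUnr₂ p J) := by
  have hp0 : ((p : ℂ_[p])) ≠ 0 := Nat.cast_ne_zero.mpr (Fact.out : p.Prime).ne_zero
  have hinj : Function.Injective (algebraMap ℤ_[p] (unrIntegers p)) := by
    rw [RingHom.injective_iff_ker_eq_bot]
    by_contra hne
    obtain ⟨n, hn⟩ := IsDiscreteValuationRing.ideal_eq_span_pow_irreducible hne PadicInt.irreducible_p
    have hmem : (p : ℤ_[p]) ^ n ∈ RingHom.ker (algebraMap ℤ_[p] (unrIntegers p)) := by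
      rw [hn]; exact Ideal.mem_span_singleton_self _
    rw [RingHom.mem_ker, map_pow, map_natCast] at hmem
    have h2 : ((p : ℂ_[p])) ^ n = 0 := by
      have h3 := congrArg (fun y : unrIntegers p => (y : ℂ_[p])) hmem
      simpa using h3
    exact pow_ne_zero n hp0 h2
  have hι : J₀.comp (algebraMap ℤ_[p] (unrIntegers p)) = J :=
    RingHom.ext fun a => Subtype.ext (by rw [RingHom.comp_apply, hJ₀, hj, hJ])
  exact xGr₂_span_singleton_le_map_toUnr₂_of_frequently_fam W κ₁ κ₂ vbar γ₁ γ₂ J (unrIntegers p) hinj J₀ hι hΛ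
    hθ hker hx hB F φ hφ hφk X hX h hu

end CruxAssembly

/-! ## §F5 TRANSPORT OF THE AVOIDANCE PROPERTY (B) ALONG `Λ₂ → W⟦T₁⟧⟦T₂⟧` ((β)(ii), the (T2) half — FORMAL)

If the `W`-family's elements are the images `x_n^W = ι(x_n)` of a `ℤ_p`-family along `ι = algebraMap : Λ₂ → W⟦T₁⟧⟦T₂⟧`
(`W` a DVR with `p ≠ 0`), then (B) for `(x_n^W)` FOLLOWS from (B) for `(x_n)` (= `SplitsliceExt` §9
`setOf_curveElt_mem_finite` for the explicit sequence): a non-maximal prime `𝔮` of `W⟦T₁⟧⟦T₂⟧` contracts to a NON-MAXIMAL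
prime of `Λ₂` — were `ι⁻¹𝔮 = 𝔪_{Λ₂}`, then `p, T₁, T₂ ∈ 𝔮`, the prime `𝔮 ∩ W ∋ p` is nonzero hence `= 𝔪_W` (`dim W = 1`), and
`(𝔪_W, T₁, T₂) = 𝔪` forces `𝔮 = 𝔪`. So of (T1)+(T2) over `W` only (T1) (the surjections `θ_n^W` with kernel `(ι x_n)` onto a
factorial `Λ'` of dimension `2`, i.e. `SplitsliceExt` §3/§7 read in `W`) remains to be built. -/

section FamilyTransport

/-- (B) transports along any ring map whose contraction sends non-maximal primes to non-maximal primes. [folklore]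
[cite: arXiv:1108.4708, Def. 8.1] -/
theorem fam_avoid_map_of_comap {A A' : Type*} [CommRing A] [CommRing A'] [IsLocalRing A] [IsLocalRing A']
    (ι : A →+* A')
    (hι : ∀ 𝔮 : Ideal A', 𝔮.IsPrime → 𝔮 ≠ IsLocalRing.maximalIdeal A' → 𝔮.comap ι ≠ IsLocalRing.maximalIdeal A)
    {x : ℕ → A}
    (hB : ∀ 𝔮 : Ideal A, 𝔮.IsPrime → 𝔮 ≠ IsLocalRing.maximalIdeal A → ∀ᶠ n in Filter.cofinite, x n ∉ 𝔮) :
    ∀ 𝔮 : Ideal A', 𝔮.IsPrime → 𝔮 ≠ IsLocalRing.maximalIdeal A' → ∀ᶠ n in Filter.cofinite, ι (x n) ∉ 𝔮 := by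
  intro 𝔮 h𝔮 hne
  haveI := h𝔮
  exact (hB (𝔮.comap ι) (Ideal.IsPrime.comap ι) (hι 𝔮 h𝔮 hne)).mono fun n hn hmem => hn (Ideal.mem_comap.mpr hmem)

/-- A prime of `W⟦T₁⟧⟦T₂⟧` (`W` local) containing `T₁`, `T₂` and the constants of `𝔪_W` IS the maximal ideal
(`f = T₂·g + C(T₁·h) + C(C(f(0,0)))`). [folklore] [cite: Matsumura1987, Thm. 15.4] -/
theorem eq_maximalIdeal_of_C_C_mem {𝒪 : Type*} [CommRing 𝒪] [IsLocalRing 𝒪]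
    {𝔮 : Ideal (PowerSeries (PowerSeries 𝒪))} (h𝔮 : 𝔮.IsPrime)
    (hc : ∀ c ∈ IsLocalRing.maximalIdeal 𝒪, PowerSeries.C (PowerSeries.C c) ∈ 𝔮)
    (hX : (PowerSeries.X : PowerSeries (PowerSeries 𝒪)) ∈ 𝔮)
    (hCX : PowerSeries.C (PowerSeries.X : PowerSeries 𝒪) ∈ 𝔮) :
    𝔮 = IsLocalRing.maximalIdeal (PowerSeries (PowerSeries 𝒪)) := by
  refine le_antisymm (IsLocalRing.le_maximalIdeal h𝔮.ne_top) fun f hf => ?_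
  set f₀ : PowerSeries 𝒪 := PowerSeries.constantCoeff f with hf₀
  set c : 𝒪 := PowerSeries.constantCoeff f₀ with hcdef
  have hcm : c ∈ IsLocalRing.maximalIdeal 𝒪 := by
    rw [IsLocalRing.mem_maximalIdeal, mem_nonunits_iff] at hf ⊢
    exact fun h => hf (PowerSeries.isUnit_iff_constantCoeff.mpr (PowerSeries.isUnit_iff_constantCoeff.mpr h))
  obtain ⟨g, hg⟩ : (PowerSeries.X : PowerSeries (PowerSeries 𝒪)) ∣ f - PowerSeries.C f₀ :=
    PowerSeries.X_dvd_iff.mpr (by rw [map_sub, PowerSeries.constantCoeff_C, hf₀, sub_self])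
  obtain ⟨h, hh⟩ : (PowerSeries.X : PowerSeries 𝒪) ∣ f₀ - PowerSeries.C c :=
    PowerSeries.X_dvd_iff.mpr (by rw [map_sub, PowerSeries.constantCoeff_C, hcdef, sub_self])
  have hdec : f = PowerSeries.X * g + PowerSeries.C (PowerSeries.X * h) + PowerSeries.C (PowerSeries.C c) := by
    rw [← hg, ← hh, map_sub]; ring
  rw [hdec]
  refine 𝔮.add_mem (𝔮.add_mem (𝔮.mul_mem_right _ hX) ?_) (hc c hcm)
  rw [map_mul]
  exact 𝔮.mul_mem_right _ hCX

variable {p : ℕ} [Fact p.Prime]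

omit [Fact p.Prime] in
/-- In a DVR with `p ≠ 0`, a prime containing `p` contains the maximal ideal (`dim ≤ 1`). [folklore]
[cite: SerreLocalFields1979, Ch. I §2] -/
theorem maximalIdeal_le_of_natCast_mem {𝒪 : Type*} [CommRing 𝒪] [IsDomain 𝒪] [IsDiscreteValuationRing 𝒪]
    (hp0 : ((p : ℕ) : 𝒪) ≠ 0) (𝔮₀ : Ideal 𝒪) (h : 𝔮₀.IsPrime) (hp : ((p : ℕ) : 𝒪) ∈ 𝔮₀) :
    IsLocalRing.maximalIdeal 𝒪 ≤ 𝔮₀ := by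
  have hne : 𝔮₀ ≠ ⊥ := fun h0 => hp0 (by rwa [h0, Ideal.mem_bot] at hp)
  haveI := Ideal.IsPrime.isMaximal h hne
  exact (IsLocalRing.eq_maximalIdeal this).ge

/-- **Non-maximal primes of `W⟦T₁⟧⟦T₂⟧` contract to non-maximal primes of `Λ₂`** along the coefficientwise structure map
`algebraMap = map (map (algebraMap ℤ_p W))` (`W` local, every prime of `W` containing `p` containing `𝔪_W` — e.g. a DVR with
`p ≠ 0`, `maximalIdeal_le_of_natCast_mem`). [folklore] [cite: arXiv:1108.4708, Def. 8.1; Matsumura1987, Thm. 15.4] -/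
theorem comap_ne_maximalIdeal_powerSeries {𝒪 : Type*} [CommRing 𝒪] [IsLocalRing 𝒪] [Algebra ℤ_[p] 𝒪]
    (h𝒪 : ∀ 𝔮₀ : Ideal 𝒪, 𝔮₀.IsPrime → ((p : ℕ) : 𝒪) ∈ 𝔮₀ → IsLocalRing.maximalIdeal 𝒪 ≤ 𝔮₀)
    {𝔮 : Ideal (PowerSeries (PowerSeries 𝒪))} (h𝔮 : 𝔮.IsPrime)
    (hne : 𝔮 ≠ IsLocalRing.maximalIdeal (PowerSeries (PowerSeries 𝒪))) :
    𝔮.comap (algebraMap (IwasawaAlgebra₂ p) (PowerSeries (PowerSeries 𝒪))) ≠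
      IsLocalRing.maximalIdeal (IwasawaAlgebra₂ p) := by
  intro heq
  apply hne
  have hmem : ∀ a ∈ IsLocalRing.maximalIdeal (IwasawaAlgebra₂ p),
      algebraMap (IwasawaAlgebra₂ p) (PowerSeries (PowerSeries 𝒪)) a ∈ 𝔮 :=
    fun a ha => Ideal.mem_comap.mp (heq ▸ ha)
  have halg : ∀ a : IwasawaAlgebra₂ p, algebraMap (IwasawaAlgebra₂ p) (PowerSeries (PowerSeries 𝒪)) a =
      PowerSeries.map (PowerSeries.map (algebraMap ℤ_[p] 𝒪)) a := fun a => rfl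
  have hXm : (PowerSeries.X : IwasawaAlgebra₂ p) ∈ IsLocalRing.maximalIdeal (IwasawaAlgebra₂ p) := by
    rw [IsLocalRing.mem_maximalIdeal, mem_nonunits_iff, PowerSeries.isUnit_iff_constantCoeff,
      PowerSeries.constantCoeff_X]
    exact not_isUnit_zero
  have hCXm : (PowerSeries.C PowerSeries.X : IwasawaAlgebra₂ p) ∈ IsLocalRing.maximalIdeal (IwasawaAlgebra₂ p) := by
    rw [IsLocalRing.mem_maximalIdeal, mem_nonunits_iff, PowerSeries.isUnit_iff_constantCoeff,
      PowerSeries.constantCoeff_C, PowerSeries.isUnit_iff_constantCoeff, PowerSeries.constantCoeff_X]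
    exact not_isUnit_zero
  have hpm : ((p : ℕ) : IwasawaAlgebra₂ p) ∈ IsLocalRing.maximalIdeal (IwasawaAlgebra₂ p) := by
    rw [IsLocalRing.mem_maximalIdeal, mem_nonunits_iff, PowerSeries.isUnit_iff_constantCoeff, map_natCast,
      PowerSeries.isUnit_iff_constantCoeff, map_natCast]
    exact PadicInt.irreducible_p.not_isUnit
  have hX : (PowerSeries.X : PowerSeries (PowerSeries 𝒪)) ∈ 𝔮 := by
    have h1 := hmem _ hXm
    rwa [halg, PowerSeries.map_X] at h1
  have hCX : PowerSeries.C (PowerSeries.X : PowerSeries 𝒪) ∈ 𝔮 := by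
    have h1 := hmem _ hCXm
    rwa [halg, PowerSeries.map_C, PowerSeries.map_X] at h1
  have hp : ((p : ℕ) : PowerSeries (PowerSeries 𝒪)) ∈ 𝔮 := by
    have h1 := hmem _ hpm
    rwa [map_natCast] at h1
  haveI := h𝔮
  have h𝔮₀ : IsLocalRing.maximalIdeal 𝒪 ≤
      𝔮.comap ((PowerSeries.C (R := PowerSeries 𝒪)).comp (PowerSeries.C (R := 𝒪))) :=
    h𝒪 _ (Ideal.IsPrime.comap _) (by rw [Ideal.mem_comap, map_natCast]; exact hp)
  exact eq_maximalIdeal_of_C_C_mem h𝔮 (fun c hc => by simpa only [Ideal.mem_comap, RingHom.comp_apply] using h𝔮₀ hc)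
    hX hCX

/-- **(B) OVER `W⟦T₁⟧⟦T₂⟧` FROM (B) OVER `Λ₂`** for the pushed family `x_n^W = algebraMap (x_n)`, `W` any DVR with `p ≠ 0`.
[cite: arXiv:1108.4708, Def. 8.1] -/
theorem fam_avoid_powerSeries_of_avoid (𝒪 : Type*) [CommRing 𝒪] [IsDomain 𝒪] [IsDiscreteValuationRing 𝒪]
    [Algebra ℤ_[p] 𝒪] (hp0 : ((p : ℕ) : 𝒪) ≠ 0) {x₀ : ℕ → IwasawaAlgebra₂ p}
    (hB₀ : ∀ 𝔮 : Ideal (IwasawaAlgebra₂ p), 𝔮.IsPrime → 𝔮 ≠ IsLocalRing.maximalIdeal (IwasawaAlgebra₂ p) →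
      ∀ᶠ n in Filter.cofinite, x₀ n ∉ 𝔮) :
    ∀ 𝔮 : Ideal (PowerSeries (PowerSeries 𝒪)), 𝔮.IsPrime → 𝔮 ≠ IsLocalRing.maximalIdeal (PowerSeries (PowerSeries 𝒪)) →
      ∀ᶠ n in Filter.cofinite, algebraMap (IwasawaAlgebra₂ p) (PowerSeries (PowerSeries 𝒪)) (x₀ n) ∉ 𝔮 :=
  fam_avoid_map_of_comap (algebraMap (IwasawaAlgebra₂ p) (PowerSeries (PowerSeries 𝒪)))
    (fun _ h𝔮 hne => comap_ne_maximalIdeal_powerSeries (maximalIdeal_le_of_natCast_mem hp0) h𝔮 hne) hB₀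

end FamilyTransport

/-! ## §F6 THE (β) DOOR AT `W = unrIntegers p` FOR A PUSHED FAMILY — (T2) discharged, (T1) the only family input left -/

section CruxAssemblyPushed

open NumberField IsDedekindDomain

variable {p : ℕ} [Fact p.Prime]

universe uK uΛ uF' uX'

variable {K : Type uK} [Field K] [NumberField K] (W : WeierstrassCurve K)
  (κ₁ κ₂ : ZpExtension K p) (vbar : IsDedekindDomain.HeightOneSpectrum (NumberField.RingOfIntegers K))
  (γ₁ γ₂ : Field.absoluteGaloisGroup K) [Fact (ZpExtension.IsTopGeneratorPair κ₁ κ₂ γ₁ γ₂)]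
  [Module.Finite (IwasawaAlgebra₂ p) (W.XGr₂ p κ₁ κ₂ vbar γ₁ γ₂)]

/-- **THE (β) DOOR AT `W = unrIntegers p` FOR A FAMILY PUSHED FROM `Λ₂`.** As `…_of_frequently_fam_unr`, but the family's
elements are `x_n^W = algebraMap (x₀ n)` for a `ℤ_p`-sequence `x₀ : ℕ → Λ₂` satisfying (B) OVER `Λ₂` (`hB₀` — for the explicit
sequence of `SplitsliceExt` §9 this is the theorem `setOf_curveElt_mem_finite`), and (B) over `W⟦T₁⟧⟦T₂⟧` is DISCHARGED by §F5
(`p ≠ 0` in `unrIntegers p ⊂ ℂ_p` by characteristic zero). FAMILY INPUT LEFT ((β)(ii) = (T1) only): surjections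
`θ_n : (unrIntegers p)⟦T₁⟧⟦T₂⟧ ↠ Λ'` onto ONE Noetherian local factorial domain `Λ'` with `1 < ht 𝔪` (e.g. `(unrIntegers p)⟦T⟧`),
`ker θ_n = (x_n^W)`, `x_n^W` prime. Ring binder `[IsDiscreteValuationRing (unrIntegers p)]` ((β)(vii)) = tree theorem
`HidaLimitAlgebra.isDiscreteValuationRing_unrIntegers` (one `haveI` for the consumer; V#26dj P1). Arithmetic left:
`φ_n`, `hX`, `h` ((β)(iv)) and `G = u · map (map J₀) g` ((β)(vi)).
[cite: arXiv:1108.4708, Def. 8.1, Thm. 8.8; SkinnerUrban2014, Cor. 3.2.9 (ii) (p. 24); YanZhu2024MainConjNonCM, statement 4.1 (2) (arXiv:2412.20078v4)] -/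
theorem xGr₂_span_singleton_le_map_toUnr₂_of_frequently_pushedFam_unr
    [Algebra ℤ_[p] (unrIntegers p)] [IsDiscreteValuationRing (unrIntegers p)]
    (hj : ∀ x : ℤ_[p], ((algebraMap ℤ_[p] (unrIntegers p) x : unrIntegers p) : ℂ_[p]) = ((x : ℚ_[p]) : ℂ_[p]))
    (J : ℤ_[p] →+* PadicComplexInt p)
    (hJ : ∀ x : ℤ_[p], ((J x : PadicComplexInt p) : ℂ_[p]) = ((x : ℚ_[p]) : ℂ_[p]))
    (J₀ : unrIntegers p →+* PadicComplexInt p)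
    (hJ₀ : ∀ y : unrIntegers p, ((J₀ y : PadicComplexInt p) : ℂ_[p]) = (y : ℂ_[p]))
    {Λ' : Type uΛ} [CommRing Λ'] [IsDomain Λ'] [IsNoetherianRing Λ'] [IsLocalRing Λ'] [UniqueFactorizationMonoid Λ']
    (hΛ : 1 < (IsLocalRing.maximalIdeal Λ').height)
    {x₀ : ℕ → IwasawaAlgebra₂ p}
    (hB₀ : ∀ 𝔮 : Ideal (IwasawaAlgebra₂ p), 𝔮.IsPrime → 𝔮 ≠ IsLocalRing.maximalIdeal (IwasawaAlgebra₂ p) →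
      ∀ᶠ n in Filter.cofinite, x₀ n ∉ 𝔮)
    {θ : ℕ → (PowerSeries (PowerSeries (unrIntegers p)) →+* Λ')}
    (hθ : ∀ n, Function.Surjective (θ n))
    (hker : ∀ n, RingHom.ker (θ n) =
      Ideal.span {algebraMap (IwasawaAlgebra₂ p) (PowerSeries (PowerSeries (unrIntegers p))) (x₀ n)})
    (hx : ∀ n, Prime (algebraMap (IwasawaAlgebra₂ p) (PowerSeries (PowerSeries (unrIntegers p))) (x₀ n)))
    {g : PowerSeries (PowerSeries (unrIntegers p))}
    (F : ℕ → Type uF') [∀ n, AddCommGroup (F n)] [∀ n, Module Λ' (F n)]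
    (φ : ∀ n, PowerSeries (PowerSeries (unrIntegers p)) ⊗[IwasawaAlgebra₂ p] W.XGr₂ p κ₁ κ₂ vbar γ₁ γ₂ →ₛₗ[θ n] F n)
    (hφ : ∀ n, Function.Surjective (φ n))
    (hφk : ∀ n y, φ n y = 0 → y ∈ RingHom.ker (θ n) •
      (⊤ : Submodule (PowerSeries (PowerSeries (unrIntegers p)))
        (PowerSeries (PowerSeries (unrIntegers p)) ⊗[IwasawaAlgebra₂ p] W.XGr₂ p κ₁ κ₂ vbar γ₁ γ₂)))
    (X : ℕ → Type uX') [∀ n, AddCommGroup (X n)] [∀ n, Module Λ' (X n)]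
    (hX : ∀ n, Module.ArePseudoIsomorphic Λ' (F n) (X n))
    (h : ∃ᶠ n in Filter.cofinite, θ n g ∈ Module.charIdeal Λ' (X n))
    {u : PowerSeries (PowerSeries (PadicComplexInt p))} (hu : IsUnit u) :
    Ideal.span {u * PowerSeries.map (PowerSeries.map J₀) g} ≤
      (WeierstrassCurve.XGr₂.charIdeal W p κ₁ κ₂ vbar γ₁ γ₂).map (IwasawaAlgebra₂.toUnr₂ p J) := by
  have hp0 : ((p : ℕ) : unrIntegers p) ≠ 0 := fun h0 => by
    have h1 : ((p : ℕ) : ℂ_[p]) = 0 := by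
      have h2 := congrArg (fun y : unrIntegers p => (y : ℂ_[p])) h0
      simpa using h2
    exact Nat.cast_ne_zero.mpr (Fact.out : p.Prime).ne_zero h1
  exact xGr₂_span_singleton_le_map_toUnr₂_of_frequently_fam_unr W κ₁ κ₂ vbar γ₁ γ₂ hj J hJ J₀ hJ₀ hΛ hθ hker hx
    (fam_avoid_powerSeries_of_avoid (unrIntegers p) hp0 hB₀) F φ hφ hφk X hX h hu

end CruxAssemblyPushed

/-! ## §F7 THE OUTER-VARIABLE SPECIALISATION BY WEIERSTRASS DIVISION ((β)(ii) (T1), ring-general; v1.3)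

For a complete local ring `A` (here `A = W⟦T⟧`) and `s ∈ 𝔪_A`, the polynomial `X − s ∈ A[X]` is DISTINGUISHED, so Mathlib's
Weierstrass division (`Polynomial.IsDistinguishedAt.algEquivQuotient`, [Washington1997] Prop. 7.2) gives
`A⟦X⟧/(X − s) ≅ A[X]/(X − s) ≅ A`: a SURJECTION `outerChar s : A⟦X⟧ ↠ A`, `C a ↦ a`, `X ↦ s`, with KERNEL `(X − C s)`,
and `X − C s` is PRIME when `A` is a domain. This is (T1) for the OUTER-SOLVED form `X − C s` of a deep graph member
(`SplitsliceExt`'s `λ_{a,d} = (1+T₂) − d(1+T₁)^a` solves the INNER variable; its image under the swap frame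
`IwasawaAlgebra₂.frameSubst W swapFrame` is `X − C s` with `s = d(1+T)^a − 1`, `s(0) = d − 1 ∈ pW`) — with NO `p`-adic
analysis beyond the instance `[IsAdicComplete 𝔪_{W⟦T⟧} W⟦T⟧]` (true for a complete DVR `W`; carried as a binder, like
`[IsAdicComplete (p) 𝒪]` in `DualExpEllipticReciprocityLaw`). [cite: Washington1997, §7.1 Prop. 7.2; arXiv:1108.4708, Def. 8.1] -/

section OuterDoor

variable {A : Type*} [CommRing A] [IsLocalRing A]

/-- `X − s` (`s ∈ 𝔪_A`) is a distinguished polynomial. [cite: Washington1997, §7.1] -/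
theorem isDistinguishedAt_X_sub_C {s : A} (hs : s ∈ IsLocalRing.maximalIdeal A) :
    (Polynomial.X - Polynomial.C s : Polynomial A).IsDistinguishedAt (IsLocalRing.maximalIdeal A) where
  mem := fun {n} hn => by
    rw [Polynomial.natDegree_X_sub_C, Nat.lt_one_iff] at hn
    subst hn
    rw [Polynomial.coeff_sub, Polynomial.coeff_X_zero, Polynomial.coeff_C_zero, zero_sub]
    exact neg_mem hs
  monic := Polynomial.monic_X_sub_C s

omit [IsLocalRing A] in
/-- The power series of the polynomial `X − s` is `X − C s`. [folklore] -/
theorem coe_X_sub_C (s : A) :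
    ((Polynomial.X - Polynomial.C s : Polynomial A) : PowerSeries A) = PowerSeries.X - PowerSeries.C s := by
  rw [← Polynomial.coeToPowerSeries.ringHom_apply, map_sub, Polynomial.coeToPowerSeries.ringHom_apply,
    Polynomial.coeToPowerSeries.ringHom_apply, Polynomial.coe_X, Polynomial.coe_C]

variable [IsAdicComplete (IsLocalRing.maximalIdeal A) A]

/-- **The OUTER-VARIABLE specialisation `A⟦X⟧ → A`, `X ↦ s`** (`s ∈ 𝔪_A`, `A` complete local), BY WEIERSTRASS DIVISION:
`A⟦X⟧ ↠ A⟦X⟧/(X − s) ≅ A[X]/(X − s) ≅ A`. [cite: Washington1997, §7.1 Prop. 7.2] -/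
noncomputable def outerChar (s : A) (hs : s ∈ IsLocalRing.maximalIdeal A) : PowerSeries A →+* A :=
  ((Polynomial.quotientSpanXSubCAlgEquiv s).toRingEquiv.toRingHom.comp
      (isDistinguishedAt_X_sub_C hs).algEquivQuotient.symm.toRingEquiv.toRingHom).comp
    (Ideal.Quotient.mk (Ideal.span {((Polynomial.X - Polynomial.C s : Polynomial A) : PowerSeries A)}))

/-- `outerChar s (C a) = a`. [cite: Washington1997, §7.1 Prop. 7.2] -/
theorem outerChar_C {s : A} (hs : s ∈ IsLocalRing.maximalIdeal A) (a : A) :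
    outerChar s hs (PowerSeries.C a) = a := by
  have h1 : Ideal.Quotient.mk (Ideal.span {((Polynomial.X - Polynomial.C s : Polynomial A) : PowerSeries A)})
      (PowerSeries.C a) = algebraMap A _ a := by
    rw [IsScalarTower.algebraMap_apply A (PowerSeries A) (PowerSeries A ⧸ _), Ideal.Quotient.algebraMap_eq,
      PowerSeries.algebraMap_apply, Algebra.algebraMap_self, RingHom.id_apply]
  show (Polynomial.quotientSpanXSubCAlgEquiv s) ((isDistinguishedAt_X_sub_C hs).algEquivQuotient.symm
    (Ideal.Quotient.mk _ (PowerSeries.C a))) = a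
  rw [h1, AlgEquiv.commutes, AlgEquiv.commutes, Algebra.algebraMap_self, RingHom.id_apply]

/-- `ker (outerChar s)` is `(X − C s)`, elementwise. [cite: Washington1997, §7.1 Prop. 7.2] -/
theorem mem_ker_outerChar_iff {s : A} (hs : s ∈ IsLocalRing.maximalIdeal A) (F : PowerSeries A) :
    F ∈ RingHom.ker (outerChar s hs) ↔ F ∈ Ideal.span {PowerSeries.X - PowerSeries.C s} := by
  rw [RingHom.mem_ker, ← coe_X_sub_C]
  show (Polynomial.quotientSpanXSubCAlgEquiv s) ((isDistinguishedAt_X_sub_C hs).algEquivQuotient.symm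
    (Ideal.Quotient.mk _ F)) = 0 ↔ _
  rw [EmbeddingLike.map_eq_zero_iff, EmbeddingLike.map_eq_zero_iff, Ideal.Quotient.eq_zero_iff_mem]

/-- **(T1), kernel: `ker (outerChar s) = (X − C s)`.** [cite: Washington1997, §7.1 Prop. 7.2; arXiv:1108.4708, Def. 8.1] -/
theorem ker_outerChar {s : A} (hs : s ∈ IsLocalRing.maximalIdeal A) :
    RingHom.ker (outerChar s hs) = Ideal.span {PowerSeries.X - PowerSeries.C s} :=
  Ideal.ext (mem_ker_outerChar_iff hs)

/-- `outerChar s X = s`. [cite: Washington1997, §7.1 Prop. 7.2] -/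
theorem outerChar_X {s : A} (hs : s ∈ IsLocalRing.maximalIdeal A) : outerChar s hs PowerSeries.X = s := by
  have h : PowerSeries.X - PowerSeries.C s ∈ RingHom.ker (outerChar s hs) :=
    (mem_ker_outerChar_iff hs _).mpr (Ideal.mem_span_singleton_self _)
  rw [RingHom.mem_ker, map_sub, outerChar_C, sub_eq_zero] at h
  exact h

/-- **(T1), surjectivity.** [cite: arXiv:1108.4708, Def. 8.1] -/
theorem outerChar_surjective {s : A} (hs : s ∈ IsLocalRing.maximalIdeal A) :
    Function.Surjective (outerChar s hs) := fun a => ⟨PowerSeries.C a, outerChar_C hs a⟩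

/-- **(T1), primality: `X − C s` is a prime element of `A⟦X⟧`** (`A` a complete local domain, `s ∈ 𝔪_A`).
[cite: arXiv:1108.4708, Def. 8.1] -/
theorem prime_X_sub_C [IsDomain A] {s : A} (hs : s ∈ IsLocalRing.maximalIdeal A) :
    Prime (PowerSeries.X - PowerSeries.C s : PowerSeries A) := by
  have hne : (PowerSeries.X - PowerSeries.C s : PowerSeries A) ≠ 0 := fun h0 => by
    have h1 := congrArg (PowerSeries.coeff 1) h0
    rw [map_sub, PowerSeries.coeff_one_X, PowerSeries.coeff_C, if_neg one_ne_zero, sub_zero, map_zero] at h1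
    exact one_ne_zero h1
  rw [← Ideal.span_singleton_prime hne, ← ker_outerChar hs]
  exact RingHom.ker_isPrime _

end OuterDoor

/-! ## §F8 THE (β) DOOR AT `unrIntegers p` FOR THE OUTER-SOLVED PUSHED FAMILY — (T1) AND (T2) BOTH DISCHARGED (v1.3)

Family `x_n^W = X − C(s_n^W)`, `s_n^W = map (algebraMap ℤ_p W) (s₀ n)` with `s₀ n ∈ ℤ_p⟦T⟧`, `s₀ n (0) ∈ pℤ_p`:
`θ_n^W := outerChar (s_n^W)` (§F7) has (T1) by §F7 and (B) by §F5 from (B) OVER `Λ₂` for `X − C(s₀ n)`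
(= `SplitsliceExt` §9's `setOf_curveElt_mem_finite` transported through the swap frame — an automorphism of `Λ₂`).
REMAINING INPUTS of the (β) chain after v1.3: RING — `[IsDiscreteValuationRing (unrIntegers p)]` and
`¬ IsUnit (p : unrIntegers p)` are TREE THEOREMS one line away (`HidaLimitAlgebra.isDiscreteValuationRing_unrIntegers`,
`HidaLimitAlgebra.irreducible_natCast_p.not_isUnit`, `Summits/…/Rank1Residual/X2/HidaLimitCongruenceAlgebra.lean` :134/:87;
V#26dj P1; binders kept because this workfile imports Literature only), and `[IsAdicComplete 𝔪 ((unrIntegers p)⟦T⟧)]` is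
ALSO a TREE THEOREM (critic V#26dm P2, correcting v1.3–v1.5's «no tree/Mathlib decl found»):
`Literature.NumberTheory.GaloisRepresentations.powerSeries_isAdicComplete_maximalIdeal`
(`Literature/NumberTheory/GaloisRepresentations/PotentialDiagonalizabilityCriteriaProofs.lean` :1265 —
`[CommRing R] [IsLocalRing R] [IsAdicComplete (maximalIdeal R) R] : IsAdicComplete (maximalIdeal R⟦X⟧) R⟦X⟧`) over
`Summit.BirchSwinnertonDyer.BirchSwinnertonDyer.Theorems.CongruentShaFreeCutUnrSeriesWeierstrass.isAdicComplete_maximalIdeal`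
(`Summits/…/Theorems/CongruentShaFreeCutUnrSeriesWeierstrass.lean` :156, via `isAdicComplete_span_p` :103 + `maximalIdeal_eq_span_p`
:90) — the consumer's two `haveI`; the binder stays here because that Literature module is outside this file's import closure
and the `Summits` theorem cannot be imported into a crux workfile; ARITHMETIC — the control
data `φ_n`, `hφk`, `hX` and the one-variable divisibilities `h` ((β)(iv)); the `W`-rationality `G = u · map (map J₀) g` ((β)(vi));
and (B) over `Λ₂` for the chosen `s₀` (`hB₀`, `SplitsliceExt` §9 + swap). -/

section CruxAssemblyOuter

open NumberField IsDedekindDomain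

variable {p : ℕ} [Fact p.Prime]

/-- The pushed inner series `map (algebraMap ℤ_p 𝒪) s₀` lies in `𝔪_{𝒪⟦T⟧}` when `s₀(0) ∈ pℤ_p` and `p` is a non-unit
of `𝒪`. [folklore] -/
theorem map_mem_maximalIdeal_powerSeries {𝒪 : Type*} [CommRing 𝒪] [IsLocalRing 𝒪] [Algebra ℤ_[p] 𝒪]
    (hp : ¬ IsUnit ((p : ℕ) : 𝒪)) {s₀ : PowerSeries ℤ_[p]}
    (hs₀ : PowerSeries.constantCoeff s₀ ∈ IsLocalRing.maximalIdeal ℤ_[p]) :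
    PowerSeries.map (algebraMap ℤ_[p] 𝒪) s₀ ∈ IsLocalRing.maximalIdeal (PowerSeries 𝒪) := by
  rw [IsLocalRing.mem_maximalIdeal, mem_nonunits_iff, PowerSeries.isUnit_iff_constantCoeff,
    ← PowerSeries.coeff_zero_eq_constantCoeff_apply, PowerSeries.coeff_map,
    PowerSeries.coeff_zero_eq_constantCoeff_apply]
  rw [PadicInt.maximalIdeal_eq_span_p, Ideal.mem_span_singleton'] at hs₀
  obtain ⟨b, hb⟩ := hs₀
  rw [← hb, map_mul, map_natCast]
  exact fun h => hp (isUnit_of_mul_isUnit_right h)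

/-- **The outer-solved `W`-family** `θ_n^W := outerChar (map (algebraMap ℤ_p 𝒪) (s₀ n))`.
[cite: arXiv:1108.4708, Def. 8.1; Washington1997, §7.1 Prop. 7.2] -/
noncomputable def outerFam {𝒪 : Type*} [CommRing 𝒪] [IsLocalRing 𝒪] [Algebra ℤ_[p] 𝒪]
    [IsAdicComplete (IsLocalRing.maximalIdeal (PowerSeries 𝒪)) (PowerSeries 𝒪)]
    (hp : ¬ IsUnit ((p : ℕ) : 𝒪)) (s₀ : ℕ → PowerSeries ℤ_[p])
    (hs₀ : ∀ n, PowerSeries.constantCoeff (s₀ n) ∈ IsLocalRing.maximalIdeal ℤ_[p]) (n : ℕ) :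
    PowerSeries (PowerSeries 𝒪) →+* PowerSeries 𝒪 :=
  outerChar (PowerSeries.map (algebraMap ℤ_[p] 𝒪) (s₀ n)) (map_mem_maximalIdeal_powerSeries hp (hs₀ n))

/-- `algebraMap (X − C s₀) = X − C (map (algebraMap ℤ_p 𝒪) s₀)` along `Λ₂ → 𝒪⟦T⟧⟦X⟧`. [folklore] -/
theorem algebraMap_X_sub_C (𝒪 : Type*) [CommRing 𝒪] [Algebra ℤ_[p] 𝒪] (s₀ : PowerSeries ℤ_[p]) :
    algebraMap (IwasawaAlgebra₂ p) (PowerSeries (PowerSeries 𝒪)) (PowerSeries.X - PowerSeries.C s₀) =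
      PowerSeries.X - PowerSeries.C (PowerSeries.map (algebraMap ℤ_[p] 𝒪) s₀) := by
  show PowerSeries.map (PowerSeries.map (algebraMap ℤ_[p] 𝒪)) _ = _
  rw [map_sub, PowerSeries.map_X, PowerSeries.map_C]

universe uK uF' uX'

variable {K : Type uK} [Field K] [NumberField K] (W : WeierstrassCurve K)
  (κ₁ κ₂ : ZpExtension K p) (vbar : IsDedekindDomain.HeightOneSpectrum (NumberField.RingOfIntegers K))
  (γ₁ γ₂ : Field.absoluteGaloisGroup K) [Fact (ZpExtension.IsTopGeneratorPair κ₁ κ₂ γ₁ γ₂)]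
  [Module.Finite (IwasawaAlgebra₂ p) (W.XGr₂ p κ₁ κ₂ vbar γ₁ γ₂)]

/-- **THE (β) DOOR AT `W = unrIntegers p`, FAMILY BUILT** ((T1) by Weierstrass division §F7, (T2) by transport §F5):
for `s₀ : ℕ → ℤ_p⟦T⟧` with `s₀ n (0) ∈ pℤ_p` and (B) over `Λ₂` for `X − C(s₀ n)`, control data along
`θ_n = outerFam … n : (unrIntegers p)⟦T⟧⟦X⟧ ↠ (unrIntegers p)⟦T⟧` and the one-variable divisibilities
`θ_n g ∈ char(X_n)` for infinitely many `n` give the crux's conclusion for `G = u · map (map J₀) g`. Nothing here proves the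
crux: the ARITHMETIC (`φ_n`, `hX`, `h`) and the `W`-rationality of `G` are inputs (the three ring binders about
`unrIntegers p` are TREE THEOREMS — §F8 docblock — discharged by the consumer's `haveI`).
[cite: arXiv:1108.4708, Def. 8.1, Thm. 8.8; Washington1997, §7.1 Prop. 7.2; SkinnerUrban2014, Cor. 3.2.9 (ii) (p. 24);
YanZhu2024MainConjNonCM, statement 4.1 (2) (arXiv:2412.20078v4)] -/
theorem xGr₂_span_singleton_le_map_toUnr₂_of_frequently_outerFam_unr
    [Algebra ℤ_[p] (unrIntegers p)] [IsDiscreteValuationRing (unrIntegers p)]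
    [IsAdicComplete (IsLocalRing.maximalIdeal (PowerSeries (unrIntegers p))) (PowerSeries (unrIntegers p))]
    (hj : ∀ x : ℤ_[p], ((algebraMap ℤ_[p] (unrIntegers p) x : unrIntegers p) : ℂ_[p]) = ((x : ℚ_[p]) : ℂ_[p]))
    (hp : ¬ IsUnit ((p : ℕ) : unrIntegers p))
    (J : ℤ_[p] →+* PadicComplexInt p)
    (hJ : ∀ x : ℤ_[p], ((J x : PadicComplexInt p) : ℂ_[p]) = ((x : ℚ_[p]) : ℂ_[p]))
    (J₀ : unrIntegers p →+* PadicComplexInt p)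
    (hJ₀ : ∀ y : unrIntegers p, ((J₀ y : PadicComplexInt p) : ℂ_[p]) = (y : ℂ_[p]))
    {s₀ : ℕ → PowerSeries ℤ_[p]} (hs₀ : ∀ n, PowerSeries.constantCoeff (s₀ n) ∈ IsLocalRing.maximalIdeal ℤ_[p])
    (hB₀ : ∀ 𝔮 : Ideal (IwasawaAlgebra₂ p), 𝔮.IsPrime → 𝔮 ≠ IsLocalRing.maximalIdeal (IwasawaAlgebra₂ p) →
      ∀ᶠ n in Filter.cofinite, (PowerSeries.X - PowerSeries.C (s₀ n) : IwasawaAlgebra₂ p) ∉ 𝔮)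
    {g : PowerSeries (PowerSeries (unrIntegers p))}
    (F : ℕ → Type uF') [∀ n, AddCommGroup (F n)] [∀ n, Module (PowerSeries (unrIntegers p)) (F n)]
    (φ : ∀ n, PowerSeries (PowerSeries (unrIntegers p)) ⊗[IwasawaAlgebra₂ p] W.XGr₂ p κ₁ κ₂ vbar γ₁ γ₂
      →ₛₗ[outerFam hp s₀ hs₀ n] F n)
    (hφ : ∀ n, Function.Surjective (φ n))
    (hφk : ∀ n y, φ n y = 0 → y ∈ RingHom.ker (outerFam hp s₀ hs₀ n) •
      (⊤ : Submodule (PowerSeries (PowerSeries (unrIntegers p)))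
        (PowerSeries (PowerSeries (unrIntegers p)) ⊗[IwasawaAlgebra₂ p] W.XGr₂ p κ₁ κ₂ vbar γ₁ γ₂)))
    (X : ℕ → Type uX') [∀ n, AddCommGroup (X n)] [∀ n, Module (PowerSeries (unrIntegers p)) (X n)]
    (hX : ∀ n, Module.ArePseudoIsomorphic (PowerSeries (unrIntegers p)) (F n) (X n))
    (h : ∃ᶠ n in Filter.cofinite, outerFam hp s₀ hs₀ n g ∈ Module.charIdeal (PowerSeries (unrIntegers p)) (X n))
    {u : PowerSeries (PowerSeries (PadicComplexInt p))} (hu : IsUnit u) :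
    Ideal.span {u * PowerSeries.map (PowerSeries.map J₀) g} ≤
      (WeierstrassCurve.XGr₂.charIdeal W p κ₁ κ₂ vbar γ₁ γ₂).map (IwasawaAlgebra₂.toUnr₂ p J) := by
  refine xGr₂_span_singleton_le_map_toUnr₂_of_frequently_pushedFam_unr W κ₁ κ₂ vbar γ₁ γ₂ hj J hJ J₀ hJ₀
    (Λ' := PowerSeries (unrIntegers p)) (one_lt_height_maximalIdeal_powerSeries (unrIntegers p))
    (x₀ := fun n => (PowerSeries.X - PowerSeries.C (s₀ n) : IwasawaAlgebra₂ p)) hB₀ (θ := outerFam hp s₀ hs₀)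
    (fun n => outerChar_surjective (map_mem_maximalIdeal_powerSeries hp (hs₀ n))) (fun n => ?_) (fun n => ?_)
    F φ hφ hφk X hX h hu
  · show RingHom.ker (outerChar _ (map_mem_maximalIdeal_powerSeries hp (hs₀ n))) =
      Ideal.span {algebraMap (IwasawaAlgebra₂ p) _ (PowerSeries.X - PowerSeries.C (s₀ n) : IwasawaAlgebra₂ p)}
    rw [algebraMap_X_sub_C]
    exact ker_outerChar _
  · show Prime (algebraMap (IwasawaAlgebra₂ p) (PowerSeries (PowerSeries (unrIntegers p)))
      (PowerSeries.X - PowerSeries.C (s₀ n) : IwasawaAlgebra₂ p))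
    rw [algebraMap_X_sub_C]
    exact prime_X_sub_C (map_mem_maximalIdeal_powerSeries hp (hs₀ n))

end CruxAssemblyOuter

/-! ### §F9 (B) FOR THE OUTER-SOLVED FAMILY FROM (B) FOR THE INNER-SOLVED ONE: transport along the swap frame

`SplitsliceExt` §9 proves (B) over `Λ₂` for the INNER-solved deep graph members
`x_n = λ_{n, c_n} = (1+T₂) − c_n (1+T₁)^n = (1 + C X) − C (C c_n) · map C ((1+T)^n)` (`setOf_curveElt_mem_finite`,
`c_n = curveTwist n`, `‖c_n − 1‖ < 1`). The swap frame `σ = frameSubst ℤ_p swapFrame` (tree: an automorphism of `Λ₂`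
with `σ T₁ = T₂`, `σ T₂ = T₁`) carries `λ_{a,c}` to the OUTER-solved `X − C (c(1+T)^a − 1)` (`frameSubst_swapFrame_lineExpr`),
and (B) is invariant under ring automorphisms of a local ring (`fam_avoid_ringEquiv`). Hence the door of §F8 with
`s₀ n := c_n (1+T)^{a_n} − 1` takes (B) in EXACTLY the shape §9 of `SplitsliceExt` proves it (with `a_n = n`,
`c_n = curveTwist n`, after unfolding `curveElt`/`lineElt`/`bpow`): `…_of_frequently_curveFam_unr`. -/
section SwapTransport

variable {p : ℕ} [Fact p.Prime]

omit [Fact p.Prime] in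
/-- **(B) is invariant under ring automorphisms of a local ring**: `σ` permutes the non-maximal primes.
[cite: arXiv:1108.4708, Def. 8.1] -/
theorem fam_avoid_ringEquiv {A : Type*} [CommRing A] [IsLocalRing A] (σ : A ≃+* A) {x : ℕ → A}
    (hB : ∀ 𝔮 : Ideal A, 𝔮.IsPrime → 𝔮 ≠ IsLocalRing.maximalIdeal A → ∀ᶠ n in Filter.cofinite, x n ∉ 𝔮) :
    ∀ 𝔮 : Ideal A, 𝔮.IsPrime → 𝔮 ≠ IsLocalRing.maximalIdeal A → ∀ᶠ n in Filter.cofinite, σ (x n) ∉ 𝔮 := by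
  intro 𝔮 h𝔮 hne
  have hne' : 𝔮.comap σ ≠ IsLocalRing.maximalIdeal A := by
    intro heq
    apply hne
    have hle : IsLocalRing.maximalIdeal A ≤ 𝔮 := by
      intro y hy
      have hy' : σ.symm y ∈ IsLocalRing.maximalIdeal A := by
        rw [IsLocalRing.mem_maximalIdeal, mem_nonunits_iff] at hy ⊢
        intro hu
        exact hy (by simpa using hu.map σ)
      rw [← heq, Ideal.mem_comap] at hy'
      simpa using hy'
    exact ((IsLocalRing.maximalIdeal.isMaximal A).eq_of_le h𝔮.ne_top hle).symm
  haveI := h𝔮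
  exact (hB _ (Ideal.IsPrime.comap σ) hne').mono fun n hn hmem => hn (Ideal.mem_comap.mpr hmem)

/-- **The swap frame solves the deep graph member in the OUTER variable**:
`σ ((1+T₂) − d(1+T₁)^a) = X − C (d(1+T)^a − 1)` (`(1+T₁)^a = map C (binomialSeries a)`, as in the tree's
`frameSubst_onePlusT₁Pow`). [cite: NeukirchSchmidtWingberg2008, (5.3.5)] -/
theorem frameSubst_swapFrame_lineExpr (𝒪 : Type*) [CommRing 𝒪] [Algebra ℤ_[p] 𝒪] (a : ℤ_[p]) (d : 𝒪) :
    IwasawaAlgebra₂.frameSubst 𝒪 (IwasawaAlgebra₂.swapFrame (p := p))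
      ((1 + PowerSeries.C PowerSeries.X) - PowerSeries.C (PowerSeries.C d) *
        PowerSeries.map (PowerSeries.C (R := 𝒪)) (PowerSeries.binomialSeries 𝒪 a)) =
      PowerSeries.X - PowerSeries.C (PowerSeries.C d * PowerSeries.binomialSeries 𝒪 a - 1) := by
  rw [map_sub, map_add, map_one, map_mul, IwasawaAlgebra₂.frameSubst_swapFrame_C_X,
    IwasawaAlgebra₂.frameSubst_C_C, IwasawaAlgebra₂.frameSubst_onePlusT₁Pow, IwasawaAlgebra₂.val_swapFrame]
  simp only [Matrix.of_apply, Matrix.cons_val', Matrix.cons_val_zero, Matrix.cons_val_one, Matrix.cons_val_fin_one,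
    zero_mul, one_mul, PowerSeries.binomialSeries_zero, map_one, map_sub, map_mul]
  ring

/-- **The outer-solved inner series** `s_{a,c} := c(1+T)^a − 1 ∈ ℤ_p⟦T⟧` of the swapped member `σ(λ_{a,c}) = X − C s_{a,c}`.
[cite: arXiv:1108.4708, Def. 8.1] -/
noncomputable def swapSeries (a c : ℤ_[p]) : PowerSeries ℤ_[p] :=
  PowerSeries.C c * PowerSeries.binomialSeries ℤ_[p] a - 1

theorem swapSeries_def (a c : ℤ_[p]) :
    swapSeries a c = PowerSeries.C c * PowerSeries.binomialSeries ℤ_[p] a - 1 := rfl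

/-- `s_{a,c}(0) = c − 1`. [folklore] -/
theorem constantCoeff_swapSeries (a c : ℤ_[p]) : PowerSeries.constantCoeff (swapSeries a c) = c - 1 := by
  rw [swapSeries, map_sub, map_mul, map_one, PowerSeries.constantCoeff_C, PowerSeries.binomialSeries_constantCoeff,
    mul_one]

/-- `s_{a,c}(0) ∈ pℤ_p` when `‖c − 1‖ < 1` (the twists of `SplitsliceExt` §9 satisfy `‖c_n − 1‖ < 1`). [folklore] -/
theorem constantCoeff_swapSeries_mem (a : ℤ_[p]) {c : ℤ_[p]} (hc : ‖c - 1‖ < 1) :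
    PowerSeries.constantCoeff (swapSeries a c) ∈ IsLocalRing.maximalIdeal ℤ_[p] := by
  rw [constantCoeff_swapSeries, IsLocalRing.mem_maximalIdeal]
  exact PadicInt.mem_nonunits.mpr hc

/-- (B) over `Λ₂` for the outer-solved sequence `X − C s_{a_n,c_n}` from (B) for the inner-solved sequence
`λ_{a_n,c_n}` (the shape `SplitsliceExt` §9 proves). [cite: arXiv:1108.4708, Def. 8.1, Lemma 8.6] -/
theorem swap_avoid_of_avoid (a c : ℕ → ℤ_[p])
    (hB : ∀ 𝔮 : Ideal (IwasawaAlgebra₂ p), 𝔮.IsPrime → 𝔮 ≠ IsLocalRing.maximalIdeal (IwasawaAlgebra₂ p) →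
      ∀ᶠ n in Filter.cofinite, ((1 + PowerSeries.C PowerSeries.X) - PowerSeries.C (PowerSeries.C (c n)) *
        PowerSeries.map (PowerSeries.C (R := ℤ_[p])) (PowerSeries.binomialSeries ℤ_[p] (a n)) : IwasawaAlgebra₂ p) ∉ 𝔮) :
    ∀ 𝔮 : Ideal (IwasawaAlgebra₂ p), 𝔮.IsPrime → 𝔮 ≠ IsLocalRing.maximalIdeal (IwasawaAlgebra₂ p) →
      ∀ᶠ n in Filter.cofinite, (PowerSeries.X - PowerSeries.C (swapSeries (a n) (c n)) : IwasawaAlgebra₂ p) ∉ 𝔮 := by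
  intro 𝔮 h𝔮 hne
  refine (fam_avoid_ringEquiv (IwasawaAlgebra₂.frameSubst ℤ_[p] (IwasawaAlgebra₂.swapFrame (p := p))) hB 𝔮 h𝔮
    hne).mono fun n hn => ?_
  rwa [frameSubst_swapFrame_lineExpr] at hn

end SwapTransport

section CruxAssemblyCurve

open NumberField IsDedekindDomain

variable {p : ℕ} [Fact p.Prime]

/-- **The swapped deep family over `𝒪`**: `θ_n := outerChar (c_n (1+T)^{a_n} − 1)` on `𝒪⟦T⟧⟦X⟧`.
[cite: arXiv:1108.4708, Def. 8.1; Washington1997, §7.1 Prop. 7.2] -/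
@[reducible] noncomputable def curveFam {𝒪 : Type*} [CommRing 𝒪] [IsLocalRing 𝒪] [Algebra ℤ_[p] 𝒪]
    [IsAdicComplete (IsLocalRing.maximalIdeal (PowerSeries 𝒪)) (PowerSeries 𝒪)]
    (hp : ¬ IsUnit ((p : ℕ) : 𝒪)) (a c : ℕ → ℤ_[p]) (hc : ∀ n, ‖c n - 1‖ < 1) (n : ℕ) :
    PowerSeries (PowerSeries 𝒪) →+* PowerSeries 𝒪 :=
  outerFam hp (fun n => swapSeries (a n) (c n)) (fun n => constantCoeff_swapSeries_mem (a n) (hc n)) n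

universe uK uF' uX'

variable {K : Type uK} [Field K] [NumberField K] (W : WeierstrassCurve K)
  (κ₁ κ₂ : ZpExtension K p) (vbar : IsDedekindDomain.HeightOneSpectrum (NumberField.RingOfIntegers K))
  (γ₁ γ₂ : Field.absoluteGaloisGroup K) [Fact (ZpExtension.IsTopGeneratorPair κ₁ κ₂ γ₁ γ₂)]
  [Module.Finite (IwasawaAlgebra₂ p) (W.XGr₂ p κ₁ κ₂ vbar γ₁ γ₂)]

/-- **THE (β) DOOR AT `W = unrIntegers p` ALONG THE SWAPPED DEEP SEQUENCE, (B) IN `SplitsliceExt` §9's SHAPE**: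
directions `a_n ∈ ℤ_p`, twists `c_n` with `‖c_n − 1‖ < 1`, and (B) over `Λ₂` for the inner-solved members
`λ_{a_n,c_n} = (1+T₂) − c_n(1+T₁)^{a_n}` (for `a_n = n`, `c_n = curveTwist n` this is LITERALLY `SplitsliceExt`'s
`setOf_curveElt_mem_finite` after unfolding `curveElt = lineElt ↑n (curveTwist n)`, `lineElt`, `bpow`); the family is
`θ_n = curveFam … n` ((T1) §F7, (T2) §F5 + §F9). Inputs left: the ARITHMETIC (`φ_n`, `hX`, `h`) and the `W`-rationality
of `G = u · map (map J₀) g` (the three ring binders about `unrIntegers p` are TREE THEOREMS, §F8 docblock). Nothing here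
proves the crux.
[cite: arXiv:1108.4708, Def. 8.1, Lemma 8.6, Thm. 8.8; Washington1997, §7.1 Prop. 7.2; SkinnerUrban2014, Cor. 3.2.9 (ii)
(p. 24); YanZhu2024MainConjNonCM, statement 4.1 (2) (arXiv:2412.20078v4)] -/
theorem xGr₂_span_singleton_le_map_toUnr₂_of_frequently_curveFam_unr
    [Algebra ℤ_[p] (unrIntegers p)] [IsDiscreteValuationRing (unrIntegers p)]
    [IsAdicComplete (IsLocalRing.maximalIdeal (PowerSeries (unrIntegers p))) (PowerSeries (unrIntegers p))]
    (hj : ∀ x : ℤ_[p], ((algebraMap ℤ_[p] (unrIntegers p) x : unrIntegers p) : ℂ_[p]) = ((x : ℚ_[p]) : ℂ_[p]))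
    (hp : ¬ IsUnit ((p : ℕ) : unrIntegers p))
    (J : ℤ_[p] →+* PadicComplexInt p)
    (hJ : ∀ x : ℤ_[p], ((J x : PadicComplexInt p) : ℂ_[p]) = ((x : ℚ_[p]) : ℂ_[p]))
    (J₀ : unrIntegers p →+* PadicComplexInt p)
    (hJ₀ : ∀ y : unrIntegers p, ((J₀ y : PadicComplexInt p) : ℂ_[p]) = (y : ℂ_[p]))
    (a c : ℕ → ℤ_[p]) (hc : ∀ n, ‖c n - 1‖ < 1)
    (hB : ∀ 𝔮 : Ideal (IwasawaAlgebra₂ p), 𝔮.IsPrime → 𝔮 ≠ IsLocalRing.maximalIdeal (IwasawaAlgebra₂ p) →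
      ∀ᶠ n in Filter.cofinite, ((1 + PowerSeries.C PowerSeries.X) - PowerSeries.C (PowerSeries.C (c n)) *
        PowerSeries.map (PowerSeries.C (R := ℤ_[p])) (PowerSeries.binomialSeries ℤ_[p] (a n)) : IwasawaAlgebra₂ p) ∉ 𝔮)
    {g : PowerSeries (PowerSeries (unrIntegers p))}
    (F : ℕ → Type uF') [∀ n, AddCommGroup (F n)] [∀ n, Module (PowerSeries (unrIntegers p)) (F n)]
    (φ : ∀ n, PowerSeries (PowerSeries (unrIntegers p)) ⊗[IwasawaAlgebra₂ p] W.XGr₂ p κ₁ κ₂ vbar γ₁ γ₂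
      →ₛₗ[curveFam hp a c hc n] F n)
    (hφ : ∀ n, Function.Surjective (φ n))
    (hφk : ∀ n y, φ n y = 0 → y ∈ RingHom.ker (curveFam hp a c hc n) •
      (⊤ : Submodule (PowerSeries (PowerSeries (unrIntegers p)))
        (PowerSeries (PowerSeries (unrIntegers p)) ⊗[IwasawaAlgebra₂ p] W.XGr₂ p κ₁ κ₂ vbar γ₁ γ₂)))
    (X : ℕ → Type uX') [∀ n, AddCommGroup (X n)] [∀ n, Module (PowerSeries (unrIntegers p)) (X n)]
    (hX : ∀ n, Module.ArePseudoIsomorphic (PowerSeries (unrIntegers p)) (F n) (X n))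
    (h : ∃ᶠ n in Filter.cofinite, curveFam hp a c hc n g ∈ Module.charIdeal (PowerSeries (unrIntegers p)) (X n))
    {u : PowerSeries (PowerSeries (PadicComplexInt p))} (hu : IsUnit u) :
    Ideal.span {u * PowerSeries.map (PowerSeries.map J₀) g} ≤
      (WeierstrassCurve.XGr₂.charIdeal W p κ₁ κ₂ vbar γ₁ γ₂).map (IwasawaAlgebra₂.toUnr₂ p J) :=
  xGr₂_span_singleton_le_map_toUnr₂_of_frequently_outerFam_unr W κ₁ κ₂ vbar γ₁ γ₂ hj hp J hJ J₀ hJ₀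
    (s₀ := fun n => swapSeries (a n) (c n)) (fun n => constantCoeff_swapSeries_mem (a n) (hc n))
    (swap_avoid_of_avoid a c hB) F φ hφ hφk X hX h hu

end CruxAssemblyCurve

/-! ## §F11 THE SLACK DOOR AT `X_Gr,2` — the conclusion shape of the skeleton's `stub_ratEulerSystemSS` (v1.6, NEW)

§F10 at `A = W⟦T₁⟧⟦T₂⟧`, `N = W⟦T₁⟧⟦T₂⟧ ⊗_{Λ₂} X_Gr,2`, pushed to `𝒪_{ℂ_p}⟦T₁⟧⟦T₂⟧` by §F3/§F4 (`map (map ι) (d^a g) =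
(map (map ι) d)^a · map (map ι) g`). At `W = unrIntegers p` along the swapped deep family `curveFam` of §F9 and with `d = p`
(`map (map J₀) p = p`) the conclusion is `∃ a, Ideal.span {(p : 𝒪_{ℂ_p}⟦T₁⟧⟦T₂⟧)^a * G} ≤ (XGr₂.charIdeal …).map (toUnr₂ p J)`
for `G = u · map (map J₀) g` — LITERALLY (up to the name of the bound exponent) the conclusion of `Lines/ratlift.lean`'s
research stub `stub_ratEulerSystemSS` (the rational two-variable divisibility in the supersingular case; its `μ`-part is the
skeleton's `stub_howardIntegralSS` + Hsieh + Herbrand). PER-LINE INPUT NOW: `∃ t, p^t · θ_n(g) ∈ char_{W⟦T⟧}(X_n)` for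
infinitely many `n` — a one-variable divisibility WITH an unspecified `p`-power, i.e. exactly what a tempered / non-integral
one-variable Euler-system argument on the line `θ_n` delivers. Ring binders as in §F8/§F9 — ALL THREE ARE TREE THEOREMS
(V#26dj P1, V#26dm P2): `[IsDiscreteValuationRing (unrIntegers p)]` = `HidaLimitAlgebra.isDiscreteValuationRing_unrIntegers`
(`Summits/…/Rank1Residual/X2/HidaLimitCongruenceAlgebra.lean` :134), `¬ IsUnit (p : unrIntegers p)` =
`HidaLimitAlgebra.irreducible_natCast_p.not_isUnit` (:87), `[IsAdicComplete 𝔪 ((unrIntegers p)⟦T⟧)]` =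
`Literature.NumberTheory.GaloisRepresentations.powerSeries_isAdicComplete_maximalIdeal`
(`Literature/NumberTheory/GaloisRepresentations/PotentialDiagonalizabilityCriteriaProofs.lean` :1265) over
`Summit.BirchSwinnertonDyer.BirchSwinnertonDyer.Theorems.CongruentShaFreeCutUnrSeriesWeierstrass.isAdicComplete_maximalIdeal`
(`Summits/…/Theorems/CongruentShaFreeCutUnrSeriesWeierstrass.lean` :156); they stay binders only because this workfile imports
no `Summits` module (the consumer's three `haveI`). Nothing here proves the stub, the crux, the route or BSD.
[cite: arXiv:1108.4708, Thm. 8.8; SkinnerUrban2014, Cor. 3.2.9 (ii) (p. 24); YanZhu2024MainConjNonCM, statement 4.1 (2) (arXiv:2412.20078v4)] -/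

section CruxAssemblySlack

open NumberField IsDedekindDomain

variable {p : ℕ} [Fact p.Prime]

/-- **ANY structure map `ℤ_p → unrIntegers p` is injective** (a nonzero kernel would be `(p^n)` —
`IsDiscreteValuationRing.ideal_eq_span_pow_irreducible`, `PadicInt.irreducible_p` — and `p^n ≠ 0` in `ℂ_p`, characteristic
zero; the proof inlined in `…_fam_unr`, isolated for reuse, its compatibility hypothesis `hj` being unnecessary; v1.9: the
unused binder `[IsDiscreteValuationRing (unrIntegers p)]` dropped — critic V#26dn t1: the DVR used is `ℤ_[p]`'s).
[cite: Serre1979LocalFields, Ch. II §5] -/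
theorem algebraMap_unrIntegers_injective [Algebra ℤ_[p] (unrIntegers p)] :
    Function.Injective (algebraMap ℤ_[p] (unrIntegers p)) := by
  have hp0 : ((p : ℂ_[p])) ≠ 0 := Nat.cast_ne_zero.mpr (Fact.out : p.Prime).ne_zero
  rw [RingHom.injective_iff_ker_eq_bot]
  by_contra hne
  obtain ⟨n, hn⟩ := IsDiscreteValuationRing.ideal_eq_span_pow_irreducible hne PadicInt.irreducible_p
  have hmem : (p : ℤ_[p]) ^ n ∈ RingHom.ker (algebraMap ℤ_[p] (unrIntegers p)) := by
    rw [hn]; exact Ideal.mem_span_singleton_self _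
  rw [RingHom.mem_ker, map_pow, map_natCast] at hmem
  have h2 : ((p : ℂ_[p])) ^ n = 0 := by
    have h3 := congrArg (fun y : unrIntegers p => (y : ℂ_[p])) hmem
    simpa using h3
  exact pow_ne_zero n hp0 h2

universe uK uS uΛ uF' uX'

variable {K : Type uK} [Field K] [NumberField K] (W : WeierstrassCurve K)
  (κ₁ κ₂ : ZpExtension K p) (vbar : IsDedekindDomain.HeightOneSpectrum (NumberField.RingOfIntegers K))
  (γ₁ γ₂ : Field.absoluteGaloisGroup K) [Fact (ZpExtension.IsTopGeneratorPair κ₁ κ₂ γ₁ γ₂)]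
  [Module.Finite (IwasawaAlgebra₂ p) (W.XGr₂ p κ₁ κ₂ vbar γ₁ γ₂)]

/-- **THE SLACK (β) DOOR ASSEMBLED over `W⟦T₁⟧⟦T₂⟧`** (`W` any DVR with injective `ℤ_p → W`, `ι : W → 𝒪_{ℂ_p}` over `J`):
an abstract family `θ_n : W⟦T₁⟧⟦T₂⟧ ↠ Λ'` with (T1)+(B), `θ_n`-fibres `F_n` of `W⟦T₁⟧⟦T₂⟧ ⊗_{Λ₂} X_Gr,2` pseudo-isomorphic to
`X_n`, a slack element `d`, and `θ_n(d^{t_n} g) ∈ char_{Λ'}(X_n)` for INFINITELY MANY `n` ⇒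
`∃ a, ((map (map ι) d)^a · u · map (map ι) g) ≤ (XGr₂.charIdeal …).map (toUnr₂ p J)` for every unit `u`
(§F10 `fam_exists_span_singleton_le_charIdeal_of_frequently_of_arePseudoIsomorphic` + §F4 `…_of_baseChange_powerSeries`).
[cite: arXiv:1108.4708, Thm. 8.8; SkinnerUrban2014, Cor. 3.2.9 (ii) (p. 24); YanZhu2024MainConjNonCM, statement 4.1 (2) (arXiv:2412.20078v4)] -/
theorem xGr₂_exists_span_singleton_le_map_toUnr₂_of_frequently_fam_slack (J : ℤ_[p] →+* PadicComplexInt p)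
    (𝒪 : Type uS) [CommRing 𝒪] [IsDomain 𝒪] [IsDiscreteValuationRing 𝒪] [Algebra ℤ_[p] 𝒪]
    (hinj : Function.Injective (algebraMap ℤ_[p] 𝒪)) (ι : 𝒪 →+* PadicComplexInt p)
    (hι : ι.comp (algebraMap ℤ_[p] 𝒪) = J)
    {Λ' : Type uΛ} [CommRing Λ'] [IsDomain Λ'] [IsNoetherianRing Λ'] [IsLocalRing Λ'] [UniqueFactorizationMonoid Λ']
    (hΛ : 1 < (IsLocalRing.maximalIdeal Λ').height)
    {θ : ℕ → (PowerSeries (PowerSeries 𝒪) →+* Λ')} {x : ℕ → PowerSeries (PowerSeries 𝒪)}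
    (hθ : ∀ n, Function.Surjective (θ n)) (hker : ∀ n, RingHom.ker (θ n) = Ideal.span {x n})
    (hx : ∀ n, Prime (x n))
    (hB : ∀ 𝔮 : Ideal (PowerSeries (PowerSeries 𝒪)), 𝔮.IsPrime →
      𝔮 ≠ IsLocalRing.maximalIdeal (PowerSeries (PowerSeries 𝒪)) → ∀ᶠ n in Filter.cofinite, x n ∉ 𝔮)
    {d g : PowerSeries (PowerSeries 𝒪)}
    (F : ℕ → Type uF') [∀ n, AddCommGroup (F n)] [∀ n, Module Λ' (F n)]
    (φ : ∀ n, PowerSeries (PowerSeries 𝒪) ⊗[IwasawaAlgebra₂ p] W.XGr₂ p κ₁ κ₂ vbar γ₁ γ₂ →ₛₗ[θ n] F n)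
    (hφ : ∀ n, Function.Surjective (φ n))
    (hφk : ∀ n y, φ n y = 0 → y ∈ RingHom.ker (θ n) •
      (⊤ : Submodule (PowerSeries (PowerSeries 𝒪)) (PowerSeries (PowerSeries 𝒪) ⊗[IwasawaAlgebra₂ p] W.XGr₂ p κ₁ κ₂ vbar γ₁ γ₂)))
    (X : ℕ → Type uX') [∀ n, AddCommGroup (X n)] [∀ n, Module Λ' (X n)]
    (hX : ∀ n, Module.ArePseudoIsomorphic Λ' (F n) (X n))
    (h : ∃ᶠ n in Filter.cofinite, ∃ t : ℕ, θ n (d ^ t * g) ∈ Module.charIdeal Λ' (X n))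
    {u : PowerSeries (PowerSeries (PadicComplexInt p))} (hu : IsUnit u) :
    ∃ a : ℕ, Ideal.span {(PowerSeries.map (PowerSeries.map ι) d) ^ a * (u * PowerSeries.map (PowerSeries.map ι) g)} ≤
      (WeierstrassCurve.XGr₂.charIdeal W p κ₁ κ₂ vbar γ₁ γ₂).map (IwasawaAlgebra₂.toUnr₂ p J) := by
  haveI : UniqueFactorizationMonoid (PowerSeries (PowerSeries 𝒪)) :=
    Literature.NumberTheory.IwasawaTheory.uniqueFactorizationMonoid_powerSeries_powerSeries 𝒪
  obtain ⟨a, hg⟩ := fam_exists_span_singleton_le_charIdeal_of_frequently_of_arePseudoIsomorphic hθ hker hx hB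
    (height_maximalIdeal_powerSeries_powerSeries 𝒪) hΛ _ F φ hφ hφk X hX h
  refine ⟨a, ?_⟩
  have h1 := xGr₂_span_singleton_le_map_toUnr₂_of_baseChange_powerSeries W κ₁ κ₂ vbar γ₁ γ₂ J 𝒪 hinj ι hι hg hu
  rwa [map_mul, map_pow, mul_left_comm] at h1

/-- **THE SLACK (β) DOOR AT `W = unrIntegers p` ALONG THE SWAPPED DEEP SEQUENCE** (`θ_n = curveFam … n`, (T1) by
Weierstrass division §F7, (T2) by transport §F5 + swap §F9, (B) over `Λ₂` in EXACTLY `SplitsliceExt` §9's shape — for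
`a_n = n`, `c_n = curveTwist n` its theorem `setOf_curveElt_mem_finite`, junction `rfl`), slack element ANY
`d ∈ (unrIntegers p)⟦T₁⟧⟦T₂⟧` (e.g. `p`, or `p · D` for a parasite `D`): `∃ t, θ_n(d^t g) ∈ char(X_n)` for infinitely many
`n` ⇒ `∃ e, ((map (map J₀) d)^e · u · map (map J₀) g) ≤ (XGr₂.charIdeal …).map (toUnr₂ p J)`. The three ring binders are
TREE THEOREMS (module docstring). Inputs left: the ARITHMETIC (`φ_n`, `hφk`, `hX`, the slack divisibilities `h`) and the
`W`-rationality `G = u · map (map J₀) g`. [cite: arXiv:1108.4708, Def. 8.1, Lemma 8.6, Thm. 8.8; Washington1997, §7.1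
Prop. 7.2; SkinnerUrban2014, Cor. 3.2.9 (ii) (p. 24); YanZhu2024MainConjNonCM, statement 4.1 (2) (arXiv:2412.20078v4)] -/
theorem xGr₂_exists_span_singleton_le_map_toUnr₂_of_frequently_curveFam_unr_slack
    [Algebra ℤ_[p] (unrIntegers p)] [IsDiscreteValuationRing (unrIntegers p)]
    [IsAdicComplete (IsLocalRing.maximalIdeal (PowerSeries (unrIntegers p))) (PowerSeries (unrIntegers p))]
    (hj : ∀ x : ℤ_[p], ((algebraMap ℤ_[p] (unrIntegers p) x : unrIntegers p) : ℂ_[p]) = ((x : ℚ_[p]) : ℂ_[p]))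
    (hp : ¬ IsUnit ((p : ℕ) : unrIntegers p))
    (J : ℤ_[p] →+* PadicComplexInt p)
    (hJ : ∀ x : ℤ_[p], ((J x : PadicComplexInt p) : ℂ_[p]) = ((x : ℚ_[p]) : ℂ_[p]))
    (J₀ : unrIntegers p →+* PadicComplexInt p)
    (hJ₀ : ∀ y : unrIntegers p, ((J₀ y : PadicComplexInt p) : ℂ_[p]) = (y : ℂ_[p]))
    (a c : ℕ → ℤ_[p]) (hc : ∀ n, ‖c n - 1‖ < 1)
    (hB : ∀ 𝔮 : Ideal (IwasawaAlgebra₂ p), 𝔮.IsPrime → 𝔮 ≠ IsLocalRing.maximalIdeal (IwasawaAlgebra₂ p) →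
      ∀ᶠ n in Filter.cofinite, ((1 + PowerSeries.C PowerSeries.X) - PowerSeries.C (PowerSeries.C (c n)) *
        PowerSeries.map (PowerSeries.C (R := ℤ_[p])) (PowerSeries.binomialSeries ℤ_[p] (a n)) : IwasawaAlgebra₂ p) ∉ 𝔮)
    {d g : PowerSeries (PowerSeries (unrIntegers p))}
    (F : ℕ → Type uF') [∀ n, AddCommGroup (F n)] [∀ n, Module (PowerSeries (unrIntegers p)) (F n)]
    (φ : ∀ n, PowerSeries (PowerSeries (unrIntegers p)) ⊗[IwasawaAlgebra₂ p] W.XGr₂ p κ₁ κ₂ vbar γ₁ γ₂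
      →ₛₗ[curveFam hp a c hc n] F n)
    (hφ : ∀ n, Function.Surjective (φ n))
    (hφk : ∀ n y, φ n y = 0 → y ∈ RingHom.ker (curveFam hp a c hc n) •
      (⊤ : Submodule (PowerSeries (PowerSeries (unrIntegers p)))
        (PowerSeries (PowerSeries (unrIntegers p)) ⊗[IwasawaAlgebra₂ p] W.XGr₂ p κ₁ κ₂ vbar γ₁ γ₂)))
    (X : ℕ → Type uX') [∀ n, AddCommGroup (X n)] [∀ n, Module (PowerSeries (unrIntegers p)) (X n)]
    (hX : ∀ n, Module.ArePseudoIsomorphic (PowerSeries (unrIntegers p)) (F n) (X n))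
    (h : ∃ᶠ n in Filter.cofinite, ∃ t : ℕ,
      curveFam hp a c hc n (d ^ t * g) ∈ Module.charIdeal (PowerSeries (unrIntegers p)) (X n))
    {u : PowerSeries (PowerSeries (PadicComplexInt p))} (hu : IsUnit u) :
    ∃ e : ℕ, Ideal.span {(PowerSeries.map (PowerSeries.map J₀) d) ^ e * (u * PowerSeries.map (PowerSeries.map J₀) g)} ≤
      (WeierstrassCurve.XGr₂.charIdeal W p κ₁ κ₂ vbar γ₁ γ₂).map (IwasawaAlgebra₂.toUnr₂ p J) := by
  have hp0 : ((p : ℕ) : unrIntegers p) ≠ 0 := fun h0 => by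
    have h1 : ((p : ℕ) : ℂ_[p]) = 0 := by
      have h2 := congrArg (fun y : unrIntegers p => (y : ℂ_[p])) h0
      simpa using h2
    exact Nat.cast_ne_zero.mpr (Fact.out : p.Prime).ne_zero h1
  have hι : J₀.comp (algebraMap ℤ_[p] (unrIntegers p)) = J :=
    RingHom.ext fun a => Subtype.ext (by rw [RingHom.comp_apply, hJ₀, hj, hJ])
  refine xGr₂_exists_span_singleton_le_map_toUnr₂_of_frequently_fam_slack W κ₁ κ₂ vbar γ₁ γ₂ J (unrIntegers p)
    algebraMap_unrIntegers_injective J₀ hι (Λ' := PowerSeries (unrIntegers p))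
    (one_lt_height_maximalIdeal_powerSeries (unrIntegers p)) (θ := curveFam hp a c hc)
    (x := fun n => algebraMap (IwasawaAlgebra₂ p) (PowerSeries (PowerSeries (unrIntegers p)))
      (PowerSeries.X - PowerSeries.C (swapSeries (a n) (c n)) : IwasawaAlgebra₂ p))
    (fun n => outerChar_surjective (map_mem_maximalIdeal_powerSeries hp (constantCoeff_swapSeries_mem (a n) (hc n))))
    (fun n => ?_) (fun n => ?_)
    (fam_avoid_powerSeries_of_avoid (unrIntegers p) hp0 (swap_avoid_of_avoid a c hB)) F φ hφ hφk X hX h hu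
  · show RingHom.ker (outerChar _ (map_mem_maximalIdeal_powerSeries hp (constantCoeff_swapSeries_mem (a n) (hc n)))) =
      Ideal.span {algebraMap (IwasawaAlgebra₂ p) _
        (PowerSeries.X - PowerSeries.C (swapSeries (a n) (c n)) : IwasawaAlgebra₂ p)}
    rw [algebraMap_X_sub_C]
    exact ker_outerChar _
  · show Prime (algebraMap (IwasawaAlgebra₂ p) (PowerSeries (PowerSeries (unrIntegers p)))
      (PowerSeries.X - PowerSeries.C (swapSeries (a n) (c n)) : IwasawaAlgebra₂ p))
    rw [algebraMap_X_sub_C]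
    exact prime_X_sub_C (map_mem_maximalIdeal_powerSeries hp (constantCoeff_swapSeries_mem (a n) (hc n)))

/-- **THE `p`-SLACK (β) DOOR AT `W = unrIntegers p` — `stub_ratEulerSystemSS`'s CONCLUSION SHAPE.** Slack element `d = p`
(`map (map J₀) p = p`), per-line input in the friendliest form `∃ t, p^t · θ_n(g) ∈ char_{(unrIntegers p)⟦T⟧}(X_n)` for
infinitely many `n` along `θ_n = curveFam … n`; output
`∃ e, Ideal.span {(p : 𝒪_{ℂ_p}⟦T₁⟧⟦T₂⟧)^e * (u · map (map J₀) g)} ≤ (XGr₂.charIdeal W p κ₁ κ₂ v̄ γ₁ γ₂).map (toUnr₂ p J)` — with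
`W := W.baseChange K` and `G = u · map (map J₀) g` the conclusion of `Lines/ratlift.lean`'s `stub_ratEulerSystemSS`. What it does
NOT supply: the arithmetic (`φ_n`, `hφk`, `hX`, `h`) and the `W`-rationality of `G`; nothing here proves the stub or the crux.
[cite: arXiv:1108.4708, Thm. 8.8; SkinnerUrban2014, Cor. 3.2.9 (ii) (p. 24); YanZhu2024MainConjNonCM, statement 4.1 (2) (arXiv:2412.20078v4)] -/
theorem xGr₂_exists_span_singleton_le_map_toUnr₂_of_frequently_curveFam_unr_pSlack
    [Algebra ℤ_[p] (unrIntegers p)] [IsDiscreteValuationRing (unrIntegers p)]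
    [IsAdicComplete (IsLocalRing.maximalIdeal (PowerSeries (unrIntegers p))) (PowerSeries (unrIntegers p))]
    (hj : ∀ x : ℤ_[p], ((algebraMap ℤ_[p] (unrIntegers p) x : unrIntegers p) : ℂ_[p]) = ((x : ℚ_[p]) : ℂ_[p]))
    (hp : ¬ IsUnit ((p : ℕ) : unrIntegers p))
    (J : ℤ_[p] →+* PadicComplexInt p)
    (hJ : ∀ x : ℤ_[p], ((J x : PadicComplexInt p) : ℂ_[p]) = ((x : ℚ_[p]) : ℂ_[p]))
    (J₀ : unrIntegers p →+* PadicComplexInt p)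
    (hJ₀ : ∀ y : unrIntegers p, ((J₀ y : PadicComplexInt p) : ℂ_[p]) = (y : ℂ_[p]))
    (a c : ℕ → ℤ_[p]) (hc : ∀ n, ‖c n - 1‖ < 1)
    (hB : ∀ 𝔮 : Ideal (IwasawaAlgebra₂ p), 𝔮.IsPrime → 𝔮 ≠ IsLocalRing.maximalIdeal (IwasawaAlgebra₂ p) →
      ∀ᶠ n in Filter.cofinite, ((1 + PowerSeries.C PowerSeries.X) - PowerSeries.C (PowerSeries.C (c n)) *
        PowerSeries.map (PowerSeries.C (R := ℤ_[p])) (PowerSeries.binomialSeries ℤ_[p] (a n)) : IwasawaAlgebra₂ p) ∉ 𝔮)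
    {g : PowerSeries (PowerSeries (unrIntegers p))}
    (F : ℕ → Type uF') [∀ n, AddCommGroup (F n)] [∀ n, Module (PowerSeries (unrIntegers p)) (F n)]
    (φ : ∀ n, PowerSeries (PowerSeries (unrIntegers p)) ⊗[IwasawaAlgebra₂ p] W.XGr₂ p κ₁ κ₂ vbar γ₁ γ₂
      →ₛₗ[curveFam hp a c hc n] F n)
    (hφ : ∀ n, Function.Surjective (φ n))
    (hφk : ∀ n y, φ n y = 0 → y ∈ RingHom.ker (curveFam hp a c hc n) •
      (⊤ : Submodule (PowerSeries (PowerSeries (unrIntegers p)))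
        (PowerSeries (PowerSeries (unrIntegers p)) ⊗[IwasawaAlgebra₂ p] W.XGr₂ p κ₁ κ₂ vbar γ₁ γ₂)))
    (X : ℕ → Type uX') [∀ n, AddCommGroup (X n)] [∀ n, Module (PowerSeries (unrIntegers p)) (X n)]
    (hX : ∀ n, Module.ArePseudoIsomorphic (PowerSeries (unrIntegers p)) (F n) (X n))
    (h : ∃ᶠ n in Filter.cofinite, ∃ t : ℕ, ((p : ℕ) : PowerSeries (unrIntegers p)) ^ t * curveFam hp a c hc n g ∈
      Module.charIdeal (PowerSeries (unrIntegers p)) (X n))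
    {u : PowerSeries (PowerSeries (PadicComplexInt p))} (hu : IsUnit u) :
    ∃ e : ℕ, Ideal.span {((p : ℕ) : PowerSeries (PowerSeries (PadicComplexInt p))) ^ e *
        (u * PowerSeries.map (PowerSeries.map J₀) g)} ≤
      (WeierstrassCurve.XGr₂.charIdeal W p κ₁ κ₂ vbar γ₁ γ₂).map (IwasawaAlgebra₂.toUnr₂ p J) := by
  have h1 := xGr₂_exists_span_singleton_le_map_toUnr₂_of_frequently_curveFam_unr_slack W κ₁ κ₂ vbar γ₁ γ₂ hj hp J hJ
    J₀ hJ₀ a c hc hB (d := ((p : ℕ) : PowerSeries (PowerSeries (unrIntegers p)))) (g := g) F φ hφ hφk X hX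
    (h.mono fun n hn => by
      obtain ⟨t, hn⟩ := hn
      refine ⟨t, ?_⟩
      rwa [map_mul, map_pow, map_natCast]) hu
  rwa [map_natCast] at h1

end CruxAssemblySlack

/-! ## §F12. The frame PIN (identity principle) and the `p`-slack door on the frame's own `G` ((β)(vi) split)

The crux quantifies over EVERY `G ∈ 𝒪_{ℂ_p}⟦T₁⟧⟦T₂⟧` in the Greenberg value frame `IsGreenbergLFunctionAnyRoot₂ … LK G` over a
Katz series `LK`; §F11's doors want `G = u · map (map J₀) g` with `g` `unrIntegers p`-rational ((β)(vi)). The frame PRESCRIBES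
the value of `G` at each admissible point in terms of `LK` alone, so two series in the same frame agree there
(`IsGreenbergLFunctionAnyRoot₂.hasValueAt₂` twice); the tree's identity principle for bounded two-variable series
(`IntSeries.eq_of_infinite_hasValueAt₂_eq_fibred`, [Gouvêa] Cor. 5.6.4 / [de Shalit] II.6.4) makes them EQUAL once the admissible
points are rich (fibred-infinite inside closed polydiscs of radius `< 1`). Hence (vi) = (vi-a) RICHNESS of the frame's
interpolation set (an arithmetic existence statement about everywhere-unramified Hecke characters of type `(−(m+1), n+1)`
with avatar through `(κ₁, κ₂)`, their CM newforms, continuations and `LK`-values — hypothesis `hrich`, NOT proved here) ∧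
(vi-b) existence of ONE `unrIntegers p`-rational-up-to-unit series in the frame (print: `𝓛_p^Gr ∈ Λ^{ur} = Λ ⊗̂ ℤ_p^{ur}`,
[YanZhu2024MainConjNonCM] §3.4; at supersingular `p` [BurungaleSkinnerTianWan2024] Thm. 4.19, preprint). -/

section FramePin

open NumberField IsDedekindDomain Field CongruenceSubgroup
  Literature.NumberTheory.GaloisRepresentations Literature.NumberTheory.EllipticCurves.ModularForms

variable {p : ℕ} [Fact p.Prime] {K : Type} [Field K] [NumberField K]

/-- **THE FRAME PIN.** Two series `G, G'` in the same Greenberg value frame over the same Katz series `LK` are EQUAL,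
provided the frame's admissible interpolation points are RICH: there are `ϖ ≠ 0`, `‖ϖ‖ < 1`, an infinite set `D₁` of first
coordinates of norm `≤ ‖ϖ‖`, and over each `c ∈ D₁` infinitely many second coordinates `y` of norm `≤ ‖ϖ_c‖ < 1`, such that
`(c, y) = (r(g₁) − 1, r(g₂) − 1)` for the avatar `r` (through `(κ₁, κ₂)`) of an everywhere-unramified Hecke character `ξ` of
type `(−(m+1), n+1)` admitting the frame's auxiliary data (a root `α` of the Hecke polynomial at `p`, a CM newform `θ` of
`ξ/N^{m+1}`, an entire continuation `L` of the Rankin–Selberg Euler product, an `LK`-value at `(0, r(g₂)² − 1)`). Proof: at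
each such point both series have THE SAME prescribed value (`IsGreenbergLFunctionAnyRoot₂.hasValueAt₂`), and the tree's
identity principle `IntSeries.eq_of_infinite_hasValueAt₂_eq_fibred` concludes. The richness is an INPUT (arithmetic).
[cite: Gouvea1993PadicNumbers, §5.6 Cor. 5.6.4; deShalit1987, II.6.4 proof (p. 85); YanZhu2024MainConjNonCM, Def. 3.11 with Thm. 3.9 (arXiv:2412.20078v4)] -/
theorem isGreenbergLFunctionAnyRoot₂_eq_of_rich {ι : PadicAlgCl p ≃+* ℂ} {v vbar : HeightOneSpectrum (𝓞 K)}
    {κ₁ κ₂ : ZpExtension K p} {g₁ g₂ : absoluteGaloisGroup K} {N : ℕ} {f : CuspForm (Gamma0 N) 2}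
    {D : ℕ} [NeZero D] {hK : ℕ} {LK G G' : PowerSeries (PowerSeries (PadicComplexInt p))}
    (hG : IsGreenbergLFunctionAnyRoot₂ ι v vbar κ₁ κ₂ g₁ g₂ f D hK LK G)
    (hG' : IsGreenbergLFunctionAnyRoot₂ ι v vbar κ₁ κ₂ g₁ g₂ f D hK LK G')
    (hrich : ∃ ϖ : ℂ_[p], ϖ ≠ 0 ∧ ‖ϖ‖ < 1 ∧ ∃ D₁ : Set (PadicComplexInt p), D₁.Infinite ∧
      (∀ c ∈ D₁, ‖(c : ℂ_[p])‖ ≤ ‖ϖ‖) ∧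
      ∀ c ∈ D₁, ∃ ϖ' : ℂ_[p], ϖ' ≠ 0 ∧ ‖ϖ'‖ < 1 ∧
        {y : ℂ_[p] | ‖y‖ ≤ ‖ϖ'‖ ∧
          ∃ (ξ : HeckeCharacter K) (r : FramedGaloisRep K (PadicAlgCl p) 1) (m n : ℕ) (α : ℂ)
            (θ : CuspForm (Gamma1 D) ((m + n + 3 : ℕ) : ℤ)) (L : ℂ → ℂ) (yK : ℂ_[p]),
            IsPAdicAvatarOf ι ξ r ∧ FactorsThroughPair κ₁ κ₂ r ∧
            (∀ w : HeightOneSpectrum (𝓞 K), ξ.IsUnramifiedAt w) ∧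
            ξ.HasInfinityType (fun _ ↦ -((m : ℤ) + 1)) (fun _ ↦ (n : ℤ) + 1) ∧
            α ^ 2 - cuspCoeff f p * α + p = 0 ∧
            IsCMNewformOf (ξ / HeckeCharacter.normCharacter K ^ (m + 1)) θ ∧
            Differentiable ℂ L ∧
            (∀ s : ℂ, (m : ℝ) + n + 3 < s.re → L s = rankinSelbergEulerProductHecke f ξ s) ∧
            IntSeries.HasValueAt₂ LK 0 (avatarValueAt r g₂ ^ 2 - 1) yK ∧
            ((c : ℂ_[p]) = avatarValueAt r g₁ - 1) ∧ y = avatarValueAt r g₂ - 1}.Infinite) :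
    G = G' := by
  obtain ⟨ϖ, hϖ0, hϖ, D₁, hD₁, hD₁ϖ, hfib⟩ := hrich
  refine IntSeries.eq_of_infinite_hasValueAt₂_eq_fibred hϖ0 hϖ hD₁ hD₁ϖ fun c hc => ?_
  obtain ⟨ϖ', hϖ'0, hϖ', hinf⟩ := hfib c hc
  refine ⟨ϖ', hϖ'0, hϖ', hinf.mono fun y hy => ⟨hy.1, ?_⟩⟩
  obtain ⟨ξ, r, m, n, α, θ, L, yK, hr, hκ, hunr, hinf', hα, hθ, hL, hL', hyK, hc', hy'⟩ := hy.2
  rw [hc', hy']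
  exact ⟨_, hG.hasValueAt₂ hr hκ hunr hinf' hα hθ hL hL' hyK, hG'.hasValueAt₂ hr hκ hunr hinf' hα hθ hL hL' hyK⟩

universe uF'' uX''

variable (W : WeierstrassCurve K)
  (κ₁ κ₂ : ZpExtension K p) (vbar : IsDedekindDomain.HeightOneSpectrum (NumberField.RingOfIntegers K))
  (γ₁ γ₂ : Field.absoluteGaloisGroup K) [Fact (ZpExtension.IsTopGeneratorPair κ₁ κ₂ γ₁ γ₂)]
  [Module.Finite (IwasawaAlgebra₂ p) (W.XGr₂ p κ₁ κ₂ vbar γ₁ γ₂)]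

/-- **THE `p`-SLACK (β) DOOR ON THE FRAME'S OWN `G`** — `stub_ratEulerSystemSS`'s conclusion for ANY `G` in the Greenberg value
frame over `LK` (as the crux quantifies), the `W`-rationality (vi) REPLACED by: (vi-a) a PIN hypothesis `hpin` (two series in
the frame over `LK` are equal — `isGreenbergLFunctionAnyRoot₂_eq_of_rich` discharges it from richness) and (vi-b) ONE
`unrIntegers p`-rational-up-to-unit member `u · map (map J₀) g` of the same frame (`hG₀`), plus §F11's arithmetic inputs for `g`
along `curveFam` (control `φ_n`/`hφk`/`hX`, slack divisibilities `h`). Nothing here proves the stub or the crux.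
[cite: arXiv:1108.4708, Thm. 8.8; SkinnerUrban2014, Cor. 3.2.9 (ii) (p. 24); YanZhu2024MainConjNonCM, Def. 3.11 / statement 4.1 (2) (arXiv:2412.20078v4); Gouvea1993PadicNumbers, §5.6 Cor. 5.6.4] -/
theorem xGr₂_exists_span_singleton_le_map_toUnr₂_of_frequently_curveFam_unr_pSlack_of_frame
    [Algebra ℤ_[p] (unrIntegers p)] [IsDiscreteValuationRing (unrIntegers p)]
    [IsAdicComplete (IsLocalRing.maximalIdeal (PowerSeries (unrIntegers p))) (PowerSeries (unrIntegers p))]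
    (hj : ∀ x : ℤ_[p], ((algebraMap ℤ_[p] (unrIntegers p) x : unrIntegers p) : ℂ_[p]) = ((x : ℚ_[p]) : ℂ_[p]))
    (hp : ¬ IsUnit ((p : ℕ) : unrIntegers p))
    (J : ℤ_[p] →+* PadicComplexInt p)
    (hJ : ∀ x : ℤ_[p], ((J x : PadicComplexInt p) : ℂ_[p]) = ((x : ℚ_[p]) : ℂ_[p]))
    (J₀ : unrIntegers p →+* PadicComplexInt p)
    (hJ₀ : ∀ y : unrIntegers p, ((J₀ y : PadicComplexInt p) : ℂ_[p]) = (y : ℂ_[p]))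
    (a c : ℕ → ℤ_[p]) (hc : ∀ n, ‖c n - 1‖ < 1)
    (hB : ∀ 𝔮 : Ideal (IwasawaAlgebra₂ p), 𝔮.IsPrime → 𝔮 ≠ IsLocalRing.maximalIdeal (IwasawaAlgebra₂ p) →
      ∀ᶠ n in Filter.cofinite, ((1 + PowerSeries.C PowerSeries.X) - PowerSeries.C (PowerSeries.C (c n)) *
        PowerSeries.map (PowerSeries.C (R := ℤ_[p])) (PowerSeries.binomialSeries ℤ_[p] (a n)) : IwasawaAlgebra₂ p) ∉ 𝔮)
    {g : PowerSeries (PowerSeries (unrIntegers p))}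
    (F : ℕ → Type uF'') [∀ n, AddCommGroup (F n)] [∀ n, Module (PowerSeries (unrIntegers p)) (F n)]
    (φ : ∀ n, PowerSeries (PowerSeries (unrIntegers p)) ⊗[IwasawaAlgebra₂ p] W.XGr₂ p κ₁ κ₂ vbar γ₁ γ₂
      →ₛₗ[curveFam hp a c hc n] F n)
    (hφ : ∀ n, Function.Surjective (φ n))
    (hφk : ∀ n y, φ n y = 0 → y ∈ RingHom.ker (curveFam hp a c hc n) •
      (⊤ : Submodule (PowerSeries (PowerSeries (unrIntegers p)))
        (PowerSeries (PowerSeries (unrIntegers p)) ⊗[IwasawaAlgebra₂ p] W.XGr₂ p κ₁ κ₂ vbar γ₁ γ₂)))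
    (X : ℕ → Type uX'') [∀ n, AddCommGroup (X n)] [∀ n, Module (PowerSeries (unrIntegers p)) (X n)]
    (hX : ∀ n, Module.ArePseudoIsomorphic (PowerSeries (unrIntegers p)) (F n) (X n))
    (h : ∃ᶠ n in Filter.cofinite, ∃ t : ℕ, ((p : ℕ) : PowerSeries (unrIntegers p)) ^ t * curveFam hp a c hc n g ∈
      Module.charIdeal (PowerSeries (unrIntegers p)) (X n))
    {u : PowerSeries (PowerSeries (PadicComplexInt p))} (hu : IsUnit u)
    -- the Greenberg value frame of the crux, over a Katz series `LK`, and the crux's OWN `G` in it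
    {ι : PadicAlgCl p ≃+* ℂ} {v : HeightOneSpectrum (𝓞 K)} {g₁ g₂ : absoluteGaloisGroup K} {N : ℕ}
    {f : CuspForm (Gamma0 N) 2} {D : ℕ} [NeZero D] {hK : ℕ} {LK G : PowerSeries (PowerSeries (PadicComplexInt p))}
    (hG : IsGreenbergLFunctionAnyRoot₂ ι v vbar κ₁ κ₂ g₁ g₂ f D hK LK G)
    -- (vi-b): ONE `unrIntegers p`-rational-up-to-unit series in the same frame
    (hG₀ : IsGreenbergLFunctionAnyRoot₂ ι v vbar κ₁ κ₂ g₁ g₂ f D hK LK (u * PowerSeries.map (PowerSeries.map J₀) g))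
    -- (vi-a): the frame pins its member (`isGreenbergLFunctionAnyRoot₂_eq_of_rich`)
    (hpin : ∀ G G' : PowerSeries (PowerSeries (PadicComplexInt p)),
      IsGreenbergLFunctionAnyRoot₂ ι v vbar κ₁ κ₂ g₁ g₂ f D hK LK G →
      IsGreenbergLFunctionAnyRoot₂ ι v vbar κ₁ κ₂ g₁ g₂ f D hK LK G' → G = G') :
    ∃ e : ℕ, Ideal.span {((p : ℕ) : PowerSeries (PowerSeries (PadicComplexInt p))) ^ e * G} ≤
      (WeierstrassCurve.XGr₂.charIdeal W p κ₁ κ₂ vbar γ₁ γ₂).map (IwasawaAlgebra₂.toUnr₂ p J) := by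
  rw [hpin G _ hG hG₀]
  exact xGr₂_exists_span_singleton_le_map_toUnr₂_of_frequently_curveFam_unr_pSlack W κ₁ κ₂ vbar γ₁ γ₂ hj hp J hJ
    J₀ hJ₀ a c hc hB F φ hφ hφk X hX h hu


/-- **RICHNESS FROM A GRID SUPPLY** ((vi-a) in the shape print produces it). If admissible interpolation data come as a
GRID `(ξ i j, r i j)` (`r i j` the `p`-adic avatar of the everywhere-unramified Hecke character `ξ i j` of type
`(−(m i j + 1), n i j + 1)`, factoring through `(κ₁, κ₂)`), each point carrying the frame's auxiliary data ((S2): a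
CM newform of `ξ/N^{m+1}`, an entire continuation of the Rankin–Selberg Euler product — the root `α` of the Hecke
polynomial `X² − a_p X + p` over `ℂ` is FREE, `IsAlgClosed.exists_root`), and the POINTS are spread ((S4): the first coordinate `r i j (g₁) − 1 = x i` depends on
`i` only and is injective in `i`, the second `r i j (g₂) − 1` is injective in `j`, all of norm `≤ ‖ϖ‖ < 1`), then the
richness hypothesis `hrich` of `isGreenbergLFunctionAnyRoot₂_eq_of_rich` holds (with `D₁ = range x`, `ϖ' = ϖ`). The
`LK`-value the frame asks for ((S3)) is FREE: an integral series has a value at every point of the open unit polydisc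
(tree `IntSeries.hasValueAt₂_tsum`) and `‖r(g₂)² − 1‖ < 1` (principal unit; ultrametric inequality) — proved inside.
Otherwise bookkeeping (`Set.infinite_range_of_injective`); the supply (S1), (S2), (S4) is the arithmetic input, NOT proved
here.
[cite: YanZhu2024MainConjNonCM, Def. 3.11 (arXiv:2412.20078v4); deShalit1987, II.4.12–II.4.14, II.6.4 (p. 85)] -/
theorem rich_of_supply {ι : PadicAlgCl p ≃+* ℂ} {κ₁ κ₂ : ZpExtension K p} {g₁ g₂ : absoluteGaloisGroup K} {N : ℕ}
    {f : CuspForm (Gamma0 N) 2} {D : ℕ} [NeZero D] {LK : PowerSeries (PowerSeries (PadicComplexInt p))}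
    -- (S1) the grid of characters and avatars
    (ξ : ℕ → ℕ → HeckeCharacter K) (r : ℕ → ℕ → FramedGaloisRep K (PadicAlgCl p) 1) (m n : ℕ → ℕ → ℕ)
    (hr : ∀ i j, IsPAdicAvatarOf ι (ξ i j) (r i j)) (hκ : ∀ i j, FactorsThroughPair κ₁ κ₂ (r i j))
    (hunr : ∀ i j (w : HeightOneSpectrum (𝓞 K)), (ξ i j).IsUnramifiedAt w)
    (hinf : ∀ i j, (ξ i j).HasInfinityType (fun _ ↦ -((m i j : ℤ) + 1)) (fun _ ↦ (n i j : ℤ) + 1))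
    -- (S2) per-point auxiliary data of the frame
    (haux : ∀ i j, ∃ (θ : CuspForm (Gamma1 D) ((m i j + n i j + 3 : ℕ) : ℤ)) (L : ℂ → ℂ),
      IsCMNewformOf (ξ i j / HeckeCharacter.normCharacter K ^ (m i j + 1)) θ ∧
      Differentiable ℂ L ∧
      ∀ s : ℂ, (m i j : ℝ) + n i j + 3 < s.re → L s = rankinSelbergEulerProductHecke f (ξ i j) s)
    -- (S4) the points are spread inside the closed polydisc of radius `‖ϖ‖ < 1`
    {ϖ : ℂ_[p]} (hϖ0 : ϖ ≠ 0) (hϖ : ‖ϖ‖ < 1)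
    (x : ℕ → PadicComplexInt p) (hx : Function.Injective x)
    (hx₁ : ∀ i j, avatarValueAt (r i j) g₁ - 1 = (x i : ℂ_[p])) (hxϖ : ∀ i, ‖(x i : ℂ_[p])‖ ≤ ‖ϖ‖)
    (hy : ∀ i, Function.Injective fun j => avatarValueAt (r i j) g₂)
    (hyϖ : ∀ i j, ‖avatarValueAt (r i j) g₂ - 1‖ ≤ ‖ϖ‖) :
    ∃ ϖ : ℂ_[p], ϖ ≠ 0 ∧ ‖ϖ‖ < 1 ∧ ∃ D₁ : Set (PadicComplexInt p), D₁.Infinite ∧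
      (∀ c ∈ D₁, ‖(c : ℂ_[p])‖ ≤ ‖ϖ‖) ∧
      ∀ c ∈ D₁, ∃ ϖ' : ℂ_[p], ϖ' ≠ 0 ∧ ‖ϖ'‖ < 1 ∧
        {y : ℂ_[p] | ‖y‖ ≤ ‖ϖ'‖ ∧
          ∃ (ξ : HeckeCharacter K) (r : FramedGaloisRep K (PadicAlgCl p) 1) (m n : ℕ) (α : ℂ)
            (θ : CuspForm (Gamma1 D) ((m + n + 3 : ℕ) : ℤ)) (L : ℂ → ℂ) (yK : ℂ_[p]),
            IsPAdicAvatarOf ι ξ r ∧ FactorsThroughPair κ₁ κ₂ r ∧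
            (∀ w : HeightOneSpectrum (𝓞 K), ξ.IsUnramifiedAt w) ∧
            ξ.HasInfinityType (fun _ ↦ -((m : ℤ) + 1)) (fun _ ↦ (n : ℤ) + 1) ∧
            α ^ 2 - cuspCoeff f p * α + p = 0 ∧
            IsCMNewformOf (ξ / HeckeCharacter.normCharacter K ^ (m + 1)) θ ∧
            Differentiable ℂ L ∧
            (∀ s : ℂ, (m : ℝ) + n + 3 < s.re → L s = rankinSelbergEulerProductHecke f ξ s) ∧
            IntSeries.HasValueAt₂ LK 0 (avatarValueAt r g₂ ^ 2 - 1) yK ∧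
            ((c : ℂ_[p]) = avatarValueAt r g₁ - 1) ∧ y = avatarValueAt r g₂ - 1}.Infinite := by
  refine ⟨ϖ, hϖ0, hϖ, Set.range x, Set.infinite_range_of_injective hx, ?_, ?_⟩
  · rintro _ ⟨i, rfl⟩
    exact hxϖ i
  · rintro _ ⟨i, rfl⟩
    refine ⟨ϖ, hϖ0, hϖ, ?_⟩
    have hinj : Function.Injective fun j => avatarValueAt (r i j) g₂ - 1 := fun j j' h => hy i (by simpa using h)
    refine (Set.infinite_range_of_injective hinj).mono ?_
    rintro _ ⟨j, rfl⟩
    obtain ⟨θ, L, hθ, hL, hL'⟩ := haux i j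
    -- a root `α` of the Hecke polynomial `X² − a_p X + p` over `ℂ` is FREE (`ℂ` algebraically closed).
    obtain ⟨α, hα⟩ : ∃ α : ℂ, α ^ 2 - cuspCoeff f p * α + p = 0 := by
      have hdeg : (Polynomial.X ^ 2 - Polynomial.C (cuspCoeff f p) * Polynomial.X +
          Polynomial.C ((p : ℕ) : ℂ)).degree = 2 := by
        compute_degree!
      obtain ⟨α, hα⟩ := IsAlgClosed.exists_root
        (Polynomial.X ^ 2 - Polynomial.C (cuspCoeff f p) * Polynomial.X + Polynomial.C ((p : ℕ) : ℂ))
        (by rw [hdeg]; decide)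
      exact ⟨α, by simpa [Polynomial.IsRoot] using hα⟩
    -- (S3) is FREE: an integral two-variable series has a value at every point of the open unit polydisc
    -- (`IntSeries.hasValueAt₂_tsum`), and `‖r(g₂)² − 1‖ < 1` because `r(g₂)` is a principal unit.
    have hsq : ∀ a : ℂ_[p], ‖a - 1‖ < 1 → ‖a ^ 2 - 1‖ < 1 := fun a ha => by
      have ha1 : ‖a‖ ≤ 1 := by
        have h := IsUltrametricDist.norm_add_le_max (a - 1) 1
        rw [sub_add_cancel, norm_one] at h
        exact h.trans (max_le ha.le le_rfl)
      have h : a ^ 2 - 1 = (a - 1) * a + (a - 1) := by ring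
      rw [h]
      refine (IsUltrametricDist.norm_add_le_max _ _).trans_lt (max_lt ?_ ha)
      rw [norm_mul]
      calc ‖a - 1‖ * ‖a‖ ≤ ‖a - 1‖ * 1 := by gcongr
        _ < 1 := by rw [mul_one]; exact ha
    have hyK := IntSeries.hasValueAt₂_tsum (G := LK) (x := 0) (by simp)
      (hsq _ ((hyϖ i j).trans_lt hϖ))
    exact ⟨hyϖ i j, ξ i j, r i j, m i j, n i j, α, θ, L, _, hr i j, hκ i j, hunr i j, hinf i j, hα, hθ, hL, hL',
      hyK, (hx₁ i j).symm, rfl⟩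

/-- The frame PIN from a grid supply: `isGreenbergLFunctionAnyRoot₂_eq_of_rich` ∘ `rich_of_supply` (the composition
type-checks, so the two richness shapes agree literally). [cite: YanZhu2024MainConjNonCM, Def. 3.11 (arXiv:2412.20078v4); Gouvea1993PadicNumbers, §5.6 Cor. 5.6.4] -/
theorem isGreenbergLFunctionAnyRoot₂_eq_of_supply {ι : PadicAlgCl p ≃+* ℂ} {v vbar : HeightOneSpectrum (𝓞 K)}
    {κ₁ κ₂ : ZpExtension K p} {g₁ g₂ : absoluteGaloisGroup K} {N : ℕ} {f : CuspForm (Gamma0 N) 2}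
    {D : ℕ} [NeZero D] {hK : ℕ} {LK G G' : PowerSeries (PowerSeries (PadicComplexInt p))}
    (hG : IsGreenbergLFunctionAnyRoot₂ ι v vbar κ₁ κ₂ g₁ g₂ f D hK LK G)
    (hG' : IsGreenbergLFunctionAnyRoot₂ ι v vbar κ₁ κ₂ g₁ g₂ f D hK LK G')
    (ξ : ℕ → ℕ → HeckeCharacter K) (r : ℕ → ℕ → FramedGaloisRep K (PadicAlgCl p) 1) (m n : ℕ → ℕ → ℕ)
    (hr : ∀ i j, IsPAdicAvatarOf ι (ξ i j) (r i j)) (hκ : ∀ i j, FactorsThroughPair κ₁ κ₂ (r i j))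
    (hunr : ∀ i j (w : HeightOneSpectrum (𝓞 K)), (ξ i j).IsUnramifiedAt w)
    (hinf : ∀ i j, (ξ i j).HasInfinityType (fun _ ↦ -((m i j : ℤ) + 1)) (fun _ ↦ (n i j : ℤ) + 1))
    (haux : ∀ i j, ∃ (θ : CuspForm (Gamma1 D) ((m i j + n i j + 3 : ℕ) : ℤ)) (L : ℂ → ℂ),
      IsCMNewformOf (ξ i j / HeckeCharacter.normCharacter K ^ (m i j + 1)) θ ∧
      Differentiable ℂ L ∧
      ∀ s : ℂ, (m i j : ℝ) + n i j + 3 < s.re → L s = rankinSelbergEulerProductHecke f (ξ i j) s)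
    {ϖ : ℂ_[p]} (hϖ0 : ϖ ≠ 0) (hϖ : ‖ϖ‖ < 1)
    (x : ℕ → PadicComplexInt p) (hx : Function.Injective x)
    (hx₁ : ∀ i j, avatarValueAt (r i j) g₁ - 1 = (x i : ℂ_[p])) (hxϖ : ∀ i, ‖(x i : ℂ_[p])‖ ≤ ‖ϖ‖)
    (hy : ∀ i, Function.Injective fun j => avatarValueAt (r i j) g₂)
    (hyϖ : ∀ i j, ‖avatarValueAt (r i j) g₂ - 1‖ ≤ ‖ϖ‖) :
    G = G' :=
  isGreenbergLFunctionAnyRoot₂_eq_of_rich hG hG'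
    (rich_of_supply ξ r m n hr hκ hunr hinf haux hϖ0 hϖ x hx hx₁ hxϖ hy hyϖ)

end FramePin

section TwoCharacterSupply

open NumberField IsDedekindDomain Field CongruenceSubgroup
  Literature.NumberTheory.GaloisRepresentations Literature.NumberTheory.EllipticCurves.ModularForms
  Literature.NumberTheory.EllipticCurves

variable {p : ℕ} [Fact p.Prime] {K : Type} [Field K] [NumberField K]

/-- Ultrametric bookkeeping: `‖uv − 1‖ ≤ max ‖u − 1‖ ‖v − 1‖` for `‖u‖ ≤ 1` (`uv − 1 = u(v − 1) + (u − 1)`). [folklore] -/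
theorem norm_mul_sub_one_le {u v : ℂ_[p]} (hu : ‖u‖ ≤ 1) : ‖u * v - 1‖ ≤ max ‖u - 1‖ ‖v - 1‖ := by
  have h : u * v - 1 = u * (v - 1) + (u - 1) := by ring
  rw [h]
  calc ‖u * (v - 1) + (u - 1)‖ ≤ max ‖u * (v - 1)‖ ‖u - 1‖ := IsUltrametricDist.norm_add_le_max _ _
    _ ≤ max ‖v - 1‖ ‖u - 1‖ := by
        refine max_le_max ?_ le_rfl
        rw [norm_mul]
        exact mul_le_of_le_one_left (norm_nonneg _) hu
    _ = max ‖u - 1‖ ‖v - 1‖ := max_comm _ _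

/-- `‖u‖ ≤ 1` for a principal unit (`‖u − 1‖ < 1`). [folklore] -/
theorem norm_le_one_of_norm_sub_one_lt {u : ℂ_[p]} (hu : ‖u - 1‖ < 1) : ‖u‖ ≤ 1 := by
  have h : u = (u - 1) + 1 := by ring
  rw [h]
  refine (IsUltrametricDist.norm_add_le_max _ _).trans (max_le hu.le ?_)
  simp

/-- A principal unit is nonzero. [folklore] -/
theorem ne_zero_of_norm_sub_one_lt {u : ℂ_[p]} (hu : ‖u - 1‖ < 1) : u ≠ 0 := by
  rintro rfl
  simp at hu

/-- `‖u^{k+1} − 1‖ ≤ ‖u − 1‖` for `‖u‖ ≤ 1`. [folklore] -/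
theorem norm_pow_succ_sub_one_le {u : ℂ_[p]} (hu : ‖u‖ ≤ 1) (k : ℕ) : ‖u ^ (k + 1) - 1‖ ≤ ‖u - 1‖ := by
  induction k with
  | zero => simp
  | succ k ih =>
    rw [pow_succ']
    exact (norm_mul_sub_one_le hu).trans (max_le le_rfl ih)

/-- **Twist powers** `r^{⊗(k+1)}` of a rank-one framed `p`-adic representation: `r^{⊗1} = r`,
`r^{⊗(k+2)} = r^{⊗(k+1)} ⊗ det r` (the avatar of `A^{k+1}` when `r` is the avatar of `A`).
[cite: SerreAbelianLadic1968, Ch. I §2.3] -/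
noncomputable def twistPow (r : FramedGaloisRep K (PadicAlgCl p) 1) : ℕ → FramedGaloisRep K (PadicAlgCl p) 1
  | 0 => r
  | k + 1 => FramedRep.twist (twistPow r k) (detChar r)

omit [NumberField K] in
/-- Values of twist powers: `r^{⊗(k+1)}(g) = r(g)^{k+1}`. [cite: SerreAbelianLadic1968, Ch. I §2.3] -/
theorem avatarValueAt_twistPow (r : FramedGaloisRep K (PadicAlgCl p) 1) (g : absoluteGaloisGroup K) (k : ℕ) :
    avatarValueAt (twistPow r k) g = avatarValueAt r g ^ (k + 1) := by
  induction k with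
  | zero => simp [twistPow]
  | succ k ih => rw [twistPow, avatarValueAt_twist_detChar, ih, ← pow_succ']

omit [NumberField K] in
/-- Twist powers stay in the `ℤ_p²`-tower. [cite: deShalit1987, II.4.17 (54) (p. 78)] -/
theorem factorsThroughPair_twistPow {κ₁ κ₂ : ZpExtension K p} {r : FramedGaloisRep K (PadicAlgCl p) 1}
    (h : FactorsThroughPair κ₁ κ₂ r) (k : ℕ) : FactorsThroughPair κ₁ κ₂ (twistPow r k) := by
  induction k with
  | zero => simpa [twistPow] using h
  | succ k ih => exact factorsThroughPair_twist_detChar ih h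

/-- Powers of an everywhere-unramified Hecke character are everywhere unramified. [folklore] -/
theorem isUnramifiedAt_pow_succ {A : HeckeCharacter K} (hunr : ∀ w : HeightOneSpectrum (𝓞 K), A.IsUnramifiedAt w)
    (k : ℕ) (w : HeightOneSpectrum (𝓞 K)) : (A ^ (k + 1)).IsUnramifiedAt w := by
  induction k with
  | zero => simpa using hunr w
  | succ k ih =>
    rw [pow_succ']
    exact (hunr w).mul' ih

/-- **Serre's dictionary on powers**: if `r` is the `p`-adic avatar of the everywhere-unramified `A`, then `r^{⊗(k+1)}` is
the avatar of `A^{k+1}` (tree `IsPAdicAvatarOf.mul_twist`, iterated). [cite: SerreAbelianLadic1968, Ch. II §2.7] -/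
theorem isPAdicAvatarOf_twistPow {ι : PadicAlgCl p ≃+* ℂ} {A : HeckeCharacter K} {r : FramedGaloisRep K (PadicAlgCl p) 1}
    (hr : IsPAdicAvatarOf ι A r) (hunr : ∀ w : HeightOneSpectrum (𝓞 K), A.IsUnramifiedAt w) (k : ℕ) :
    IsPAdicAvatarOf ι (A ^ (k + 1)) (twistPow r k) := by
  induction k with
  | zero => simpa [twistPow] using hr
  | succ k ih =>
    rw [pow_succ', twistPow]
    exact IsPAdicAvatarOf.mul_twist ih hr fun v _ => hunr v

/-- Infinity type of a power (constant-exponent form of the tree's `HasInfinityType.zpow'`). [folklore] -/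
theorem hasInfinityType_pow_succ {A : HeckeCharacter K} {a b : ℤ}
    (h : A.HasInfinityType (fun _ ↦ a) (fun _ ↦ b)) (k : ℕ) :
    (A ^ (k + 1)).HasInfinityType (fun _ ↦ ((k : ℤ) + 1) * a) (fun _ ↦ ((k : ℤ) + 1) * b) := by
  induction k with
  | zero => simpa using h
  | succ k ih =>
    rw [pow_succ']
    convert h.mul' ih using 2 <;> (simp only [Pi.add_apply]; push_cast; ring)

/-- **THE TWO-CHARACTER SUPPLY ⇒ THE GRID SUPPLY ⇒ RICHNESS.** The richness hypothesis `hrich` of the frame PIN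
(`isGreenbergLFunctionAnyRoot₂_eq_of_rich`) from TWO everywhere-unramified Hecke characters `A` (type `(−a₁, a₂)`) and `B`
(type `(−b₁, b₂)`, `b₁, b₂ ≥ 1`) with `p`-adic avatars `rA`, `rB` through `(κ₁, κ₂)`, and THREE value conditions:
`rB(g₁) = 1` (B is "vertical" at `g₁`), and `rA(g₁)`, `rB(g₂)` of infinite order (their powers are injective). The grid is
`ξ_{ij} = B^{j+1}·A^{i+1}` with avatar `rA^{⊗(i+1)} ⊗ det rB^{⊗(j+1)}`, of type `(−(m_{ij}+1), n_{ij}+1)`,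
`m_{ij} + 1 = (i+1)a₁ + (j+1)b₁`, `n_{ij} + 1 = (i+1)a₂ + (j+1)b₂`; its points are `(rA(g₁)^{i+1} − 1, rB(g₂)^{j+1}rA(g₂)^{i+1} − 1)`:
first coordinate a function of `i`, injective; second injective in `j`; all in the closed disc of radius
`‖ϖ‖ = max(‖rA(g₁) − 1‖, ‖rA(g₂) − 1‖, ‖rB(g₂) − 1‖) < 1` (principal units: tree
`norm_avatarValueAt_sub_one_lt_of_factorsThroughPair`; ultrametric bookkeeping above). The per-point auxiliary data (S2) of the
frame (CM newform of `ξ_{ij}/N^{m_{ij}+1}`, entire Rankin–Selberg continuation) remain a hypothesis, now indexed by the grid.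
NOT proved here and genuinely arithmetic: the existence of such `A`, `B` (classically `A = Ψ^{−M}`, `B = (Ψ^c/Ψ)^{M}` for the
tree's everywhere-unramified `Ψ` of type `(h_K w_K, 0)` and the torsion-killing exponent `M`) and the three value conditions.
[cite: deShalit1987, II.4.12–II.4.14, II.4.17, II.6.4 (p. 85)] [cite: YanZhu2024MainConjNonCM, Def. 3.11 (arXiv:2412.20078v4)] -/
theorem rich_of_two_characters {ι : PadicAlgCl p ≃+* ℂ} {κ₁ κ₂ : ZpExtension K p} {g₁ g₂ : absoluteGaloisGroup K} {N : ℕ}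
    {f : CuspForm (Gamma0 N) 2} {D : ℕ} [NeZero D] {LK : PowerSeries (PowerSeries (PadicComplexInt p))}
    (A B : HeckeCharacter K) (rA rB : FramedGaloisRep K (PadicAlgCl p) 1)
    (hrA : IsPAdicAvatarOf ι A rA) (hrB : IsPAdicAvatarOf ι B rB)
    (hκA : FactorsThroughPair κ₁ κ₂ rA) (hκB : FactorsThroughPair κ₁ κ₂ rB)
    (hunrA : ∀ w : HeightOneSpectrum (𝓞 K), A.IsUnramifiedAt w)
    (hunrB : ∀ w : HeightOneSpectrum (𝓞 K), B.IsUnramifiedAt w)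
    (a₁ a₂ b₁ b₂ : ℕ) (hb₁ : 1 ≤ b₁) (hb₂ : 1 ≤ b₂)
    (htA : A.HasInfinityType (fun _ ↦ -(a₁ : ℤ)) (fun _ ↦ (a₂ : ℤ)))
    (htB : B.HasInfinityType (fun _ ↦ -(b₁ : ℤ)) (fun _ ↦ (b₂ : ℤ)))
    -- (S2) per grid point: the frame's auxiliary data for `ξ_{ij} = B^{j+1} A^{i+1}`
    (haux : ∀ i j : ℕ, ∃ (θ : CuspForm (Gamma1 D)
        ((((i + 1) * a₁ + (j + 1) * b₁ - 1) + ((i + 1) * a₂ + (j + 1) * b₂ - 1) + 3 : ℕ) : ℤ)) (L : ℂ → ℂ),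
      IsCMNewformOf (B ^ (j + 1) * A ^ (i + 1) / HeckeCharacter.normCharacter K ^ (((i + 1) * a₁ + (j + 1) * b₁ - 1) + 1)) θ ∧
      Differentiable ℂ L ∧
      ∀ s : ℂ, ((((i + 1) * a₁ + (j + 1) * b₁ - 1 : ℕ)) : ℝ) + (((i + 1) * a₂ + (j + 1) * b₂ - 1 : ℕ)) + 3 < s.re →
        L s = rankinSelbergEulerProductHecke f (B ^ (j + 1) * A ^ (i + 1)) s)
    -- (S4') the three value conditions
    (hB₁ : avatarValueAt rB g₁ = 1)
    (hA₁ : Function.Injective fun k : ℕ => avatarValueAt rA g₁ ^ k)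
    (hB₂ : Function.Injective fun k : ℕ => avatarValueAt rB g₂ ^ k) :
    ∃ ϖ : ℂ_[p], ϖ ≠ 0 ∧ ‖ϖ‖ < 1 ∧ ∃ D₁ : Set (PadicComplexInt p), D₁.Infinite ∧
      (∀ c ∈ D₁, ‖(c : ℂ_[p])‖ ≤ ‖ϖ‖) ∧
      ∀ c ∈ D₁, ∃ ϖ' : ℂ_[p], ϖ' ≠ 0 ∧ ‖ϖ'‖ < 1 ∧
        {y : ℂ_[p] | ‖y‖ ≤ ‖ϖ'‖ ∧ ∃ (ξ : HeckeCharacter K) (r : FramedGaloisRep K (PadicAlgCl p) 1) (m n : ℕ) (α : ℂ)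
            (θ : CuspForm (Gamma1 D) ((m + n + 3 : ℕ) : ℤ)) (L : ℂ → ℂ) (yK : ℂ_[p]),
            IsPAdicAvatarOf ι ξ r ∧ FactorsThroughPair κ₁ κ₂ r ∧
            (∀ w : HeightOneSpectrum (𝓞 K), ξ.IsUnramifiedAt w) ∧
            ξ.HasInfinityType (fun _ ↦ -((m : ℤ) + 1)) (fun _ ↦ (n : ℤ) + 1) ∧
            α ^ 2 - cuspCoeff f p * α + p = 0 ∧
            IsCMNewformOf (ξ / HeckeCharacter.normCharacter K ^ (m + 1)) θ ∧
            Differentiable ℂ L ∧ (∀ s : ℂ, (m : ℝ) + n + 3 < s.re → L s = rankinSelbergEulerProductHecke f ξ s) ∧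
            IntSeries.HasValueAt₂ LK 0 (avatarValueAt r g₂ ^ 2 - 1) yK ∧
            ((c : ℂ_[p]) = avatarValueAt r g₁ - 1) ∧ y = avatarValueAt r g₂ - 1}.Infinite := by
  -- the three principal units and the radius
  set uA₁ := avatarValueAt rA g₁ with huA₁
  set uA₂ := avatarValueAt rA g₂ with huA₂
  set uB₂ := avatarValueAt rB g₂ with huB₂
  have hA₁lt : ‖uA₁ - 1‖ < 1 := norm_avatarValueAt_sub_one_lt_of_factorsThroughPair hκA g₁
  have hA₂lt : ‖uA₂ - 1‖ < 1 := norm_avatarValueAt_sub_one_lt_of_factorsThroughPair hκA g₂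
  have hB₂lt : ‖uB₂ - 1‖ < 1 := norm_avatarValueAt_sub_one_lt_of_factorsThroughPair hκB g₂
  have hA₁le := norm_le_one_of_norm_sub_one_lt hA₁lt
  have hA₂le := norm_le_one_of_norm_sub_one_lt hA₂lt
  have hB₂le := norm_le_one_of_norm_sub_one_lt hB₂lt
  -- `uA₁ ≠ 1` (its powers are injective), so `uA₁ - 1 ≠ 0`
  have hA₁ne : uA₁ - 1 ≠ 0 := by
    intro h
    have h1 : uA₁ = 1 := sub_eq_zero.mp h
    have := @hA₁ 0 1 (by simp [h1])
    exact absurd this (by norm_num)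
  -- the radius: the largest of the three
  obtain ⟨ϖ, hϖ1, hϖ2, hϖ3, hϖlt, hϖ0⟩ : ∃ ϖ : ℂ_[p], ‖uA₁ - 1‖ ≤ ‖ϖ‖ ∧ ‖uA₂ - 1‖ ≤ ‖ϖ‖ ∧ ‖uB₂ - 1‖ ≤ ‖ϖ‖ ∧
      ‖ϖ‖ < 1 ∧ ϖ ≠ 0 := by
    classical
    obtain ⟨ϖ, hϖmem, hϖmax⟩ :=
      ({uA₁ - 1, uA₂ - 1, uB₂ - 1} : Finset ℂ_[p]).exists_max_image (fun z => ‖z‖) ⟨uA₁ - 1, by simp⟩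
    have hϖ1 : ‖uA₁ - 1‖ ≤ ‖ϖ‖ := hϖmax _ (by simp)
    refine ⟨ϖ, hϖ1, hϖmax _ (by simp), hϖmax _ (by simp), ?_, ?_⟩
    · simp only [Finset.mem_insert, Finset.mem_singleton] at hϖmem
      rcases hϖmem with rfl | rfl | rfl <;> assumption
    · intro h
      rw [h, norm_zero] at hϖ1
      exact hA₁ne (norm_le_zero_iff.mp hϖ1)
  -- the first coordinates are integral
  have hxmem : ∀ i : ℕ, uA₁ ^ (i + 1) - 1 ∈ PadicComplexInt p := fun i =>
    mem_padicComplexInt_iff.mpr (((norm_pow_succ_sub_one_le hA₁le i).trans hϖ1).trans hϖlt.le)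
  -- casts of the weights
  have hm : ∀ i j : ℕ, ((((i + 1) * a₁ + (j + 1) * b₁ - 1 : ℕ)) : ℤ) + 1 = (((i + 1) * a₁ + (j + 1) * b₁ : ℕ) : ℤ) := by
    intro i j
    exact_mod_cast Nat.sub_add_cancel (le_add_left (Nat.mul_pos (Nat.succ_pos j) hb₁))
  have hn : ∀ i j : ℕ, ((((i + 1) * a₂ + (j + 1) * b₂ - 1 : ℕ)) : ℤ) + 1 = (((i + 1) * a₂ + (j + 1) * b₂ : ℕ) : ℤ) := by
    intro i j
    exact_mod_cast Nat.sub_add_cancel (le_add_left (Nat.mul_pos (Nat.succ_pos j) hb₂))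
  -- values of the grid avatars
  have hval : ∀ (i j : ℕ) (g : absoluteGaloisGroup K),
      avatarValueAt (FramedRep.twist (twistPow rA i) (detChar (twistPow rB j))) g =
        avatarValueAt rB g ^ (j + 1) * avatarValueAt rA g ^ (i + 1) := fun i j g => by
    rw [avatarValueAt_twist_detChar, avatarValueAt_twistPow, avatarValueAt_twistPow]
  refine rich_of_supply (LK := LK)
    (fun i j => B ^ (j + 1) * A ^ (i + 1))
    (fun i j => FramedRep.twist (twistPow rA i) (detChar (twistPow rB j)))
    (fun i j => (i + 1) * a₁ + (j + 1) * b₁ - 1) (fun i j => (i + 1) * a₂ + (j + 1) * b₂ - 1)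
    (fun i j => IsPAdicAvatarOf.mul_twist (isPAdicAvatarOf_twistPow hrA hunrA i) (isPAdicAvatarOf_twistPow hrB hunrB j)
      fun v _ => isUnramifiedAt_pow_succ hunrB j v)
    (fun i j => factorsThroughPair_twist_detChar (factorsThroughPair_twistPow hκA i) (factorsThroughPair_twistPow hκB j))
    (fun i j w => (isUnramifiedAt_pow_succ hunrB j w).mul' (isUnramifiedAt_pow_succ hunrA i w))
    (fun i j => ?_) haux hϖ0 hϖlt (fun i => ⟨uA₁ ^ (i + 1) - 1, hxmem i⟩) ?_ ?_ ?_ ?_ ?_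
  · -- (S1) infinity types of the grid
    have h := (hasInfinityType_pow_succ htB j).mul' (hasInfinityType_pow_succ htA i)
    convert h using 2
    · simp only [Pi.add_apply]
      rw [hm]
      push_cast
      ring
    · simp only [Pi.add_apply]
      rw [hn]
      push_cast
      ring
  · -- first coordinates injective in `i`
    intro i i' h
    have h1 : uA₁ ^ (i + 1) - 1 = uA₁ ^ (i' + 1) - 1 := congrArg Subtype.val h
    have h2 : uA₁ ^ (i + 1) = uA₁ ^ (i' + 1) := sub_left_injective h1
    have h3 : i + 1 = i' + 1 := hA₁ h2
    omega
  · -- first coordinate = `rA(g₁)^{i+1} − 1`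
    intro i j
    rw [hval, ← huA₁, hB₁, one_pow, one_mul]
  · intro i
    exact (norm_pow_succ_sub_one_le hA₁le i).trans hϖ1
  · -- second coordinates injective in `j`
    intro i j j' h
    have h1 : uB₂ ^ (j + 1) * uA₂ ^ (i + 1) = uB₂ ^ (j' + 1) * uA₂ ^ (i + 1) := by
      simpa only [hval, ← huA₂, ← huB₂] using h
    have hne : uA₂ ^ (i + 1) ≠ 0 := pow_ne_zero _ (ne_zero_of_norm_sub_one_lt hA₂lt)
    have h2 : uB₂ ^ (j + 1) = uB₂ ^ (j' + 1) := mul_right_cancel₀ hne h1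
    have h3 : j + 1 = j' + 1 := hB₂ h2
    omega
  · -- second coordinates in the disc
    intro i j
    rw [hval, ← huA₂, ← huB₂]
    have hB : ‖uB₂ ^ (j + 1)‖ ≤ 1 := by
      rw [norm_pow]
      exact pow_le_one₀ (norm_nonneg _) hB₂le
    exact (norm_mul_sub_one_le hB).trans
      (max_le ((norm_pow_succ_sub_one_le hB₂le j).trans hϖ3) ((norm_pow_succ_sub_one_le hA₂le i).trans hϖ2))

end TwoCharacterSupply

end Summit.BirchSwinnertonDyer.BirchSwinnertonDyer.Cruxes.TwoVariableEulerSystemDivisibility.SplitsliceFam
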